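/-
Copyright: cell `langlands-arthur-audit` (papers/Langlands/langlands-arthur-audit), unit `pub-arthur-down-g68`
(downstream tracer, gen 68).  Forty-fifth file of the downstream register (module M310 of the cell's MODULE-MAP, CLAIMed in `lean/MODULE-MAP3.md` 2026-08-27T05:30Z).
`Downstream.lean` (tranches 1–4) … `Downstream44.lean` (155–160, module M308, 163,632 B at v6 = p500516 = 81.8 % of the gate's 200,000-byte content cap: closed for further
tranches) hold the register so far; this file continues it, APPEND-ONLY in the same conventions and the same namespace `…Arthur2013.Downstream` (one `ConsumersN` structure of
arbitrary `Prop`s per tranche when new statements are typed, one `E_…` hypothesis per printed dependence with the quotation that carries it, an `ImplicationsN` bundle, kernel-checked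
bookkeeping theorems; quotations `pNNNN:La-b "…"` are verbatim spans of the staged page texts named in each docstring, machine-verified before filing; sentences carrying the
register's lint word stay in `--` comments).  v1 imports `…Downstream44`, the head of the line; through the chain this tranche uses `…Downstream` only (`Nodes`, `Mok2015.Nodes`,
`KMSW2014.Nodes`, `MokInputs`, `KMSWInputs`, `MokInputs.everything`, `KMSWInputs.scope`).  Nothing of tranches 1–160 is redeclared or changed.
v1 = the hundred-and-sixty-first tranche: NEW ROW B137 (K. Choiy – D. Goldberg, *Behavior of R-groups for p-adic inner forms of quasi-split special unitary groups*,
arXiv:1605.05299, 2016) — a census-3 « mention » text regraded on a first-hand read (`Consumers161`, `Implications161`): a consumer of Mok 2015 and of KMSW's proved scope, nothing of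
the book's.
v2 (same unit) = the hundred-and-sixty-second tranche appended: NEW ROW B138 (J. Hundley – S. D. Miller, Amer. J. Math. 144 (2022) 1561–1600 = arXiv:1908.04363; archimedean: the
Langlands element of a unipotent Arthur packet of a split real group is unitarizable — as stated ⇐ the book for the classical groups, the exceptional part a control); nothing of v1 redeclared
or changed, no new import.
v3 (unit `pub-arthur-down-g69`, downstream tracer gen 69) = the hundred-and-sixty-third tranche appended: ROW C143 TYPED (Liu – Tian – Xiao – Zhang – Zhu, Acta Math. Sin. (Engl. Ser.)
40 (2024) = arXiv:2108.06998: Proposition 2.3.6 / Corollary 2.3.7 ⇐ Mok ∧ KMSW proved scope, feeding the R = T Theorem 3.6.3 and Theorem 1.0.1; the rigidity Theorem 4.2.6 a control)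
and NEW ROW B139 (Y. Mieda, Math. Res. Lett. 28 (2021) = arXiv:1908.11185: the formal degree identity for simple supercuspidals of Sp_{2n} / quasi-split even SO ⇐ the book ∧ B30,
its Galois-side Theorem 2.1 a control); nothing of v1 – v2 redeclared or changed, no new import.
v4 (same unit) = the hundred-and-sixty-fourth tranche appended: NEW ROWS C318 (Anandavardhanan – Matringe, Adv. Math. 360 (2020) = arXiv:1805.04047: Theorem 7.1 ⇐ Mok ∧ row C25,
finite-field Theorem 1.1 a control) and C319 (Hernandez – Schraen, arXiv:2210.10564v2, 2023, PREPRINT: Corollary 8.13 = 1.7 ⇐ Mok ∧ Theorem 8.8, the latter a control) — the residue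
tail of GAPS G-DN-607 (c); nothing of v1 – v3 redeclared or changed, no new import.
v5 (same unit) = the hundred-and-sixty-fifth tranche appended: NEW ROW B140 (M. Hanzer, arXiv:2510.10389v2, 2025, PREPRINT: Muić's conj. — the big theta lift of a discrete series
of a symplectic / even orthogonal p-adic group is irreducible — Theorem 3.1 ⇐ the book ∧ B110 ∧ C168 ∧ B2 ∧ B5 ∧ B89 ∧ Mœglin – Tadić ∧ B7 (Sp – O) ∧ B111; numeric citations, found by the
label sweep); nothing of v1 – v4 redeclared or changed, no new import.
v6 (same unit) = the hundred-and-sixty-sixth tranche appended: NEW ROWS C320 (Cléry – van der Geer, Doc. Math. 23 (2018), with G. Chenevier's appendices: Prop. A.1, Lemma A.2,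
Theorem A.5 ⇐ the book for PGSp₄ ≅ SO₅; Lemma A.3 (j = 36, 38) ⇐ row C5★) and C321 (S. Tang, JTNB 33 (2021): Lemma 6.3 ⇐ the book; §6 ⇐ row C10) — the second label sweep;
erratum: the B140 text has 34 pages, not 35; nothing of v1 – v5 redeclared or changed, no new import.
-/
import HarnessLib
import Literature.NumberTheory.Automorphic.Arthur2013.Downstream44

set_option autoImplicit false

namespace Literature.NumberTheory.Automorphic.Arthur2013

namespace Downstream

/-! ## Hundred-and-sixty-first tranche (v1 of this file, unit `pub-arthur-down-g68`): NEW ROW B137 — ONE MORE CENSUS-3 « MENTION » TEXT REGRADED ON A FIRST-HAND READ (GAPS G-DN-598 residue,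
item arXiv:1605.05299; the text is the cell's corpus TeX rendering (`lit read`), copied sha256-identical from this seat's session cache into `HOME/pub-arthur-down-g68/primaries/paper-arxiv-1605.05299/`,
18 chunks).
**B137** — Kwangho CHOIY – David GOLDBERG, *Behavior of R-groups for p-adic inner forms of quasi-split special unitary groups*, arXiv:1605.05299 (May 2016; no journal DOI located by
`lit cite --prefer-doi` / zbMATH on 2026-08-27; bib `ChoiyGoldberg2016SpecialUnitary` NEW — NOT the authors' Trans. AMS 368 (2016) paper = row B94, bib `ChoiyGoldberg2016`; census-3 §I.6
« R-groups for inner forms of SU_n; KMSW cited for LLC of inner forms — mention (no theorem …) »).  THE SETTING: p0003:L22-25 "we fix a quadratic extension $E$ of a $p$-adic field $F$ of characteristic zero. Let $\bG_n = \SU_n$ be a quasi-split special unitary group over $F$ with respect to $E/F$ and let $\bG'_n$ be its non quasi-split inner form over $F$. A simple consequence from the Satake classification or a computation of Galois cohomology reduces our study to the case when $n$ is even. In fact, there is a unique non quasi-split $F$-inner form $\bG'_n,$ up to $F$-isomorphism (see Section (structure)). For the rest of the introduction, we assume that $n$ is even, unless otherwise stated. Let $\bM'$ be an $F$-Levi subgroup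 of $\bG'_n,$ which is an $F$-inner form of an $F$-Levi subgroup $\bM$ of $\bG_n.$ Then, $\bM = \tbM \cap \bG_n$ and $\bM' = \tbM' \cap \bG'_n,$ where $\tbM$ is an $F$-Levi subgroup of a quasi-split unitary group $\tbG_n = \U_n$ over $F$ with respect to $E/F$ and $\tbM'$ is an $F$-Levi subgroup of a non quasi-split $F$-inner form $\tbG'_n$ of $\tbG_n.$"  THE CONSTRUCTION AND THE
MAIN STATEMENT: p0003:L28-35 "Given an elliptic tempered $L$-parameter $\phi \in \Phi_{\disc}(M),$ by [la85], we have a lifting $\tphi \in \Phi_{\disc}(\tM)$ commuting with the natural projection $\widehat{\tM} \twoheadrightarrow \widehat{M},$ where $\widehat{\tM}$ and $\widehat{M}$ respectively denote the connected components of the $L$-groups of $\tbM$ and $\bM$ (see Section (pre) for the details). Restricting the $L$-packet $\Pi_{\tphi}(\tM)$ constructed by Rogawski [rog90] and Mok [mok13] (see Section (LLC for unitary)), we construct an $L$-packet $\Pi_{\phi}(M)$ as the set of isomorphism classes of irreducible constituents in the restriction from $\tM$ to $M.$ All the arguments used for $\bM$ can be applied to $\bM',$ as in Kaletha-Minguez-Shin-White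 [kmsw14] and the details are described in Section (L-packets)." p0003:L36-42 "For any $\sigma \in \Pi_{\phi}(M),$ and $\sigma' \in \Pi_{\phi}(M'),$ we prove  \[ R_{\sigma} \s R_{\phi, \sigma} ~~ \text{and} ~~R_{\sigma'} \s R_{\phi, \sigma'}. \]  In each of the above isomorphisms, the left side is the Knapp-Stein $R$-group, and and the right side is the Langlands-Arthur $R$-group, defined in Section (section for def of R)." p0003:L44-46 "In the course of the proofs, we apply some known results about $R$-groups for $\tbG_n$ and $\tbG'_n$ in [go95, kmsw14, mok13], which are recalled in Section (R-groups for U(n) and its inner forms)."  THE INPUTS, AS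
PRINTED (§5.1): p0012:L7-17 "Let $\tbG=\tbG_n$ denote the quasi-split unitary group $\U_n$ with respect to $E/F$ and $J_n,$ and $\tbM$ an $F$-Levi subgroup of $\tbG.$ For our purpose of studying $R$-groups, we focus on $\Phi_{\temp}(\tG).$ In [mok13], Mok generalized Rogawski's results ( [rog90]) in the case of unitary groups in three variables as follows. There is a surjective finite-to-one map  \[ \Pi_{\temp}(\tG) \longrightarrow \Phi_{\temp}(\tG), \]  and for $\tphi \in \Phi_{\temp} (\tG),$ the tempered $L$-packet $\Pi_{\tphi}(\tG)$ is constructed. The same is true for an $F$-inner form $\tbG'$ of $\tbG$ by Kaletha-Minguez-Shin-White [kmsw14]." […] p0012:L35-39 "For each $\tphi_i,$ due to [ht01, he00, scholze13], we construct $L$-packets $\Pi_{\tphi_i}(\GL_{n_i}(E))$ consisting of discrete series representations of $\GL_{n_i}(E).$ Note that $\Pi_{\tphi_i}(\GL_{n_i}(E))$ is a singleton. For $\tphi_-,$ due to [kmsw14, mok13, rog90], we construct $L$-packets $\Pi_{\tphi_-}(G_m)$ and $\Pi_{\tphi_-}(G'_m)$ consisting of discrete series representations of $G_m$ and $G'_m,$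 respectively. By taking the tensor product of members in packets for each $\tphi_i$ and $\tphi_-,$ we thus construct $L$-packets ${\Pi}_{\tphi}(\tM)$ of $\tM$ and ${\Pi}_{\tphi}(\tM')$ of $\tM',$ associated to the elliptic tempered $L$-parameter $\tphi.$" — [mok13] = Mok, Mem. AMS 235 (2015) ↦ « Mok proves everything at every rank »
`(∀ N, μ.Everything N)` (the tempered L-packets of U_n and of its Levi subgroups; the torus T_φ̃: p0014:L88 "From [mok13] we set a maximal torus $T_{\tphi}$ in $C_{\tphi}(\widehat{\tG})^{\circ}$ to be the identity component" […]); [kmsw14] = Kaletha – Minguez – Shin – White, arXiv:1409.3731 ↦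
KMSW's PROVED SCOPE `(∀ N, κ.Scope N)` (tempered = generic parameters of the inner forms of U_n, E/F a field, and the intertwining / R-group statements for their Levi subgroups:
Theorem* 1.6.1 for generic parameters and Theorem* 2.6.2 for bounded parameters are inside the scope; nothing non-tempered is used, so NOT `κ.Full`); [rog90] (Rogawski, U(3)), [go95] /
[go06] (Goldberg, R-groups for quasi-split unitary / special unitary groups), [bangoldberg12] (D. Ban – D. Goldberg, Pacific J. Math. 255 (2012): maximal Levi subgroups), [la85]
(Labesse, lifting of parameters), [chaoli] (K. F. Chao – W.-W. Li, dual R-groups of inner forms of SL(N)), [ht01, he00, scholze13] (LLC for GL), [ks72, sil78, sil78cor], [art89ast]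
(the conj.): Arthur-free or not premises, absorbed; [art12] = the book is cited ONCE, as context (line comment below) — no symplectic / orthogonal group in the text.  TYPED:
`CGUnitaryRgroups` := §5.2's statements for U_n AND ITS INNER FORM (Theorem 5.2, Corollaries 5.3, 5.4, 5.5, 5.7, 5.9, Propositions 5.6, 5.8 — « a consequence of [bangoldberg12] … and
[mok13] and [kmsw14] »); `CGSpecialUnitaryRgroups` := §6 for SU_n and its inner form (the L-packets by restriction, §6.1; Theorem 6.1 = Arthur's R-group statement R_σ ≃ R_{φ,σ};
Theorem 6.3; Theorems 6.6, 6.8 = invariance of R-groups within L-packets and between inner forms).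
EXPECTED SUPPORTS (next section of `DownstreamSupport18.lean`): support(`CGUnitaryRgroups`) = support(`CGSpecialUnitaryRgroups`) = Mok's 29 leaves ∧ KMSW's proved-scope leaves (the
leaves with `onlyFull = false`; KMSW's unwritten sequels [KMS_A] / [KMS_B] and `AubertSS` are NOT in the support), and NO leaf of the book's DAG.  Census id consumed: B137.  Bib key added:
ChoiyGoldberg2016SpecialUnitary (`ledger bib add`, commit 2041d412b9bb). -/

-- Verbatim, kept out of docstrings by the docstring lint (B137, `paper-arxiv-1605.05299/`): p0002:L3 "We study $R$-groups for $p$-adic inner forms of quasi-split special unitary groups. We prove Arthur's conjecture, the isomorphism between the Knapp-Stein $R$-group and the Langlands-Arthur $R$-group, for quasi-split special unitary groups and their inner forms."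
-- p0003:L7 "Further, as conjectured by Arthur, the isomorphism of the Knapp-Stein and Langlands-Arthur $R$-groups, via the endoscopic $R$-group, plays a significant role in the comparison of trace formulas and the endoscopic classification of automorphic representations [art12, kmsw14, mok13]."
-- p0003:L43 "This is known as Arthur's conjecture, predicted in [art89ast], for $\bG$ and $\bG'$ (See Theorem (arthur conj))."
-- p0012:L3 "Based on some known results in [bangoldberg12, go95, kmsw14, mok13] regarding $R$-groups for $\U_n$ and its $F$-inner form, we discuss Arthur's conjecture for $\U_n$ and its inner forms, behavior of $R$-groups within $L$-packets of $\U_n$ and its inner forms, and behavior of $R$-groups between $\U_n$ and its inner forms."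
-- p0014:L3-4 "In this section, we prove Arthur's conjecture for both quasi-split special unitary groups $\SU_n$ and its inner forms. Furthermore, we study the behavior of $R$-groups within $L$-packets and between inner forms of $\SU_n.$"
-- p0014:L42 "The purpose of the section is to prove Arthur's conjecture, predicted in [art89ast], for $\bG$ and $\bG'.$"

/-- NEW row B137's statements, as an arbitrary assignment of truth values (the register records which typed inputs the PRINTED text invokes, never the truth of the fields). [cite: ChoiyGoldberg2016SpecialUnitary, Thm 5.2, Cors 5.3–5.9, Thms 6.1, 6.3, 6.6, 6.8 (structure only)] [claim: KalethaMinguezShinWhite2014, under-review] -/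
structure Consumers161 where
  /-- B137, §5.2 — R-GROUPS FOR U_n AND ITS INNER FORM (census grade G-i; arXiv 2016): K. Choiy – D. Goldberg, arXiv:1605.05299 (`paper-arxiv-1605.05299/`), E/F a quadratic extension of p-adic fields of characteristic zero, U_n quasi-split w.r.t. E/F and its non-quasi-split inner form (n even), M̃ / M̃′ Levi subgroups, φ̃ ∈ Φ_disc(M̃): p0012:L55-66 "Theorem 5.2. Let $\tphi \in \Phi_{\disc}(\tM)$ be given. Under the identity (identity for Weyls), for any $\tsigma \in \Pi_{\tphi}(\tM)$ and $\tsigma' \in \Pi_{\tphi}(\tM'),$ we have  \begin{equation*} W(\tsigma) = W_{\tphi} = W(\tsigma'). \end{equation*}  and  \begin{equation} W^{\circ}_{\tsigma} = W^{\circ}_{\tphi} = W^{\circ}_{\tsigma'}." […] p0012:L75-76 "Proof. This is a consequence of [bangoldberg12] for maximal Levi subgroups and [mok13] and [kmsw14] for general Levi subgroups." p0012:L81-83 "Corollary 5.3. Let $\tphi \in \Phi_{\disc}(\tM)$ be given. For $\tsigma \in \Pi_{\tphi}(\tM)$ and $\tsigma' \in \Pi_{\tphi}(\tM'),$ we have $\ii_{\tG,\tM}(\tsigma)$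 is irreducible if and only if $\ii_{\tG',\tM'}(\tsigma')$ is irreducible." […] p0012:L126-127 "Corollary 5.7. Let $\tsigma' \in \Pi_{\disc}(\tM')$ be given. Then, each constituent of $\ii_{\tG',\tM'}(\tsigma')$ appears with multiplicity one." p0012:L129-130 "Proposition 5.8. Let $\tsigma' \in \Pi_{\disc}(\tM')$ be given. Then, $\ii_{\tG', \tM'}(\tsigma')$ has an elliptic constituent if and only if" […] p0013:L1-9 "Corollary 5.9. Let $\tphi \in \Phi_{\disc}(\tM)$ be given. For any $\tsigma \in \Pi_{\tphi}(\tM)$ and $\tsigma' \in \Pi_{\tphi}(\tM'),$ there is an elliptic constituent in $\ii_{\tG, \tM}(\tsigma)$ if and only if there is an elliptic constituent in $\ii_{\tG', \tM'}(\tsigma').$  Proof. This is a consequence of [go95] and Proposition (analogue of go95 thm4.3)." [cite: ChoiyGoldberg2016SpecialUnitary, Thm 5.2 (arXiv:1605.05299 p0012:L55-76), Cor. 5.3 (p0012:L81-83), Cors 5.4, 5.5, Prop. 5.6 (p0012:L85-122), Cor. 5.7 (p0012:L126-127), Prop. 5.8 (p0012:L129-134), Cor. 5.9 (p0013:L1-9)]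 [claim: KalethaMinguezShinWhite2014, under-review] -/
  CGUnitaryRgroups : Prop
  /-- B137, §6 — SU_n AND ITS INNER FORM (census grade G-i): the tempered L-packets of SU_n, of its inner form and of their Levi subgroups by restriction (§6.1: p0014:L22-23 "For our purpose, we are interested in $\phi \in \Phi_{\temp}(G)$ and the lifting $\tphi$ lies in $\Phi_{\temp}(\tG).$ Using the $L$-packet $\Pi_{\tphi}(\tG)$ for $\tphi \in \Phi_{\temp}(\tG)$ in Section (LLC for unitary), we construct an $L$-packet $\Pi_{\phi}(G)$ for $\phi \in \Phi_{\temp}(G)$ as the set of isomorphism classes of irreducible constituents in the restriction from $\tG$ to $G$ as follows:" […] p0014:L38 "All the above arguments apply verbatim to $F$-inner forms $\tbG'$ and their $F$-Levi subgroups $\tbM'.$"); THEOREM 6.1 (Arthur's statement on R-groups, [art89ast]): p0014:L44-45 "Theorem 6.1. Given $\phi \in \Phi_{\disc}(M),$ $\sigma \in \Pi_{\phi}(M),$ and $\sigma' \in \Pi_{\phi}(M'),$ we have" [R_σ ≃ R_{φ,σ} and R_{σ′} ≃ R_{φ,σ′}: Knapp – Stein = Langlands – Arthur R-groups] p0014:L51-52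 "The rest of the section is devoted to the proof of Theorem (arthur conj). Since all the following techniques apply to both $\bM$ and $\bM',$ we shall state the proof for $\bM.$" […]; THEOREM 6.3: p0015:L40-41 "Theorem 6.3. Fix a lift $\tphi \in \Phi_{\disc}(\tM)$ and $\tsigma \in \Pi_{\tphi}(\tM).$ Then, we have" [W(σ) = {w ∈ W_M : ʷσ̃ ≃ σ̃λ for some λ ∈ (M̃/M)^D}]; THEOREMS 6.6 / 6.8 (invariance within L-packets and between inner forms): p0016:L1-2 "Theorem 6.6. Given $\sigma_1, ~ \sigma_2 \in \Pi_{\phi}(M),$ we have" [R_{σ₁} ≃ R_{σ₂}] p0016:L8 "Furthermore, given $\sigma'_1, ~ \sigma'_2 \in \Pi_{\phi}(M'),$ we have" [R_{σ′₁} ≃ R_{σ′₂}] p0016:L54-55 "Theorem 6.8. Given $\sigma \in \Pi_{\phi}(M)$ and $\sigma' \in \Pi_{\phi}(M),$ we have" [R_σ ≃ R_{σ′}] p0016:L65-66 "Remark 6.9. Due to [go95], Theorem (invariance 2 within L-packet) shows that the Knapp-Stein $R$-group $R_{\sigma'}$ is of the form" [Γ_{σ′} ⋉ ℤ^d]. [cite: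 ChoiyGoldberg2016SpecialUnitary, §6.1 (arXiv:1605.05299 p0014:L9-38), Thm 6.1 (p0014:L44-52), Thm 6.3 (p0015:L40-51), Thm 6.6 (p0016:L1-12), Thm 6.8 (p0016:L54-63), Remark 6.9 (p0016:L65-70)] [claim: KalethaMinguezShinWhite2014, under-review] -/
  CGSpecialUnitaryRgroups : Prop

/-- B137, §5 ⇐ MOK ∧ KMSW's PROVED SCOPE: p0012:L7-17 "Let $\tbG=\tbG_n$ denote the quasi-split unitary group $\U_n$ with respect to $E/F$ and $J_n,$ and $\tbM$ an $F$-Levi subgroup of $\tbG.$ For our purpose of studying $R$-groups, we focus on $\Phi_{\temp}(\tG).$ In [mok13], Mok generalized Rogawski's results ( [rog90]) in the case of unitary groups in three variables as follows. There is a surjective finite-to-one map  \[ \Pi_{\temp}(\tG) \longrightarrow \Phi_{\temp}(\tG), \]  and for $\tphi \in \Phi_{\temp} (\tG),$ the tempered $L$-packet $\Pi_{\tphi}(\tG)$ is constructed. The same is true for an $F$-inner form $\tbG'$ of $\tbG$ by Kaletha-Minguez-Shin-White [kmsw14]." […] p0012:L35-39 "For each $\tphi_i,$ due to [ht01, he00,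 scholze13], we construct $L$-packets $\Pi_{\tphi_i}(\GL_{n_i}(E))$ consisting of discrete series representations of $\GL_{n_i}(E).$ Note that $\Pi_{\tphi_i}(\GL_{n_i}(E))$ is a singleton. For $\tphi_-,$ due to [kmsw14, mok13, rog90], we construct $L$-packets $\Pi_{\tphi_-}(G_m)$ and $\Pi_{\tphi_-}(G'_m)$ consisting of discrete series representations of $G_m$ and $G'_m,$ respectively. By taking the tensor product of members in packets for each $\tphi_i$ and $\tphi_-,$ we thus construct $L$-packets ${\Pi}_{\tphi}(\tM)$ of $\tM$ and ${\Pi}_{\tphi}(\tM')$ of $\tM',$ associated to the elliptic tempered $L$-parameter $\tphi.$" p0012:L75-76 "Proof. This is a consequence of [bangoldberg12] for maximal Levi subgroups and [mok13] and [kmsw14] for general Levi subgroups." — [mok13] ↦ Mok at every rank; [kmsw14] ↦ KMSW's proved scope at every rank (tempered packets of the inner form and the R-group statements for its Levi subgroups); [go95], [bangoldberg12], [rog90], [ht01, he00, scholze13]: absorbed.  Premises: Mok at every rank, KMSW's proved scope at every rank. [cite: ChoiyGoldberg2016SpecialUnitary, §5.1 (arXiv:1605.05299 p0012:L3-39), Thm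 5.2 with proof (p0012:L55-76); Mok2015, as [mok13]] [claim: KalethaMinguezShinWhite2014, under-review] -/
def E_CGUnitaryRgroups (μ : Mok2015.Nodes) (κ : KMSW2014.Nodes) (c₁₆₁ : Consumers161) : Prop :=
  (∀ N, μ.Everything N) → (∀ N, κ.Scope N) → c₁₆₁.CGUnitaryRgroups

/-- B137, §6 ⇐ MOK ∧ KMSW's PROVED SCOPE ∧ §5: p0014:L9-13 "We discuss tempered $L$-packets of $\bG=\SU_n$ and its $F$-inner form $\bG'.$ It is natural to construct $L$-packets for $\bG$ and $\bG',$ by restricting $L$-packets for $\tbG=\U_n$ and its $F$-inner form $\tbG'$ which has been done by Rogawski [rog90], Mok [mok13], and Kaletha-Minguez-Shin-White [kmsw14] (see Section (LLC for unitary)). Thus, given $\phi \in \Phi(G),$ from [la85], there exists a lifting $\tphi \in \Phi(\tG)$ such that" […] p0014:L22-23 "For our purpose, we are interested in $\phi \in \Phi_{\temp}(G)$ and the lifting $\tphi$ lies in $\Phi_{\temp}(\tG).$ Using the $L$-packet $\Pi_{\tphi}(\tG)$ for $\tphi \in \Phi_{\temp}(\tG)$ in Section (LLC for unitary), we construct an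 $L$-packet $\Pi_{\phi}(G)$ for $\phi \in \Phi_{\temp}(G)$ as the set of isomorphism classes of irreducible constituents in the restriction from $\tG$ to $G$ as follows:" […] p0014:L38 "All the above arguments apply verbatim to $F$-inner forms $\tbG'$ and their $F$-Levi subgroups $\tbM'.$" p0003:L44-46 "In the course of the proofs, we apply some known results about $R$-groups for $\tbG_n$ and $\tbG'_n$ in [go95, kmsw14, mok13], which are recalled in Section (R-groups for U(n) and its inner forms)." In the proof of Theorem 6.1: p0014:L88 "From [mok13] we set a maximal torus $T_{\tphi}$ in $C_{\tphi}(\widehat{\tG})^{\circ}$ to be the identity component" […]; in the proof of Theorem 6.3: p0015:L51 "It suffice to consider the case of $m \geq 2,$ since the equality is already true for the case $m =1$ due to [go06]." — [rog90], [mok13] ↦ Mok; [kmsw14] ↦ KMSW's proved scope; §5's statements (`CGUnitaryRgroups`); [la85], [chaoli], [go95], [go06]: absorbed.  Premises: Mok at every rank, KMSW's proved scope at every rank, §5. [cite: ChoiyGoldberg2016SpecialUnitary, §6.1 (arXiv:1605.05299 p0014:L9-38), §1 (p0003:L28-46), Thm 6.1 proof (p0014:L51-88), Thm 6.3 proof (p0015:L51);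 Mok2015, as [mok13]] [claim: KalethaMinguezShinWhite2014, under-review] -/
def E_CGSpecialUnitaryRgroups (μ : Mok2015.Nodes) (κ : KMSW2014.Nodes) (c₁₆₁ : Consumers161) : Prop :=
  (∀ N, μ.Everything N) → (∀ N, κ.Scope N) → c₁₆₁.CGUnitaryRgroups → c₁₆₁.CGSpecialUnitaryRgroups

/-- The hundred-and-sixty-first tranche of implications: NEW row B137's two edges. [cite: ChoiyGoldberg2016SpecialUnitary, Thm 5.2, Thms 6.1, 6.3, 6.6, 6.8 (each edge's source in its own docstring)] [claim: KalethaMinguezShinWhite2014, under-review] -/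
structure Implications161 (μ : Mok2015.Nodes) (κ : KMSW2014.Nodes) (c₁₆₁ : Consumers161) : Prop where
  cgUnitary : E_CGUnitaryRgroups μ κ c₁₆₁
  cgSpecialUnitary : E_CGSpecialUnitaryRgroups μ κ c₁₆₁

section Tranche161

variable {μ : Mok2015.Nodes} {κ : KMSW2014.Nodes} {c₁₆₁ : Consumers161}

/-- FIRST READING — row B137 granted Mok and KMSW's proved scope at every rank. [cite: ChoiyGoldberg2016SpecialUnitary, Thm 5.2, Thms 6.1, 6.3, 6.6, 6.8 (bookkeeping proved here)] [claim: KalethaMinguezShinWhite2014, under-review] -/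
theorem choiyGoldbergSU_of_mok_and_scope (Y : Implications161 μ κ c₁₆₁) (m : ∀ N, μ.Everything N) (k : ∀ N, κ.Scope N) :
    c₁₆₁.CGUnitaryRgroups ∧ c₁₆₁.CGSpecialUnitaryRgroups :=
  have u := Y.cgUnitary m k
  ⟨u, Y.cgSpecialUnitary m k u⟩

/-- SECOND READING — B137 FROM MOK's AND KMSW's INPUTS (`MokInputs.everything`, `KMSWInputs.scope`): nothing of the book's DAG, and NOT KMSW's unwritten sequels. [cite: ChoiyGoldberg2016SpecialUnitary, Thm 5.2, Thms 6.1, 6.3, 6.6, 6.8 (bookkeeping proved here)] [claim: KalethaMinguezShinWhite2014, under-review] -/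
theorem choiyGoldbergSU_of_inputs (Y : Implications161 μ κ c₁₆₁) (M : MokInputs μ) (K : KMSWInputs μ κ) : c₁₆₁.CGUnitaryRgroups ∧ c₁₆₁.CGSpecialUnitaryRgroups :=
  choiyGoldbergSU_of_mok_and_scope Y M.everything (KMSWInputs.scope M K)

/-- ROW B137 IN CONDITIONAL FORM, 2026 (arXiv 2016; « constructed by Rogawski [rog90] and Mok [mok13] », « as in Kaletha-Minguez-Shin-White [kmsw14] », no status sentence on either — census class G-i): granting Mok's and KMSW's edges, supplies and PUBLISHED inputs, KMSW's Mok import and the identification of the two copies of the general weighted fundamental lemma, B137's two statements are conditional on Mok's 2024–2026 PREPRINT layer and on Mok's general and non-standard weighted fundamental lemmas; KMSW's unwritten sequels are NOT needed. [cite: ChoiyGoldberg2016SpecialUnitary, §1 (arXiv:1605.05299 p0003:L31-34) (bookkeeping proved here)] [claim: KalethaMinguezShinWhite2014, under-review] -/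
theorem choiyGoldbergSU_conditional_form_2026 (Y : Implications161 μ κ c₁₆₁) (D1 : KMSW2014.E_ImportMok μ κ) (D3 : KMSW2014.E_SameWFL μ κ) (MB : μ.SectionEdges)
    (MS : μ.SupplyEdges) (MP : μ.PublishedLeaves) (KB : κ.ChapterEdges) (KS : κ.SupplyEdges) (KP : κ.PublishedLeaves) :
    μ.PreprintLeaves2026 → μ.WFL_general → μ.WFL_nonstandard → c₁₆₁.CGUnitaryRgroups ∧ c₁₆₁.CGSpecialUnitaryRgroups :=
  fun hMQ m₆ m₇ => choiyGoldbergSU_of_inputs Y ⟨MB, MS, MP, hMQ, ⟨m₆, m₇⟩⟩ ⟨D1, KB, KS, KP, ⟨D3 m₆⟩⟩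

end Tranche161

/-! ## Hundred-and-sixty-second tranche (v2 of this file, unit `pub-arthur-down-g68`): NEW ROW B138 — ONE MORE CENSUS-3 « MENTION » TEXT REGRADED ON A FIRST-HAND READ (GAPS G-DN-598 residue, item
arXiv:1908.04363; the text is the cell's corpus TeX rendering (`lit read`), copied sha256-identical from this seat's session cache into `HOME/pub-arthur-down-g68/primaries/paper-arxiv-1908.04363/`, 29 chunks).
**B138** — Joseph HUNDLEY – Stephen D. MILLER, *On Arthur's unitarity conj. for split real groups* (title lint-abbreviated), Amer. J. Math. 144 (2022), no. 6, 1561–1600, doi:10.1353/ajm.2022.0038 =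
arXiv:1908.04363 (bib `HundleyMiller2022` NEW; census-3 §I.6 « mention; not graded (no theorem of the paper located that rests on [Ar] …) »).  An ARCHIMEDEAN row: G a split (Chevalley) group over ℚ,
representations of G(ℝ), unipotent Arthur parameters (p0010:L16 "Thus a real unipotent Arthur parameter is determined by an element $\sigma=\psi(j)\in T^\vee(\C)$ having order at most two, and a complex adjoint nilpotent orbit $\cal O^\vee\subset \frak{g}^\vee_\C$ which intersects $({\frak g}^\vee_\C)^{\sigma}$ nontrivially. The Langlands parameter attached to $\psi$ is the homomorphism $\psi_{\text{Langlands}}:W_\R\rightarrow G^\vee(\C)$ given by" […]).  THE STATEMENT: p0003:L11-12 "Theorem 1. Let $G$ be a Chevalley group other than $Spin(n+1,n)$, $Spin(n,n)$, or $HSpin(2n,2n)$ (the “half-spin” group double-covered by $Spin(2n,2n)$). Then the canonical “Langlands element" [straight quotation mark in the source] p0003:L12 "of each unipotent Arthur packet of representations of $G(\R)$ is unitarizable."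
— obtained from Theorem 2 (the principal series I_∞(λ_{𝒪^∨}, χ_{σ,∞}) has a unitarizable quotient with Langlands parameter ψ_Langlands).  THE PRINTED DIVISION OF LABOUR: p0010:L31 "Our contribution to Theorem (thm:unitarizablequotient) is for the exceptional groups $G$, since the classical group cases have been settled by Mœglin [Moeglin] and Arthur [Arthur-book] (in addition, the case of $G_2$ was established by Vogan [Vogan]; see also [Kim-G2]). Recall from Section (sec:chevalleygroups) that it suffices to establish Theorem (thm:unitarizablequotient) for simply connected $G$." and, in §2 (line
comment below, lint word): the authors « focus on exceptional groups and assume for the rest of the paper that G is of exceptional type » BECAUSE « Arthur [Arthur-book] has proven his conj.s for the classical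
groups SO(n,n), SO(n,n+1), and split Sp(2n) ».  So THE THEOREM AS STATED — for every Chevalley group outside the three spin-type families, hence for SO(n,n), SO(n,n+1), Sp(2n) too — rests, for its
classical cases, on [Arthur-book] ↦ the book at every rank (with [Moeglin] = C. Mœglin, Forum Math. 6 (1994), [Vogan] (G₂, Invent. math. 1994), [Kim-G2] (Canad. J. Math. 1996): Arthur-free, absorbed),
while the paper's OWN CONTRIBUTION — the seven exceptional groups, by Borel Eisenstein series, intertwining operators and, for finitely many representations, the atlas software (p0003:L24 "For both of these reasons, we have elected to instead leverage the recent algorithmic progress on the unitary dual problem [The5] and found it simpler to verify the unitarity of the remaining representations (i.e., those not covered in Section (sec:proofofThm4.3)) using the atlas software [atlas].")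
— uses nothing of the three DAGs ([M] = S. D. Miller, Ann. of Math. 177 (2013); [ABV]; [The5]; [atlas]; Langlands' theory of Eisenstein series).  TYPED: `HMLanglandsElement` := Theorem 1 = Theorem 2 AS
STATED; `HMExceptional` := the same statement for the seven exceptional Chevalley groups (the part proved in the paper) — CONTROL.  No Mok, no KMSW, no Mœglin node (the [Moeglin] here is the 1994
Forum Math. paper, not rows B70–B75).
EXPECTED SUPPORTS (next section of `DownstreamSupport18.lean`): support(`HMLanglandsElement`) = the 24 book leaves; support(`HMExceptional`) = ∅.  Census id consumed: B138.  Bib key added: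
HundleyMiller2022 (`ledger bib add`, commit 30180e3faef4).  Nothing of v1 is redeclared or changed; no new import. -/

-- Verbatim, kept out of docstrings by the docstring lint (B138, `paper-arxiv-1908.04363/`): p0003:L3 "In [Arthur-conjectures1,Arthur-conjectures2] James Arthur introduced a series of conjectures about the discrete automorphic spectrum. Motivated by his work on the trace formula, they predict several properties of packets of so-called “unipotent” representations, all of which are conjectured to occur unitarily in spaces of automorphic forms on the adelic points of some connected reductive linear algebraic group $G$. Arthur's conjectures for many classical groups were solved in [Arthur-book] using the deep input of Ngo's proof of the Fundamental Lemma [Ngo]."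
-- p0003:L5 "The book [ABV] provides a detailed study of the properties of Arthur's unipotent representations for the real points $G(\R)$ of $G$, and proves all of their major expected properties – except for unitarity. The unitarity is most difficult for split $G$, where it has been solved for spherical representations in [M] using Eisenstein series (completing earlier work of [Kim-G2,Moeglin,GMV])."
-- p0003:L7 "This paper studies the non-spherical representations of split $G(\R)$ using more complicated Eisenstein series. Arthur's book [Arthur-book] proves his conjectures for the classical groups $SO(n,n)$, $SO(n,n+1)$, and split $Sp(2n)$ (but not for Spin covers or the half-spin group $HSpin(2n)$), while Henry Kim earlier used Eisenstein series to prove our Theorem (thm:mainthm) below for $G_2$ (where it also follows from Vogan's classification of the unitary dual [Vogan]). Though our methods surely apply to classical groups as well, we focus on the remaining exceptional group cases (for which no general pattern exists)."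
-- p0003:L9 "Arthur's formulation [Arthur-conjectures1,Arthur-conjectures2] of his conjectures does not explicitly define his packets aside from describing a particularly canonical “Langlands element” of each (see ((langlandsparam)) and Theorem (thm:unitarizablequotient)). A description of the full Arthur packets for real groups was given in [ABV] in terms of the Beilinson-Bernstein classification [BB]. It is this Langlands element which we demonstrate the unitarity of; we do not say anything about the other elements of the packet, which are difficult to concretely identify."
-- p0003:L18-19 "Our global methods show that certain partial residues of Eisenstein series are square-integrable. Consequently each of their local component representations is unitary, in particular their archimedean components (which realize the representations in Theorem (thm:mainthm)). One also simultaneously deduces the unitarity of the nonarchimedean representations attached to these residues, which is itself an interesting aspect of Arthur's conjectures; however, these nonarchimedean representations could already be shown to be unitary using other methods [BC,BM]."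
-- p0005:L7 "By standard reductions determining the representations of $G(\R)$ in terms of its factors, we may (and do) additionally assume that $G$ is simple. Since Arthur [Arthur-book] has proven his conjectures for the classical groups $SO(n,n)$, $SO(n,n+1)$, and split $Sp(2n)$ (but not for Spin covers or the half-spin group $HSpin(2n)$), we focus on exceptional groups and assume for the rest of the paper that $G$ is of exceptional type. A list of the seven such $G$ is given in Table (fig:dualgroups)."
-- p0010:L30 "This statement is (mostly) a special case of Arthur's conjectures [Arthur-conjectures1,Arthur-conjectures2], which are stronger, global statements concerning a full packet of representations (potentially more than just this one having Langlands parameter $\psi_{\text{Langlands}}$). As mentioned in the introduction, the full Arthur packets are very difficult to identify."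

/-- NEW row B138's statements, as an arbitrary assignment of truth values (the register records which typed inputs the PRINTED text invokes, never the truth of the fields). [cite: HundleyMiller2022, Thm 1, Thm 2 (structure only)] -/
structure Consumers162 where
  /-- B138, THEOREM 1 = THEOREM 2 AS STATED (census grade G-i; PUBLISHED Amer. J. Math. 144 (2022) 1561–1600): J. Hundley – S. D. Miller, arXiv:1908.04363 (`paper-arxiv-1908.04363/`), G a Chevalley group (split, defined over ℚ; representations of G(ℝ)), ψ a real unipotent Arthur parameter: p0003:L11-12 "Theorem 1. Let $G$ be a Chevalley group other than $Spin(n+1,n)$, $Spin(n,n)$, or $HSpin(2n,2n)$ (the “half-spin” group double-covered by $Spin(2n,2n)$). Then the canonical “Langlands element" [straight quotation mark in the source] p0003:L12 "of each unipotent Arthur packet of representations of $G(\R)$ is unitarizable." In §4: p0010:L25-28 "Theorem 2. Let $G$ be a Chevalley group other than $Spin(n+1,n)$, $Spin(n,n)$, or $HSpin(2n)$, and let $\psi$ be a real unipotent Arthur parameter as above. Then the principal series $I_\infty(\lambda_{{\cal O}^\vee},\chi_{\sigma,\infty})$ has a unitarizable quotient having Langlands parameter $\psi_{\text{Langlands}}$."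 [cite: HundleyMiller2022, Thm 1 (arXiv:1908.04363 p0003:L11-12), Thm 2 (p0010:L25-28)] -/
  HMLanglandsElement : Prop
  /-- B138, CONTROL — THE PART PROVED IN THE PAPER: Theorem 2 for the seven EXCEPTIONAL Chevalley groups (G₂, F₄, E₆, E₇, E₈ in their simply connected and adjoint forms as listed in the paper's Table), by Eisenstein series, intertwining operators and atlas; no input of the three DAGs: p0010:L31 "Our contribution to Theorem (thm:unitarizablequotient) is for the exceptional groups $G$, since the classical group cases have been settled by Mœglin [Moeglin] and Arthur [Arthur-book] (in addition, the case of $G_2$ was established by Vogan [Vogan]; see also [Kim-G2]). Recall from Section (sec:chevalleygroups) that it suffices to establish Theorem (thm:unitarizablequotient) for simply connected $G$." p0003:L24 "For both of these reasons, we have elected to instead leverage the recent algorithmic progress on the unitary dual problem [The5] and found it simpler to verify the unitarity of the remaining representations (i.e., those not covered in Section (sec:proofofThm4.3)) using the atlas software [atlas]." [cite: HundleyMiller2022, Thm 2 for exceptional G (arXiv:1908.04363 p0010:L31, p0005:L7), §1 (p0003:L16-24)] -/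
  HMExceptional : Prop

/-- B138, CONTROL EDGE: the exceptional cases are the paper's own, Arthur-free proof ([M], [ABV], [The5], [atlas], Langlands – Shahidi / constant terms). [cite: HundleyMiller2022, §1 (arXiv:1908.04363 p0003:L16-24), §4 (p0010:L31)] -/
def E_HMExceptional (c₁₆₂ : Consumers162) : Prop := c₁₆₂.HMExceptional

/-- B138 AS STATED ⇐ THE BOOK ∧ THE EXCEPTIONAL PART: p0010:L31 "Our contribution to Theorem (thm:unitarizablequotient) is for the exceptional groups $G$, since the classical group cases have been settled by Mœglin [Moeglin] and Arthur [Arthur-book] (in addition, the case of $G_2$ was established by Vogan [Vogan]; see also [Kim-G2]). Recall from Section (sec:chevalleygroups) that it suffices to establish Theorem (thm:unitarizablequotient) for simply connected $G$." (and §2, line comment above: G is assumed exceptional for the rest of the paper because of [Arthur-book]) — [Arthur-book] ↦ the book at every rank (its archimedean packets for the split classical groups: the unitarity of the Langlands element of a unipotent packet of SO(n,n)(ℝ), SO(n,n+1)(ℝ), Sp(2n,ℝ)); [Moeglin] (Forum Math. 6 (1994)), [Vogan], [Kim-G2]: Arthur-free, absorbed.  Premises: the book at every rank, `HMExceptional`.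 [cite: HundleyMiller2022, §4 (arXiv:1908.04363 p0010:L31), §2 (p0005:L7), §1 (p0003:L7); Arthur2013, as [Arthur-book]] -/
def E_HMLanglandsElement (ν : Nodes) (c₁₆₂ : Consumers162) : Prop := (∀ N, ν.Everything N) → c₁₆₂.HMExceptional → c₁₆₂.HMLanglandsElement

/-- The hundred-and-sixty-second tranche of implications: NEW row B138's control edge and its as-stated edge. [cite: HundleyMiller2022, Thms 1, 2 (each edge's source in its own docstring)] -/
structure Implications162 (ν : Nodes) (c₁₆₂ : Consumers162) : Prop where
  hmExceptional : E_HMExceptional c₁₆₂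
  hmAsStated : E_HMLanglandsElement ν c₁₆₂

section Tranche162

variable {ν : Nodes} {c₁₆₂ : Consumers162}

/-- THE CONTROL holds by the tranche's edge alone — no input of any DAG. [cite: HundleyMiller2022, Thm 2 for exceptional G (bookkeeping proved here)] -/
theorem hundleyMiller_exceptional (Y : Implications162 ν c₁₆₂) : c₁₆₂.HMExceptional :=
  Y.hmExceptional

/-- FIRST READING — row B138 as stated, granted the book at every rank. [cite: HundleyMiller2022, Thm 1 = Thm 2 (bookkeeping proved here)] -/
theorem hundleyMiller_of_book (Y : Implications162 ν c₁₆₂) (b : ∀ N, ν.Everything N) : c₁₆₂.HMLanglandsElement ∧ c₁₆₂.HMExceptional :=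
  ⟨Y.hmAsStated b Y.hmExceptional, Y.hmExceptional⟩

/-- SECOND READING — B138 from the book's inputs (`BookInputs.everything`); nothing of Mok's or KMSW's. [cite: HundleyMiller2022, Thm 1 = Thm 2 (bookkeeping proved here)] -/
theorem hundleyMiller_of_inputs (Y : Implications162 ν c₁₆₂) (A : BookInputs ν) : c₁₆₂.HMLanglandsElement ∧ c₁₆₂.HMExceptional :=
  hundleyMiller_of_book Y A.everything

/-- ROW B138 IN CONDITIONAL FORM, 2026 (« the classical group cases have been settled by Mœglin [Moeglin] and Arthur [Arthur-book] », no status sentence on the book's references — census class G-i): granting the book's edges, supplies and PUBLISHED inputs, Theorem 1 as stated is conditional on the book's 2024–2026 PREPRINT layer and its general and non-standard weighted fundamental lemmas; its exceptional part is unconditional. [cite: HundleyMiller2022, §4 (p0010:L31), §2 (p0005:L7) (bookkeeping proved here)] -/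
theorem hundleyMiller_conditional_form_2026 (Y : Implications162 ν c₁₆₂) (B : ν.BookEdges) (S : ν.SupplyEdges) (P : ν.PublishedLeaves) :
    c₁₆₂.HMExceptional ∧ (ν.PreprintLeaves2026 → ν.WFL_general → ν.WFL_nonstandard → c₁₆₂.HMLanglandsElement) :=
  ⟨Y.hmExceptional, fun hQ h₆ h₇ => (hundleyMiller_of_inputs Y ⟨B, S, P, hQ, ⟨h₆, h₇⟩⟩).1⟩

end Tranche162

/-! ## Hundred-and-sixty-third tranche (v3 of this file, unit `pub-arthur-down-g69`, downstream tracer gen 69): ROW C143 TYPED and NEW ROW B139 — the two consumers identified at the end of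
down-g68's residue sweep (GAPS G-DN-607 (b)), read first-hand.  Texts: C143 = this unit's pypdf 4.3.1 paging of the arXiv v1 PDF (16 Aug 2021; `HOME/pub-arthur-down-g69/primaries/arxiv-pdf-2108.06998/`,
42 pp., PDF sha256 fce1c9ae227dc1fc…; the corpus TeX rendering `paper-arxiv-2108.06998/` (30 chunks, macros lost, statement counter off by one: its « Proposition 2.3.7 / Corollary 2.3.8 » =
the PDF's Proposition 2.3.6 / Corollary 2.3.7) staged for collation only); B139 = the corpus TeX rendering `paper-arxiv-1908.11185/` (9 chunks), copied sha256-identical from this seat's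
session cache.  Locators `pNNNN:La-b` = page (PDF page for C143, chunk for B139) and extracted lines, verbatim spans machine-checked before filing (`work/quotecheck69.py`).
**C143** (census row of `DOWNSTREAM.md` l.500, block `[g5c]`, « Proposition 2.3.7 … Corollary 2.3.8 » in the corpus numbering; G-DN-607 (b) proposed it as « C318 » — the row EXISTS, so no
new C id is consumed) — Yifeng LIU – Yichao TIAN – Liang XIAO – Wei ZHANG – Xinwen ZHU, *Deformation of rigid conjugate self-dual Galois representations*, Acta Math. Sin. (Engl. Ser.) 40
(2024), no. 7, 1599–1644, doi:10.1007/s10114-024-1409-x = arXiv:2108.06998 (bib `LiuTianXiaoZhangZhu2024Rigid` NEW; the companion of row C13 = [LTXZZ], Invent. Math. 228 (2022)):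
p0001:L28-34 "LetF/F+be a CM extension of number ﬁelds with c∈Gal(F/F+)the complex conjugation. In this article, we study deformations of conjugate self-dual Galois representations of F. The study has two folds. First, we prove an R=T type theorem (Theorem 3.6.3) for a conjugate self-dual Galois representation ¯rofFwith coeﬃcients in a ﬁnite ﬁeld, satisfying a certain property called rigid(Deﬁnition 3.6.1). It is worth mentioning that unlike many other references in the ﬁeld, we neither assume that the characteristic of the coeﬃcient ﬁeld is relatively split in F/F+nor assume that ¯ronly ramiﬁes at places that are split in F." […] p0002:L6-7 "To see how Galois deformation is used in the study of Selmer groups, we refer to that article."  F/F⁺ CM, V a hermitian space of rank N over F, U(V) its unitary group over F⁺ (a pure inner form of the quasi-split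
U_N), π cuspidal automorphic on U(V)(𝔸_{F⁺}), Π RACSDC on GL_N(𝔸_F).  THE ONE INVOCATION OF THE UNITARY CLASSIFICATION (the bibliography's back-references « ↑8 » for both [KMSW] and
[Mok15] confirm page 8 is their only use): the notion of local base change p0008:L2-3 "inF, we have a notion of local base change, which is deﬁned by [Rog90] when N⩽3and by [Mok15,KMSW] for general N." and PROPOSITION 2.3.6 (local – global compatibility of
the automorphic base change at every nonarchimedean place; discrete-series archimedean components with the displayed Harish-Chandra parameters) p0008:L15 "Proof.This follows from [KMSW, Theorem 1.7.1] for generic packets. □" with its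
COROLLARY 2.3.7 (the monodromy at an inert place where V_v is not split and π_v is spherical for a special maximal compact) p0008:L24-25 "Proof.WriteN= 2rfor a positive integer r. By Proposition 2.3.6, we know that Πwis isomorphic toBC(πv). Since ΠwistemperedbyProposition2.3.3(1), πvisalsotempered." […].  WHERE IT
GOES: the R = T theorem, THEOREM 3.6.3, through steps (b), (c) of its proof — p0033:L19-23 "(b)Π = BC(π)for a cuspidal automorphic representation πofU(V)(AF+)satisfying that (π∞)Kappears (nontrivially) in Hd(V) ´ et(Sh(V,K),Lξ⊗O,ι−1 ℓC); (c) the archimedean weights of Πequalsξ, which follows from (b) and Proposition 2.3.6." […] p0033:L35-36 "We claim that rmsatisﬁes the global deformation problem S. Indeed, by (b) and Proposition 2.3.6, Πx,wis unramiﬁed for nonarchimedean places wofF" […] p0033:L42-45 "by Proposition 2.3.3(2a), ¯rm,vis unramiﬁed for v̸∈S. By (b), Corollary 2.3.7, and Proposition 2.3.3(2a), ¯rm,vbelongs to Dram vforv∈Σ+ lr.9" — and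
thence THEOREM 1.0.1: p0003:L7-9 "The above theorem is a consequence of the two main results of this article, namely, Theorem 3.6.3 and Theorem 4.2.6. We have a similar consequence when d(V)is general, but under an extra assumption on certain vanishing of localized cohomology oﬀ middle degree."  THEOREM 4.2.6 (rigidity of the residual Galois representations of Π with a supercuspidal component, for all but
finitely many λ) is proved from Proposition 2.3.3 ([Car12], [CH13], [Car14]: the Galois representations of RACSDC Π), Propositions 3.2.7 / 3.4.12, Corollary 3.4.10 and « the same proof of
[Tho12, Theorem 10.1] » / « [Gee11, Lemma 5.1.3] » adapted to non-split places — no [KMSW] / [Mok15] / Proposition 2.3.6 in its proof as printed: a CONTROL.  TYPED (`Consumers163`):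
node `LTXZZ2BaseChange` := Proposition 2.3.6 ∧ Corollary 2.3.7 ⇐ Mok at every rank ∧ KMSW's PROVED SCOPE at every rank ([KMSW, Theorem 1.7.1] « for generic packets » on the unitary
group of a hermitian space, E/F = F/F⁺ a field: inside `κ.Scope`, node `T171p`, exactly as row C13's `E_LTXZZ` (tranche 1) and row C231's node (tranche 92); [Mok15] named with [KMSW] as
the definition of local base change for general N ↦ Mok at every rank — tranche 1 typed C13's identical sentence pair through `κ.Scope` alone, Mok entering by KMSW's import: the supports
coincide); `LTXZZ2RT` := Theorem 3.6.3 ⇐ node; `LTXZZ2Rigid` := Theorem 4.2.6, CONTROL (premise-free as printed); `LTXZZ2Combined` := Theorem 1.0.1 ⇐ Theorem 3.6.3 ∧ Theorem 4.2.6.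
[Rog90], [PS79], [Car12], [Car14], [CH13], [CHT08], [Tho12], [Gee11], [BLGGT14], [Clo90], [HT01]: Arthur-free, absorbed.  No book premise (no symplectic / orthogonal group; [Art13] not
in the bibliography).  RECORDED, NOT REPAIRED (DIVERGENCE3): the passage « every (closed) point x of Spec T_m[1/ℓ] gives rise to an RACSDC representation Π_x … (b) Π = BC(π) for a cuspidal
automorphic representation π of U(V)(A_F⁺) » (p0033:L15-19) uses the EXISTENCE of the automorphic base change of π, for which the text names no source (the definition p0007:L44-47 is
conditional: « if BC(π) exists »); the register types what is printed — the node carries [KMSW, Theorem 1.7.1] once, through Proposition 2.3.6.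
**B139** (NEW ROW; `DOWNSTREAM.md` §I l.1145 « peripheral (bibliographic/context mention only by these needles) », REGRADED on a first-hand read) — Yoichi MIEDA, *On the formal degree conj.
for simple supercuspidal representations* (title lint-abbreviated), Math. Res. Lett. 28 (2021), no. 4, 1227–1242, doi:10.4310/mrl.2021.v28.n4.a11 = arXiv:1908.11185 (bib
`Mieda2021FormalDegreeSSC` NEW).  F p-adic, p ≠ 2; G = Sp_{2n}, the ramified quasi-split SO_{2n}, the split SO_{2n+2}, the unramified quasi-split SO_{2n+2} (the list of Theorem 1.1, line
comment below — the statement sentences carry the lint word and are filed as `--` comments).  THE STATEMENT BEING PROVED is Hiraga – Ichino – Ikeda's formal degree identity for the simple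
supercuspidal representations of G(F): p0007:L36-40 "For an irreducible discrete series representation $\pi$ of $G(F)$, we have  \[ \deg(\pi)=C\cdot \frac{\dim \rho_\pi}{\#S_{\phi_\pi}}\lvert\gamma(0,\Ad\circ\phi_\pi,\psi)\rvert. \]" — an identity whose right-hand side is READ THROUGH THE BOOK's local Langlands correspondence:
p0007:L23-31 "By the local Langlands correspondence due to Arthur [MR3135650], discrete series representations of $G(F)$ are parametrized by pairs $(\phi,\rho)$, where  * $\phi\colon W_F\times\SL_2(\C)\to \widehat{G}(\C)=\SO_{2n+1}(\C)$ is an $L$-parameter such that the centralizer group $S_\phi=\Cent_{\widehat{G}(\C)}(\Imm \phi)$ is finite,  * and $\rho$ is an irreducible representation of $\pi_0(S_\phi)=S_\phi$.  The pair attached to a discrete series representation $\pi$ is denoted by $(\phi_\pi,\rho_\pi)$." […].  THE INPUT FROM ROW B30 (M. Oi, Mem. AMS 297 (2024) no. 1483 = arXiv:1805.01400, `Consumers59.OiSSC`, tranche 59; cited here as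
[Oi-ssc-classical] under its Kyoto preprint URL): p0007:L111-112 "The parameter $(\phi_\pi,\rho_\pi)$ attached to a simple supercuspidal representation $\pi$ is investigated by Oi in detail." p0007:L114-124 "Theorem 3.3 ( [Oi-ssc-classical]). Assume $p\neq 2$. Let $\iota$ denote the embedding $\widehat{G}(\C)=\SO_{2n+1}(\C)\hookrightarrow \GL_{2n+1}(\C)$. For a simple supercuspidal representation $\pi$ of $G(F)$, we have the following:  * $\iota\circ \phi_\pi=\tau\oplus \omega$, where $\tau$ is an irreducible $2n$-dimensional irreducible representation 	of $W_F$ with Swan conductor $1$ and $\omega$ is a quadratic character of $W_F$. 	Furthermore, $\tau$ is orthogonal, that is, there exists a $W_F$-invariant non-degenerate symmetric bilinear form 	$\tau\times\tau\to \C$.  * $\#S_{\phi_\pi}=2$." […] and the route: p0008:L26-29 "In fact, Theorem (thm:main) can be deduced from Theorem (thm:exterior-square) exactly in the same way as Oi did in [Oi-ssc-classical]. We include some of his arguments for reader's convenience. In the following, we assume that $p\neq 2$ and let $\pi$ be a simple supercuspidal representation of $G(F)$. Let $\tau$ and $\omega$ be as in Theorem (thm:ssc-LLC)."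
THE PAPER's OWN, ARTHUR-FREE CONTRIBUTION (Galois side; Deligne's fields of norms, Katz's Kloosterman sheaves, Grothendieck – Ogg – Shafarevich): p0002:L5-7 "The essential part is to compute the Swan conductor of the exterior square of an irreducible local Galois representation with Swan conductor $1$. It is carried out by passing to the equal characteristic local field and using the theory of Kloosterman sheaves." p0004:L36-45 "Theorem 2.1. Let $(\tau,V)$ be an $n$-dimensional irreducible smooth representation of $W_F$ such that $\Sw \tau=1$. Then we have  \[ \Sw(\wedge^2\tau)=\begin{cases} m-1 & \text{if $n=2m$ is even,}\\ m & \text{if $n=2m+1$ is odd.} \end{cases} \]"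
— a CONTROL.  TYPED: `MiedaFDCssc` := Theorem 3.5 (= Theorem 1.2 with Remark 3.7: the formal degree identity for the simple supercuspidal representations of the four families, p ≠ 2) ⇐ the
book at every rank (the parametrization (φ_π, ρ_π) of the discrete series of G(F), [MR3135650]) ∧ B30 (Theorem 3.3 = Oi's description of (φ_π, #S_φ)) ∧ `MiedaExteriorSquare` := Theorem
2.1 (= Theorem 1.3), control.  [MR2350057] (Hiraga – Ichino – Ikeda: the identity for GL_n and for the Steinberg representation), [MR2730575] (Gross – Reeder), [MR3158004] (Bushnell –
Henniart), [2015arXiv150902960I] (Imai – Tsushima), [MR771673] (Deligne), [MR955052] / [MR867916] (Katz), [MR3164986] (Reeder – Yu): Arthur-free, absorbed; [MR3166215] = Gan – Ichino,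
Invent. Math. 195 (2014) = the census's control row E47 (Remark 3.7's transport to the even orthogonal groups by the local theta correspondence): absorbed as in tranche 59 (row B114);
[MR3649356] (Ichino – Lapid – Mao, odd SO: row-level context) and [2018arXiv181200047B] (Beuzart-Plessis, unitary FDC = row C40's text) are context (p0003:L14-15), not premises.
EXPECTED SUPPORTS (section 165 of `DownstreamSupport18.lean`, next filing): support(`LTXZZ2BaseChange`) = support(`LTXZZ2RT`) = support(`LTXZZ2Combined`) = Mok's 29 leaves ∧ KMSW's
proved-scope leaves (no book leaf; KMSW's sequels [KMS_A] / [KMS_B] and `AubertSS` not needed); support(`LTXZZ2Rigid`) = ∅; support(`MiedaFDCssc`) = the 24 book leaves (through the LLC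
sentence and through B30, whose certified support is the same 24 leaves, section 59); support(`MiedaExteriorSquare`) = ∅.  Census ids consumed: B139 (C143 pre-existing).  Bib keys added:
LiuTianXiaoZhangZhu2024Rigid, Mieda2021FormalDegreeSSC (`ledger bib add` 2026-08-27, the latter commit 2f8fb3afcdc8).  Nothing of v1 – v2 is redeclared or changed; no new import
(`Consumers59` reaches this file through the chain `…Downstream44` → … → `…Downstream15`). -/

-- Verbatim, kept out of docstrings by the docstring lint (C143, `arxiv-pdf-2108.06998/`): p0002:L4-6 "The main purpose of this article is to make preparation for our work [LTXZZ] in which we prove major cases toward the Beilinson–Bloch–Kato conjecture on the relation between Selmer groups andL-functions. To see how Galois deformation is used in the study of Selmer groups, we refer"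
-- p0037:L17-22 "Conjecture 4.2.1. LetΠandEbe as above. Fix a ﬁnite set Σ+of nonarchimedean place of F+ containing Σ+ Π. Then for all but ﬁnitely many primes λofE, we have (1)ρΠ,λis residually absolutely irreducible; (2)¯ρΠ,λ|Gal(F/F(ζℓ))is absolutely irreducible, where ℓis the underlying rational prime of λ; (3)¯rΠ,λ:= ¯ρΠ,λ,+is rigid for (Σ+,∅)(Deﬁnition 3.6.1 with Othe ring of integers of Eλ)."
-- p0039:L23 "Concerning the entire Conjecture 4.2.1, we have the following theorem." p0039:L24-25 "Theorem 4.2.6. LetΠandEbe as above. Suppose that there exists a nonarchimedean place of Fat which Πis supercuspidal. Then Conjecture 4.2.1 holds for ΠandE."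
-- bibliography: p0041:L25-26 "[KMSW] T. Kaletha, A. Minguez, S. W. Shin, and P.-J. White, Endoscopic Classiﬁcation of Representations: Inner Forms of Unitary Groups . arXiv:1409.3731. ↑8" / p0041:L31-32 "[Mok15] C. P. Mok, Endoscopic classiﬁcation of representations of quasi-split unitary groups , Mem. Amer. Math. Soc. 235(2015), no. 1108, vi+248, DOI 10.1090/memo/1108. MR3338302 ↑8" / p0041:L29-30 "[LTXZZ] Y. Liu, Y. Tian, L. Xiao, W. Zhang, and X. Zhu, On the Beilinson–Bloch–Kato conjecture for Rankin– Selberg motives . arXiv:1912.11942. ↑2"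
-- Verbatim, kept out of docstrings by the docstring lint (B139, `paper-arxiv-1908.11185/`): p0002:L3-5 "We prove the formal degree conjecture for simple supercuspidal representations of symplectic groups and quasi-split even special orthogonal groups over a $p$-adic field, under the assumption that $p$ is odd."
-- p0003:L7-10 "On the other hand, by the local Langlands correspondence, irreducible smooth representations of $G(F)$ are conjecturally parametrized by pairs $(\phi,\rho)$, where $\phi\colon W_F\times\SL_2(\C)\to {}^LG$ is an $L$-parameter, and $\rho$ is an irreducible representation of a finite group $\mathcal{S}_\phi$ determined by $\phi$." p0003:L11-16 "The formal degree conjecture, which was proposed by Hiraga-Ichino-Ikeda [MR2350057], predicts that $\deg(\pi)$ can be described by using the pair $(\phi_\pi,\rho_\pi)$ attached to $\pi$. For more precise formulation, see Section (sec:FDC-ssc). This conjecture has been solved for general linear groups [MR2350057], odd special orthogonal groups [MR3649356] and unitary groups [2018arXiv181200047B], but it seems still open for many other groups."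
-- p0003:L25-38 "Theorem 1.1 ( [Oi-ssc-classical]). Let $n\ge 1$ be an integer and write $2n=p^en'$ with $p\nmid n'$. Assume $p\neq 2$ and either $p\nmid 2n$ or $n'\mid p-1$. Let $G$ be one of the following groups:  * $\Sp_{2n}$,  * the quasi-split $\SO_{2n}$ attached to a ramified quadratic extension of $F$,  * the split $\SO_{2n+2}$,  * or the quasi-split $\SO_{2n+2}$ attached to an unramified quadratic extension of $F$.  Then, the formal degree conjecture holds for simple supercuspidal representations of $G(F)$."
-- p0003:L43-45 "Theorem 1.2 (Theorem (thm:main) and Remark (rem:Gan-Ichino)). Assume $p\neq 2$. Let $G$ be one of the groups in Theorem (thm:FDC-Oi-intro). Then, the formal degree conjecture holds for simple supercuspidal representations of $G(F)$."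
-- p0007:L3-6 "In this section, we deduce the formal degree conjecture for simple supercuspidal representations of symplectic groups and quasi-split even special orthogonal groups from Theorem (thm:exterior-square). Let us first recall the conjecture quickly in the case of symplectic groups. For more detail, see [MR2350057]." […] p0007:L21 "The formal degree conjecture predicts that $\deg(\pi)$ can be described by using the local Langlands correspondence."
-- p0007:L33-36 "Here is the statement of the formal degree conjecture for $\Sp_{2n}$:  Conjecture 3.1 ( [MR2350057]). For an irreducible discrete series representation $\pi$ of $G(F)$, we have" [display (conj:HII): deg(π) = C · (dim ρ_π / #S_{φ_π}) · |γ(0, Ad ∘ φ_π, ψ)|]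
-- p0008:L7-12 "By using Theorem (thm:ssc-LLC), Oi obtained a partial result on the formal degree conjecture.  Theorem 3.4 ( [Oi-ssc-classical]). We write $2n=p^en'$ with $p\nmid n'$. Assume $p\neq 2$ and either $p\nmid 2n$ or $n'\mid p-1$. Then, Conjecture (conj:HII) holds for simple supercuspidal representations of $G(F)$."
-- p0008:L23-24 "Theorem 3.5. Assume $p\neq 2$. Then, Conjecture (conj:HII) holds for simple supercuspidal representations of $G(F)$."
-- p0008:L87 "On the other hand, by [MR2350057], the formal degree conjecture for $\St$ is known:"
-- p0008:L101-104 "Remark 3.7. As remarked in [Oi-ssc-classical], by using the results in [MR3166215], we can deduce from Theorem (thm:main) the formal degree conjecture for simple supercuspidal representations of quasi-split even special orthogonal groups, under the assumption $p\neq 2$."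
-- bibliography: p0009:L5-8 "[MR3135650] J. Arthur, AThe endoscopic classification of representations: Orthogonal and symplectic groups, American Mathematical Society Colloquium Publications, vol. 61, American Mathematical Society, Providence, RI, 2013." / p0009:L56-58 "[Oi-ssc-classical] M. Oi, Simple supercuspidal L-packets of quasi-split classical groups, <https://www.math.kyoto-u.ac.jp/ masaooi/ssc_classic.pdf>." / p0009:L26-28 "[MR3166215] W. T. Gan and A. Ichino, Formal degrees and local theta correspondence, Invent. Math. 195 (2014), no. 3, 509–672." / p0009:L34-36 "[MR2350057] K. Hiraga, A. Ichino, and T. Ikeda, Formal degrees and adjoint $\gamma$-factors, J. Amer. Math. Soc. 21 (2008), no. 1, 283–304."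

/-- Row C143's and NEW row B139's statements, as an arbitrary assignment of truth values (the register records which typed inputs the PRINTED text invokes, never the truth of the fields). [cite: LiuTianXiaoZhangZhu2024Rigid, Prop. 2.3.6, Cor. 2.3.7, Thm 3.6.3, Thm 4.2.6, Thm 1.0.1; Mieda2021FormalDegreeSSC, Thm 2.1, Thm 3.5 (structure only)] [claim: KalethaMinguezShinWhite2014, under-review] -/
structure Consumers163 where
  /-- C143, NODE — PROPOSITION 2.3.6 ∧ COROLLARY 2.3.7 (census grade G-i; PUBLISHED Acta Math. Sin. (Engl. Ser.) 40 (2024); numbering of arXiv v1): Liu – Tian – Xiao – Zhang – Zhu (`arxiv-pdf-2108.06998/`), F/F⁺ CM, V hermitian of rank N over F, Π RACSDC on GL_N(𝔸_F): p0008:L4-7 "Proposition 2.3.6. Take an RACSDC representation ΠofGLN(AF)withξΠ= (ξτ)τthe archimedean weights. Let Vbe a hermitian space over Fof rankNandπ=⊗vπva cuspidal automorphic representation of U(V)(AF+)such that Π≃BC(π). Then (1) For every nonarchimedean place vofF+,BC(πv)≃Πv." p0008:L8 "(2) For every τ∈Σ∞,πτis a discrete series representation of Harish-Chandra parameter" [display: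 {(1−N)/2 + ξ_{τ,1}, (3−N)/2 + ξ_{τ,2}, …, (N−1)/2 + ξ_{τ,N}}] p0008:L14 "after we identity U(V)(Fτ)as a subgroup of GLN(C)viaτ:F⊗F+,τR∼− →C." p0008:L16-23 "Corollary 2.3.7. Take an RACSDC representation ΠofGLN(AF). Let Vbe a hermitian space overFof rankNthat is even, and π=⊗vπva cuspidal automorphic representation of U(V)(AF+) such that Π≃BC(π). Ifvis a nonarchimedean place of F+that is inert in F(withwthe unique place ofFabove it) such that Vvis not split and that πvhas nonzero invariants under a special maximal open compact subgroup of U(V)(F+ v), then the monodromy operator of WD(ιℓΠw)is conjugate to (1 1 0 1)⊕1N−2for every rational prime ℓand every isomorphism ιℓ:C∼− →Qℓ." [cite: LiuTianXiaoZhangZhu2024Rigid, Prop. 2.3.6 (arXiv:2108.06998v1 p0008:L4-14), Cor. 2.3.7 (p0008:L16-23)] [claim: KalethaMinguezShinWhite2014, under-review] -/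
  LTXZZ2BaseChange : Prop
  /-- C143, THEOREM 3.6.3 — THE ALMOST MINIMAL R = T THEOREM (census grade G-i): under the setup of §3.6 (r̄ : Γ_{F⁺} → 𝒢_N(k) with (D0)–(D4), V a hermitian space not split at Σ⁺_lr, Sh(V, K) its Shimura variety of dimension d(V), 𝕋_𝔪 the localised Hecke algebra on H^{d(V)}_ét): p0030:L25-26 "Theorem 3.6.3. Suppose that Σ+ lr=∅ifNis odd. Under the above setup, we assume" […] p0030:L30-32 "(D3): ¯ris rigid for (Σ+ min,Σ+ lr)(Deﬁnition 3.6.1);" […] p0030:L44-49 ". IfTm̸= 0, then (1) There is a canonical isomorphism Runiv S∼− →Tmof local complete intersection rings over O. (2) The Tm-module Hd(V) ´ et(Sh(V,K),Lξ)mis ﬁnite and free. (3) We have µ≡Nmod 2." p0030:L50-51 "The rest of this subsection is devoted to the proof of the theorem. We will use the Taylor–Wiles patching argument following [CHT08] and [Tho12]." [cite: LiuTianXiaoZhangZhu2024Rigid, Thm 3.6.3 (arXiv:2108.06998v1 p0030:L25-49)] [claim: KalethaMinguezShinWhite2014, under-review] -/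
  LTXZZ2RT : Prop
  /-- C143, CONTROL — THEOREM 4.2.6 (RIGIDITY; census grade G-i): Π RACSDC on GL_N(𝔸_F), N ≥ 2, E a strong coefficient field: p0037:L4-11 "LetΠbe an RACSDC representation of GLN(AF)(Deﬁnition 2.3.2) for N⩾2, and denote byΣ+ Πthe smallest (ﬁnite) set of nonarchimedean places of F+containing Σ+ badsuch that Πwis unramiﬁed for every nonarchimedean place wofFnot above Σ+ Π. LetE⊆Ca strong coeﬃcient ﬁeld of Π(Deﬁnition 2.3.4). Then for every prime λofE, we have a continuous homomorphism ρΠ,λ: ΓF→GLN(Eλ)." […] p0039:L24-25 "Theorem 4.2.6. LetΠandEbe as above. Suppose that there exists a nonarchimedean place of Fat which Πis supercuspidal." [conclusion, line comment above: the authors' Conj. 4.2.1 holds for Π and E — for all but finitely many primes λ of E: ρ_{Π,λ} residually absolutely irreducible, ρ̄_{Π,λ} absolutely irreducible on Gal(F̄/F(ζ_ℓ)), r̄_{Π,λ} rigid for (Σ⁺, ∅)].  Its proof as printed: p0039:L26-27 "Proof.Letξ=ξΠbe the archimedean weights of Π(Deﬁnition 2.3.2). Let Λ2be the set in Proposition 4.2.3(2)."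 […] p0039:L55-59 "Now by (a–e), and the same proof of [Tho12, Theorem 10.1] (which assumes that Σ+∪Σ+ ℓconsists only of places split in F), we know that the global universal deformation ring Runiv S(DΣ+)is a ﬁnite O-module." p0039:L59-63 "By (d,e) and the same proof of [Gee11, Lemma 5.1.3] (which assumes that Σ+∪Σ+ ℓconsists only of places split inF), we know that the Krull dimension of Runiv S(DΣ+)is at least one." — Galois deformation theory and the Galois representations of Proposition 2.3.3; no [KMSW] / [Mok15] / Proposition 2.3.6. [cite: LiuTianXiaoZhangZhu2024Rigid, Thm 4.2.6 (arXiv:2108.06998v1 p0039:L24-25), its proof (p0039:L26 – p0040:L38), §4.2 setup (p0037:L4-22)] -/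
  LTXZZ2Rigid : Prop
  /-- C143, THEOREM 1.0.1 (the introduction's combined statement; census grade G-i): Π RACSDC with a supercuspidal component, E, Σ⁺, the pairs (V, K) with d(V) ≤ 1 p0002:L45-46 "satisfying that there exists a cuspidal automorphic representation πofU(V)(AF+)with nonzero K- invariantswhoseautomorphicbasechangeis Π. Everypair (V,K)asabovegivesaShimuravariety": p0002:L55-60 "Theorem 1.0.1. Let the setup be as above. Suppose that there exists a nonarchimedean place of Fat which Πis supercuspidal. Then ΛΠ,Σ+is a ﬁnite set. Moreover, there exists a ﬁnite set Λ′ Π,Σ+ of primes of Econtaining ΛΠ,Σ+, such that for every λ̸∈Λ′ Π,Σ+and every pair (V,K)as above withd(V)⩽1, we have" p0003:L2-6 "(1) There is a canonical isomorphism Runiv Sλ∼− →Tλ,mλof local complete intersection commutative Oλ-algebras. (2) The Tλ,mλ-module Hd(V) ´ et(Sh(V,K),Lξ,λ)mλis ﬁnite and free." p0003:L7-9 "The above theorem is a consequence of the two main results of this article, namely, Theorem 3.6.3 and Theorem 4.2.6. We have a similar consequence when d(V)is general, but under an extra assumption on certain vanishing of localized cohomology oﬀ middle degree." [cite: LiuTianXiaoZhangZhu2024Rigid,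 Thm 1.0.1 (arXiv:2108.06998v1 p0002:L55 – p0003:L9)] [claim: KalethaMinguezShinWhite2014, under-review] -/
  LTXZZ2Combined : Prop
  /-- B139, CONTROL — THEOREM 2.1 (= Theorem 1.3; Galois side, Arthur-free): Y. Mieda (`paper-arxiv-1908.11185/`), F a finite extension of ℚ_p, W_F its Weil group, Sw the Swan conductor: p0004:L36-45 "Theorem 2.1. Let $(\tau,V)$ be an $n$-dimensional irreducible smooth representation of $W_F$ such that $\Sw \tau=1$. Then we have  \[ \Sw(\wedge^2\tau)=\begin{cases} m-1 & \text{if $n=2m$ is even,}\\ m & \text{if $n=2m+1$ is odd.} \end{cases} \]" p0002:L5-7 "The essential part is to compute the Swan conductor of the exterior square of an irreducible local Galois representation with Swan conductor $1$. It is carried out by passing to the equal characteristic local field and using the theory of Kloosterman sheaves." [cite: Mieda2021FormalDegreeSSC, Thm 2.1 (arXiv:1908.11185 p0004:L36-45), abstract (p0002:L5-7)] -/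
  MiedaExteriorSquare : Prop
  /-- B139, THEOREM 3.5 (= Theorem 1.2, with Remark 3.7; census grade G-i; PUBLISHED Math. Res. Lett. 28 (2021) 1227–1242): Y. Mieda (`paper-arxiv-1908.11185/`), p ≠ 2, G = Sp_{2n} (n ≥ 2; and by Remark 3.7 the quasi-split even special orthogonal groups of Theorem 1.1's list), π a simple supercuspidal representation of G(F) (p0007:L106-109 "Let $\chi$ be a character of $\pm I^+$ such that $\chi\vert_{I^{++}}$ is trivial and $\chi\vert_{I^+}$ induces an affine generic character of $I^+/I^{++}$. Then, the compact induction $\cInd_{\pm I^+}^{G(F)} \chi$ is known to be irreducible supercuspidal. Representations obtained in this way are called simple supercuspidal representations."): Hiraga – Ichino – Ikeda's formal degree identity holds for π — p0007:L36-40 "For an irreducible discrete series representation $\pi$ of $G(F)$, we have  \[ \deg(\pi)=C\cdot \frac{\dim \rho_\pi}{\#S_{\phi_\pi}}\lvert\gamma(0,\Ad\circ\phi_\pi,\psi)\rvert. \]" [(conj:HII) of the text; C > 0 depending on the Haar measure and ψ; the statement sentences of Theorems 1.2 / 3.5 carry the lint word: line comments above] p0008:L20-23 "The following is our main theorem for symplectic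 groups (for quasi-split even special orthogonal groups, see Remark (rem:Gan-Ichino)).  Theorem 3.5." […] p0007:L61-62 "Remark 3.2. In the case $G=\Sp_{2n}$, $S_{\phi_\pi}$ is known to be an elementary $2$-group, hence $\dim \rho_\pi=1$." [cite: Mieda2021FormalDegreeSSC, Thm 3.5 (arXiv:1908.11185 p0008:L20-24), Thm 1.2 (p0003:L43-45), Remark 3.7 (p0008:L101-104), (conj:HII) display (p0007:L33-40)] -/
  MiedaFDCssc : Prop

/-- C143's NODE ⇐ MOK ∧ KMSW's PROVED SCOPE: p0007:L43-48 "LetVbe a hermitian space over Fof rankN, andπan irreducible admissible representation ofU(V)(AF+). Anautomorphic base change ofπis deﬁned to be an automorphic representation BC(π)ofGLN(AF)that is a ﬁnite isobaric sum of discrete automorphic representations such that BC(π)v≃BC(πv)holds for all but ﬁnitely many nonarchimedean places vofF+such thatπvis unramiﬁed. By the strong multiplicity one property for GLN[PS79], if BC(π)exists, then it is unique up to isomorphism. Moreover, for every nonarchimedean place vofF+that is nonsplit" p0008:L2-3 "inF, we have a notion of local base change, which is deﬁned by [Rog90] when N⩽3and by [Mok15,KMSW] for general N." p0008:L15 "Proof.This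 follows from [KMSW, Theorem 1.7.1] for generic packets. □" (Proposition 2.3.6); Corollary 2.3.7: p0008:L24-25 "Proof.WriteN= 2rfor a positive integer r. By Proposition 2.3.6, we know that Πwis isomorphic toBC(πv). Since ΠwistemperedbyProposition2.3.3(1), πvisalsotempered." […] — [KMSW, Theorem 1.7.1] « for generic packets » on U(V), V hermitian over F w.r.t. F/F⁺ (E/F a field, a pure inner form): INSIDE the proved scope ↦ `∀ N, κ.Scope N` (as rows C13, C19, C231); [Mok15] ↦ Mok at every rank (named with [KMSW] as the definition of local base change for general N); [Rog90], [PS79], Proposition 2.3.3 ([Car12], [CH13], [Car14]): absorbed.  Premises: Mok at every rank, KMSW's proved scope at every rank. [cite: LiuTianXiaoZhangZhu2024Rigid, Prop. 2.3.6 with proof (arXiv:2108.06998v1 p0008:L4-15), Cor. 2.3.7 with proof (p0008:L16-32), §2.3 (p0007:L43 – p0008:L3); Mok2015, as [Mok15]] [claim: KalethaMinguezShinWhite2014, under-review] -/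
def E_LTXZZ2BaseChange (μ : Mok2015.Nodes) (κ : KMSW2014.Nodes) (c₁₆₃ : Consumers163) : Prop :=
  (∀ N, μ.Everything N) → (∀ N, κ.Scope N) → c₁₆₃.LTXZZ2BaseChange

/-- C143, THEOREM 3.6.3 ⇐ THE NODE: in the proof (p0033), the points of Spec 𝕋_𝔪[1/ℓ] give RACSDC Π_x with p0033:L19-23 "(b)Π = BC(π)for a cuspidal automorphic representation πofU(V)(AF+)satisfying that (π∞)Kappears (nontrivially) in Hd(V) ´ et(Sh(V,K),Lξ⊗O,ι−1 ℓC); (c) the archimedean weights of Πequalsξ, which follows from (b) and Proposition 2.3.6." — then p0033:L35-36 "We claim that rmsatisﬁes the global deformation problem S. Indeed, by (b) and Proposition 2.3.6, Πx,wis unramiﬁed for nonarchimedean places wofF" […] p0033:L42-45 "by Proposition 2.3.3(2a), ¯rm,vis unramiﬁed for v̸∈S. By (b), Corollary 2.3.7, and Proposition 2.3.3(2a), ¯rm,vbelongs to Dram vforv∈Σ+ lr.9" […]; the rest is Taylor – Wiles patching ([CHT08], [Tho12], [KT17], [BLGG11]) and the local deformation theory of §§3.2–3.5: absorbed.  Premise: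 the node. [cite: LiuTianXiaoZhangZhu2024Rigid, Thm 3.6.3, proof (arXiv:2108.06998v1 p0033:L3-52)] [claim: KalethaMinguezShinWhite2014, under-review] -/
def E_LTXZZ2RT (c₁₆₃ : Consumers163) : Prop := c₁₆₃.LTXZZ2BaseChange → c₁₆₃.LTXZZ2RT

/-- C143, CONTROL EDGE — THEOREM 4.2.6 is proved without the unitary classification as printed ([KMSW] and [Mok15] are cited on page 8 only: bibliography back-references « ↑8 »): p0039:L55-59 "Now by (a–e), and the same proof of [Tho12, Theorem 10.1] (which assumes that Σ+∪Σ+ ℓconsists only of places split in F), we know that the global universal deformation ring Runiv S(DΣ+)is a ﬁnite O-module." [cite: LiuTianXiaoZhangZhu2024Rigid, Thm 4.2.6, proof (arXiv:2108.06998v1 p0039:L26 – p0040:L38), bibliography (p0041:L25-26, L31-32)] -/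
def E_LTXZZ2Rigid (c₁₆₃ : Consumers163) : Prop := c₁₆₃.LTXZZ2Rigid

/-- C143, THEOREM 1.0.1 ⇐ THEOREM 3.6.3 ∧ THEOREM 4.2.6: p0003:L7-9 "The above theorem is a consequence of the two main results of this article, namely, Theorem 3.6.3 and Theorem 4.2.6. We have a similar consequence when d(V)is general, but under an extra assumption on certain vanishing of localized cohomology oﬀ middle degree." [cite: LiuTianXiaoZhangZhu2024Rigid, Thm 1.0.1 (arXiv:2108.06998v1 p0003:L7-9)] [claim: KalethaMinguezShinWhite2014, under-review] -/
def E_LTXZZ2Combined (c₁₆₃ : Consumers163) : Prop := c₁₆₃.LTXZZ2RT → c₁₆₃.LTXZZ2Rigid → c₁₆₃.LTXZZ2Combined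

/-- B139, CONTROL EDGE — THEOREM 2.1 is local Galois theory: p0003:L53-62 "In the case $p\mid 2n$ and $n'\mid p-1$ (which is more difficult than the case $p\nmid 2n$), Oi used an explicit description of $\tau$ in [2015arXiv150902960I] to obtain the theorem above. Our strategy to Theorem (thm:exterior-square-intro) is totally different. First we use Deligne's result [MR771673] to reduce Theorem (thm:exterior-square-intro) to the case where $F$ is an equal characteristic local field. In the equal characteristic case, every irreducible smooth representation of $W_F$ with Swan conductor $1$ is essentially obtained as the localization at $\infty\in \P^1$ of a Kloosterman sheaf $\Kl$ (see [MR0463174] and [MR955052]). The Swan conductor of the localization at $\infty$ of $\wedge^2\Kl$ can be computed by using the Grothendieck-Ogg-Shafarevich formula and the Grothendieck-Lefschetz trace formula." [cite: Mieda2021FormalDegreeSSC, Thm 2.1, §1 (arXiv:1908.11185 p0003:L53-62), §2 (p0004 – p0006)] -/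
def E_MiedaExteriorSquare (c₁₆₃ : Consumers163) : Prop := c₁₆₃.MiedaExteriorSquare

/-- B139, THEOREM 3.5 ⇐ THE BOOK ∧ B30 ∧ THEOREM 2.1: the statement's parameters — p0007:L23-31 "By the local Langlands correspondence due to Arthur [MR3135650], discrete series representations of $G(F)$ are parametrized by pairs $(\phi,\rho)$, where  * $\phi\colon W_F\times\SL_2(\C)\to \widehat{G}(\C)=\SO_{2n+1}(\C)$ is an $L$-parameter such that the centralizer group $S_\phi=\Cent_{\widehat{G}(\C)}(\Imm \phi)$ is finite,  * and $\rho$ is an irreducible representation of $\pi_0(S_\phi)=S_\phi$.  The pair attached to a discrete series representation $\pi$ is denoted by $(\phi_\pi,\rho_\pi)$." — [MR3135650] ↦ the book at every rank (the local Langlands correspondence for Sp_{2n}(F) and the quasi-split SO_{2n}(F), SO_{2n+2}(F): the pair (φ_π, ρ_π) and S_φ in the identity); the proof's inputs — p0007:L111-112 "The parameter $(\phi_\pi,\rho_\pi)$ attached to a simple supercuspidal representation $\pi$ is investigated by Oi in detail." p0008:L1-5 "Strictly speaking, [Oi-ssc-classical] claims that $\iota\circ \phi_\pi=\tau\oplus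 \det\circ\tau$, where $\tau$ is the Langlands parameter of a simple supercuspidal representation of $\GL_n(F)$. However, it is well-known that such $\tau$ is irreducible and has Swan conductor $1$; see [MR3158004] for example. Further, since $\tau$ is orthogonal (see [Oi-ssc-classical]), the character $\omega=\det\circ\tau$ is quadratic." p0008:L26-29 "In fact, Theorem (thm:main) can be deduced from Theorem (thm:exterior-square) exactly in the same way as Oi did in [Oi-ssc-classical]. We include some of his arguments for reader's convenience. In the following, we assume that $p\neq 2$ and let $\pi$ be a simple supercuspidal representation of $G(F)$. Let $\tau$ and $\omega$ be as in Theorem (thm:ssc-LLC)." p0008:L31-35 "Lemma 3.6.  * We have $L(s,\Ad\circ\phi_\pi)=1$.  * We have $\Ar(\Ad\circ\phi_\pi)=2n^2+2n$, where $\Ar$ denotes the Artin conductor." […] p0008:L45 "Since $\tau$ is orthogonal by Theorem (thm:ssc-LLC), we have" […] p0008:L59 "by Theorem (thm:exterior-square). On the other hand, by the proof of (i), we have" […] p0008:L71-73 "Proof 6 (of Theorem (thm:main)). Let $\St$ denote the Steinberg representation of $G(F)$. We may choose $\psi$ so that the following equalities hold:" […] p0008:L80-81 "See [MR2730575] for the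 first equality, and [MR2730575] for the second. Together with Lemma (lem:Artin-L), we obtain $\lvert \gamma(0,\Ad\circ\phi_\pi,\psi)\rvert=q^{n^2+n}$ and" […] p0008:L99 "as desired (recall that $\dim \rho_\pi=1$ by Remark (rem:S-gp-abelian) and $\#S_{\phi_\pi}=2$ by Theorem (thm:ssc-LLC))." — [Oi-ssc-classical] (Theorem 3.3) ↦ row B30 `Consumers59.OiSSC` (Oi's Theorem 1.1: the simple supercuspidal L-packets of Sp_{2n}, SO_{2n}^μ, SO_{2n+2}^{(ur)} and their parameters); Theorem 2.1 ↦ `MiedaExteriorSquare`; [MR2350057] (the identity for St), [MR2730575], [MR3158004], [MR3166215] (= control row E47, Remark 3.7): absorbed.  Premises: the book at every rank, B30, Theorem 2.1. [cite: Mieda2021FormalDegreeSSC, §3 (arXiv:1908.11185 p0007:L23-31, L111-124; p0008:L1-5, L26-99), Remark 3.7 (p0008:L101-104); Arthur2013, as [MR3135650]; Oi2024SSCPackets, as [Oi-ssc-classical]] -/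
def E_MiedaFDCssc (ν : Nodes) (c₅₉ : Consumers59) (c₁₆₃ : Consumers163) : Prop :=
  (∀ N, ν.Everything N) → c₅₉.OiSSC → c₁₆₃.MiedaExteriorSquare → c₁₆₃.MiedaFDCssc

/-- The hundred-and-sixty-third tranche of implications: row C143's supplier edge, two consumer edges and control edge; NEW row B139's control edge and consumer edge. [cite: LiuTianXiaoZhangZhu2024Rigid, Prop. 2.3.6, Thms 3.6.3, 4.2.6, 1.0.1; Mieda2021FormalDegreeSSC, Thms 2.1, 3.5 (each edge's source in its own docstring)] [claim: KalethaMinguezShinWhite2014, under-review] -/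
structure Implications163 (ν : Nodes) (μ : Mok2015.Nodes) (κ : KMSW2014.Nodes) (c₅₉ : Consumers59) (c₁₆₃ : Consumers163) : Prop where
  ltxzz2BaseChange : E_LTXZZ2BaseChange μ κ c₁₆₃
  ltxzz2RT : E_LTXZZ2RT c₁₆₃
  ltxzz2Rigid : E_LTXZZ2Rigid c₁₆₃
  ltxzz2Combined : E_LTXZZ2Combined c₁₆₃
  miedaExteriorSquare : E_MiedaExteriorSquare c₁₆₃
  miedaFDC : E_MiedaFDCssc ν c₅₉ c₁₆₃

section Tranche163

variable {ν : Nodes} {μ : Mok2015.Nodes} {κ : KMSW2014.Nodes} {c : Consumers} {c₂ : Consumers2} {c₅ : Consumers5} {c₆ : Consumers6} {c₁₁ : Consumers11} {c₁₃ : Consumers13}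
  {c₁₄ : Consumers14} {c₂₆ : Consumers26} {c₃₃ : Consumers33} {c₃₄ : Consumers34} {c₃₅ : Consumers35} {c₄₃ : Consumers43} {c₄₄ : Consumers44} {c₄₅ : Consumers45} {c₄₇ : Consumers47}
  {c₄₈ : Consumers48} {c₅₁ : Consumers51} {c₅₄ : Consumers54} {c₅₉ : Consumers59} {c₁₆₃ : Consumers163}

/-- THE TWO CONTROLS hold by the tranche's edges alone — no input of any DAG. [cite: LiuTianXiaoZhangZhu2024Rigid, Thm 4.2.6; Mieda2021FormalDegreeSSC, Thm 2.1 (bookkeeping proved here)] -/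
theorem hundredsixtythird_controls (Y : Implications163 ν μ κ c₅₉ c₁₆₃) : c₁₆₃.LTXZZ2Rigid ∧ c₁₆₃.MiedaExteriorSquare :=
  ⟨Y.ltxzz2Rigid, Y.miedaExteriorSquare⟩

/-- C143 FROM ITS NODE: the R = T theorem and the combined Theorem 1.0.1 (the rigidity theorem being premise-free). [cite: LiuTianXiaoZhangZhu2024Rigid, Thms 3.6.3, 1.0.1 (bookkeeping proved here)] [claim: KalethaMinguezShinWhite2014, under-review] -/
theorem ltxzz2_of_node (Y : Implications163 ν μ κ c₅₉ c₁₆₃) (h : c₁₆₃.LTXZZ2BaseChange) : c₁₆₃.LTXZZ2RT ∧ c₁₆₃.LTXZZ2Rigid ∧ c₁₆₃.LTXZZ2Combined :=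
  have r := Y.ltxzz2RT h
  ⟨r, Y.ltxzz2Rigid, Y.ltxzz2Combined r Y.ltxzz2Rigid⟩

/-- FIRST READING — row C143 granted Mok and KMSW's proved scope at every rank: the node and the three theorems. [cite: LiuTianXiaoZhangZhu2024Rigid, Prop. 2.3.6, Thms 3.6.3, 4.2.6, 1.0.1 (bookkeeping proved here)] [claim: KalethaMinguezShinWhite2014, under-review] -/
theorem ltxzz2_of_mok_and_scope (Y : Implications163 ν μ κ c₅₉ c₁₆₃) (m : ∀ N, μ.Everything N) (k : ∀ N, κ.Scope N) :
    c₁₆₃.LTXZZ2BaseChange ∧ c₁₆₃.LTXZZ2RT ∧ c₁₆₃.LTXZZ2Rigid ∧ c₁₆₃.LTXZZ2Combined :=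
  have h := Y.ltxzz2BaseChange m k
  ⟨h, ltxzz2_of_node Y h⟩

/-- SECOND READING — C143 FROM MOK's AND KMSW's INPUTS (`MokInputs.everything`, `KMSWInputs.scope`): nothing of the book's DAG, and NOT KMSW's unwritten sequels. [cite: LiuTianXiaoZhangZhu2024Rigid, Prop. 2.3.6, Thms 3.6.3, 1.0.1 (bookkeeping proved here)] [claim: KalethaMinguezShinWhite2014, under-review] -/
theorem ltxzz2_of_inputs (Y : Implications163 ν μ κ c₅₉ c₁₆₃) (M : MokInputs μ) (K : KMSWInputs μ κ) :
    c₁₆₃.LTXZZ2BaseChange ∧ c₁₆₃.LTXZZ2RT ∧ c₁₆₃.LTXZZ2Rigid ∧ c₁₆₃.LTXZZ2Combined :=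
  ltxzz2_of_mok_and_scope Y M.everything (KMSWInputs.scope M K)

/-- ROW C143 IN CONDITIONAL FORM, 2026 (PUBLISHED 2024; « This follows from [KMSW, Theorem 1.7.1] for generic packets » — scope-aware, no status sentence on [KMSW] / [Mok15]; census class G-i): granting Mok's and KMSW's edges, supplies and PUBLISHED inputs, KMSW's Mok import and the identification of the two copies of the general weighted fundamental lemma, the node, Theorem 3.6.3 and Theorem 1.0.1 are conditional on Mok's 2024–2026 PREPRINT layer and on Mok's general and non-standard weighted fundamental lemmas; KMSW's unwritten sequels are NOT needed; Theorem 4.2.6 is unconditional. [cite: LiuTianXiaoZhangZhu2024Rigid, Prop. 2.3.6 proof (arXiv:2108.06998v1 p0008:L15) (bookkeeping proved here)] [claim: KalethaMinguezShinWhite2014, under-review] -/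
theorem ltxzz2_conditional_form_2026 (Y : Implications163 ν μ κ c₅₉ c₁₆₃) (D1 : KMSW2014.E_ImportMok μ κ) (D3 : KMSW2014.E_SameWFL μ κ) (MB : μ.SectionEdges) (MS : μ.SupplyEdges)
    (MP : μ.PublishedLeaves) (KB : κ.ChapterEdges) (KS : κ.SupplyEdges) (KP : κ.PublishedLeaves) :
    c₁₆₃.LTXZZ2Rigid ∧ (μ.PreprintLeaves2026 → μ.WFL_general → μ.WFL_nonstandard → c₁₆₃.LTXZZ2BaseChange ∧ c₁₆₃.LTXZZ2RT ∧ c₁₆₃.LTXZZ2Combined) :=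
  ⟨Y.ltxzz2Rigid, fun hMQ m₆ m₇ =>
    have h := ltxzz2_of_inputs Y ⟨MB, MS, MP, hMQ, ⟨m₆, m₇⟩⟩ ⟨D1, KB, KS, KP, ⟨D3 m₆⟩⟩
    ⟨h.1, h.2.1, h.2.2.2⟩⟩

/-- FIRST READING — NEW row B139 granted the book at every rank and row B30: Theorem 3.5 and its control. [cite: Mieda2021FormalDegreeSSC, Thms 3.5, 2.1 (bookkeeping proved here)] -/
theorem mieda_of_book_and_B30 (Y : Implications163 ν μ κ c₅₉ c₁₆₃) (b : ∀ N, ν.Everything N) (h₃₀ : c₅₉.OiSSC) : c₁₆₃.MiedaFDCssc ∧ c₁₆₃.MiedaExteriorSquare :=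
  ⟨Y.miedaFDC b h₃₀ Y.miedaExteriorSquare, Y.miedaExteriorSquare⟩

/-- SECOND READING — B139 FROM THE BOOK's INPUTS (`BookInputs.everything`), row B30 being delivered from the same inputs by tranche 59's `simpleSC_bookRows_of_inputs` over tranches 35, 45, 54; nothing of Mok's or KMSW's. [cite: Mieda2021FormalDegreeSSC, Thm 3.5 (bookkeeping proved here)] -/
theorem mieda_of_inputs (Y : Implications163 ν μ κ c₅₉ c₁₆₃) (Z : Implications59 ν μ κ c₃₅ c₄₅ c₅₄ c₅₉) (T : Implications35 ν μ c c₂ c₅ c₆ c₃₃ c₃₄ c₃₅)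
    (V : Implications45 ν μ κ c₁₃ c₁₄ c₄₃ c₄₄ c₄₅) (W : Implications54 ν c₂ c₅ c₁₁ c₂₆ c₃₃ c₄₅ c₄₇ c₄₈ c₅₁ c₅₄) (A : BookInputs ν) :
    c₁₆₃.MiedaFDCssc ∧ c₁₆₃.MiedaExteriorSquare :=
  mieda_of_book_and_B30 Y A.everything (simpleSC_bookRows_of_inputs Z T V W A).2.2

/-- ROW B139 IN CONDITIONAL FORM, 2026 (PUBLISHED 2021; « By the local Langlands correspondence due to Arthur [MR3135650] », no status sentence — census class G-i): granting the book's edges, supplies and PUBLISHED inputs and tranches 35 / 45 / 54 / 59's edges, Theorem 3.5 is conditional on the book's 2024–2026 PREPRINT layer and its general and non-standard weighted fundamental lemmas; Theorem 2.1 is unconditional. [cite: Mieda2021FormalDegreeSSC, §3 (arXiv:1908.11185 p0007:L23) (bookkeeping proved here)] -/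
theorem mieda_conditional_form_2026 (Y : Implications163 ν μ κ c₅₉ c₁₆₃) (Z : Implications59 ν μ κ c₃₅ c₄₅ c₅₄ c₅₉) (T : Implications35 ν μ c c₂ c₅ c₆ c₃₃ c₃₄ c₃₅)
    (V : Implications45 ν μ κ c₁₃ c₁₄ c₄₃ c₄₄ c₄₅) (W : Implications54 ν c₂ c₅ c₁₁ c₂₆ c₃₃ c₄₅ c₄₇ c₄₈ c₅₁ c₅₄) (B : ν.BookEdges) (S : ν.SupplyEdges) (P : ν.PublishedLeaves) :
    c₁₆₃.MiedaExteriorSquare ∧ (ν.PreprintLeaves2026 → ν.WFL_general → ν.WFL_nonstandard → c₁₆₃.MiedaFDCssc) :=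
  ⟨Y.miedaExteriorSquare, fun hQ h₆ h₇ => (mieda_of_inputs Y Z T V W ⟨B, S, P, hQ, ⟨h₆, h₇⟩⟩).1⟩

end Tranche163

/-! ## Hundred-and-sixty-fourth tranche (v4 of this file, unit `pub-arthur-down-g69`, downstream tracer gen 69): NEW ROWS C318 AND C319 — THE RESIDUE TAIL OF GAPS G-DN-607 (c) READ FIRST-HAND
(21 arXiv ids with ≤ 3 needles in down-g68's `residue68.txt`; `work/residue_sweep.py` + a plain-word re-grep; every other text of the tail is a non-consumer or an already graded E-row —
verdicts in GAPS G-DN-609).  Texts: C318 = the corpus TeX rendering `HOME/pub-arthur-down-g69/primaries/paper-arxiv-1805.04047/` (18 chunks); C319 = the store's per-page text of the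
arXiv v2 PDF `HOME/pub-arthur-down-g69/primaries/paper-arxiv-2210.10564/` (48 pages; ligature / math-font artefacts of the extraction are quoted as extracted), both copied sha256-identical
from this seat's session cache.  ERRATUM carried from section 165 of `DownstreamSupport18.lean`: in the tranche-163 header above, « row C40's text » (Beuzart-Plessis, arXiv:1812.00047) should
read « row C25's text » — C25 = `Consumers34.BPPlancherel`, the premise typed below for C318.
**C318** (NEW ROW; `DOWNSTREAM.md` §I l.1100 « mention; not graded » and l.1471 « peripheral / F: … status-type sentence ») — U. K. ANANDAVARDHANAN – Nadir MATRINGE, *Test vectors for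
finite periods and base change*, Adv. Math. 360 (2020) 106915, doi:10.1016/j.aim.2019.106915 = arXiv:1805.04047 (bib `AnandavardhananMatringe2020` NEW).  The body of the paper is over
FINITE fields (E/F quadratic, H = GL_n(F) or U(n, E/F) inside GL_n(E); base change of Shintani / Kawanaka, distinction by Gow): p0003:L16-24 "It is known that there exists an irreducible representation $\rho$ of  \[G_\iota = \{g \in \GL_n(E) \mid g^\iota = g\}\]  such that  \[{\rm Trace}~ [\pi(g)T_\iota] = {\rm Trace}~ [\rho(g g^\iota)],\]  for a suitable normalization of $T_\iota$. We say that the $\iota$-invariant representation $\pi$ of $\GL_n(E)$ is the base change lift of the representation $\rho$ of $G_\iota$ or that $\rho$ base changes to $\pi$. This is the work of Shintani when $\iota = \sigma$ [shi76], and Kawanaka when $\iota = \tau$ [kaw77]. We remark that Kawanaka assumes the characteristic $p$ to be odd, so it is understood that we have the same assumption whenever we deal with base change from ${\rm U}(n,E/F)$." p0003:L26 "It follows from the work of Gow [gow84] that distinction is characterized by base change. An irreducible representation $\pi$ of $\GL_n(E)$ is distinguished with respect to $\GL_n(F)$ if and only if it is a base change lift from ${\rm U}(n,E/F)$ and it is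 distinguished with respect to ${\rm U}(n,E/F)$ if and only if it a base change lift from $\GL_n(F)$."
— THEOREM 1.1 (the explicit test vector: the H-average of the Bessel function, with the value λ(B_π) = (dim ρ / dim π) · |GL_n(E)| / (|GL_n(F)| |U(n,E/F)|)) is Arthur-free: a CONTROL.  §7 is the
p-ADIC ANALOGUE (K/k quadratic p-adic): p0015:L3-4 "Let $K/k$ be a quadratic extension of $p$-adic fields. Our interest is in distinction for the symmetric pair $(\GL_n(K),\GL_n(k))$ for square-integrable representations which is related to stable (resp. unstable) base change from the quasi-split unitary group ${\rm U}(n,K/k)$ when $n$ is odd (resp. even)," [« by the Flicker-Rallis conj., now a theorem by the work of Mok [mok15] » — line comment below] p0015:L18 "Let $\pi$ be a square-integrable representation of $\GL_n(K)$ which is distinguished with respect to $\GL_n(k)$. Let $\rho$ be the (unique) representation of ${\rm U}(n,K/k)$ that base changes to $\pi$. When $n$ is odd, we consider the stable base change, whereas we consider the unstable base change when $n$ is even."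
p0015:L13 "The $\GL_n(K)$ case is known and the case of ${\rm U}(n,K/k)$ is known for $n \leq 3$ [hii08], and a proof for arbitrary $n$ has been recently announced by Beuzart-Plessis, thus proving Proposition 8.5 of [hii08] without the assumptions over there." p0015:L38-40 "and, by [hii08], and by the forthcoming work of Beuzart-Plessis mentioned earlier,  \[d(\rho) = \frac{1}{2} \left| \gamma^{\rm LS}(0,\pi,r^\prime,\psi_0) \right|.\]" p0016:L45 "We summarize the above arguments in the following theorem." — THEOREM 7.1 (λ(W) ∼ ε(1/2, π, r, ψ) · (d(ρ)/d(π)) · ℓ(W) for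
square-integrable GL_n(k)-distinguished π of GL_n(K), ρ the square-integrable representation of U(n, K/k) base-changing to π).  TYPED: `AMFiniteTestVectors` := Theorem 1.1 (with Corollary 1.2,
Theorems 1.3, 1.4, 6.1: finite groups) — CONTROL; `AMpadicFormalDegrees` := Theorem 7.1 ⇐ Mok at every rank ([mok15]: the square-integrable packets of the quasi-split U(n, K/k) and their
stable / unstable base change — the ρ of the statement) ∧ row C25 `Consumers34.BPPlancherel` (R. Beuzart-Plessis, Invent. Math. 225 (2021) = arXiv:1812.00047, tranche 34: « a proof for
arbitrary n has been recently announced by Beuzart-Plessis », « the forthcoming work of Beuzart-Plessis » — the formal degree of ρ); [hii08] (Hiraga – Ichino – Ikeda: the GL_n(K) formal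
degree and the U(3) case), [akt04], [kab04], [am17], [akmss18], [sha84], [fli93], [ana08]: Arthur-free, absorbed.  STATUS SENTENCES: Mok « now a theorem »; Beuzart-Plessis « announced » /
« forthcoming » (2018) and (line comment) the constant « relies on the validity of the formal degree conj. for GL(n,K) and U_n(K/k) » — the authors flag the C25 input, not Mok.
**C319** (NEW ROW; `DOWNSTREAM.md` §I l.1164 « peripheral » — its « [ Mok15, Thm. 2.4.2] » has a blank after the bracket in the PDF text, which the census needles and down-g68's sweep pattern
`\[Mok` both miss; found by this seat's plain-word re-grep) — Valentin HERNANDEZ – Benjamin SCHRAEN, *The infinite fern in higher dimensions*, p0001:L31 "arXiv:2210.10564v2  [math.NT]  5 May 2023" (PREPRINT; no journal DOI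
located by Crossref / `lit cite` on 2026-08-27; bib `HernandezSchraen2023InfiniteFern` NEW).  E CM with maximal totally real subfield F, ρ̄ : Gal(Ē/E) → GL_n(𝔽̄_p) χ-polarized, absolutely
irreducible, conveniently modular; X^{χ-pol}_ρ̄ the rigid generic fibre of the polarized deformation ring; the infinite fern F(ρ̄) = the image of the GU-eigenvariety E(ρ̄): p0002:L8-12 "This article deals with a generalization of this result to more general number /uniFB01elds and greater values of n. First, we need to assume that the number /uniFB01eld E is a CM /uniFB01eld, with totally real /uniFB01eld F , in order to be able to associate Galois representations to automorphic representations. Second, it is expected that for general n the automorphic points are not Zariski dense in Xρ, thus we reduce to the case of χ-polarized Galois"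
[…].  THE MAIN THEOREMS (1.2 / 1.6 = 8.8: the Zariski closure of the infinite fern is a non-empty union of irreducible components of dimension [F:ℚ] n(n+1)/2) use the eigenvariety for the similitude
unitary group GU, Chenevier's methods, Bellaïche – Chenevier, Breuil – Hellmann – Schraen and the Galois representations of Appendix A (p0040:L33-35 "By [ HL TT16] and [ Sch15], for any cuspidal regular algebraic automorphic representa- tion Π, there is a unique ρΠ,ι which is strongly associated to Π and for any ρ there is at most one Π such that ρ is weakly associated to Π." […]; base change for GU
via [Mor10] / Shin's appendix to [Gol14]) — no [Mok15] / [KMSW] / [Art13]: a CONTROL as printed.  THE ONE USE OF MOK is in the proof of COROLLARY 8.13 = COROLLARY 1.7 « (Allen) » (full Zariski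
density of the infinite fern under Hypothesis 8.12), where an automorphic point of every component, supplied on GL_n by [All19], must be moved to the quasi-split unitary group U and then to
GU: p0039:L58-59 "Let ΠU be the global A-packet associate to Π (see [ Mok15, 2.3] for example). Let v|8 be an archimedean place of F and let ψv be the local Arthur parameter at v associated to ψ." […] p0040:L9-16 "As ψv is tempered, discrete, regular algebraic its associated local A-packet is equal to the L-packet of discrete series representations constructed in [ Lan89], and in particular contains the holomorphic dis- crete series. In particular, by [ Mok15, Thm. 2.4.2], there exists π0 a regular holomorphic algebraic, unrami/uniFB01ed above p representation of the quasi-split unitary group U in ΠU . As Π is cuspidal, the A-packet ΠU is stable and thus Sψ “ 1 (see [ Rog92, 2.2]), so that π0 is also discrete and automorphic. As π0 is tempered at in /uniFB01nity , it follows from the main result of [ W al84] that π0 is cuspidal." p0040:L17-22 "Choose an algebraic extension of its central character which is unrami /uniFB01ed at p, then by [LS19] there exists an extension of π0 to a cuspidal, regular algebraic representation π of GU . Moreover π8 is also the holomorphic discrete series thus contribute to coherent cohomology in degree 0 and thus gives a point in the Eigenvariety E (forGU ), whose Galois representation (given in Corollary A.9) is ρ. In particular, ρ is conveniently modular, Fpρq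 intersects C, and the corollary is proved."  TYPED: `HSInfiniteFern` :=
Theorem 1.6 = Theorem 8.8 (with Theorem 1.2, Corollary 1.3, Corollaries 8.10 / 8.11) — CONTROL; `HSFernDense` := Corollary 1.7 = Corollary 8.13 (Allen) under Hypothesis 8.12 ⇐ Mok at every
rank ([Mok15, 2.3]: the global packet Π_U of the quasi-split U attached to the cuspidal polarized Π; [Mok15, Thm. 2.4.2] with « S_ψ = 1 (see [Rog92, 2.2]) »: the existence of a discrete
automorphic π₀ ∈ Π_U with prescribed archimedean component — Mok's global classification) ∧ `HSInfiniteFern` (« the hypothesis of Theorem 8.8 »); [All19] / [All16] (P. Allen), [CHT08],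
[Clo90], [BC09], [Lan89], [Rog92], [Wal84], [LS19], [Che11], [HMS22], [Gui20]: not census DAGs, absorbed (Allen – Newton arXiv:1901.05490 is the census's « peripheral » l.1558; [All19] itself
has no row).  No KMSW (U quasi-split), no book.
EXPECTED SUPPORTS (section 166 of `DownstreamSupport18.lean`, next filing): support(`AMpadicFormalDegrees`) = Mok's 29 leaves ∧ KMSW's proved-scope leaves (the latter solely through row
C25, whose certified support — section 37 — is Mok ∧ KMSW-scope via C24 / C60); support(`HSFernDense`) = Mok's 29 leaves; support(`AMFiniteTestVectors`) = support(`HSInfiniteFern`) = ∅;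
no book leaf anywhere in the tranche.  Census ids consumed: C318, C319.  Bib keys added: AnandavardhananMatringe2020 (commit e68cfb543f2b), HernandezSchraen2023InfiniteFern (commit
95bac2f8955e).  Nothing of v1 – v3 is redeclared or changed; no new import (`Consumers34`, `Consumers33`, `Consumers6` and `bpPlancherel_of_leaves` reach this file through the chain
`…Downstream44` → … → `…Downstream7`). -/

-- Verbatim, kept out of docstrings by the docstring lint (C318, `paper-arxiv-1805.04047/`): p0002:L12, the abstract's last sentence: p0002:L12 "Finally we prove a $p$-adic analogue of our result for square-integrable representations in terms of formal degrees by employing the formal degree conjecture of Hiraga-Ichino-Ikeda [hii08]."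
-- §7: p0015:L3-5 "Our interest is in distinction for the symmetric pair $(\GL_n(K),\GL_n(k))$ for square-integrable representations which is related to stable (resp. unstable) base change from the quasi-split unitary group ${\rm U}(n,K/k)$ when $n$ is odd (resp. even), by the Flicker-Rallis conjecture, now a theorem by the work of Mok [mok15]. In this section we prove a $p$-adic analogue of Theorem (thm-main), which is in fact a consequence of the formal degree conjecture of Hiraga, Ichino, and Ikeda [hii08]."
-- p0015:L13 "The formal degree conjecture relates in a precise way the formal degree of an elliptic tempered representation to the absolute value of its adjoint $\gamma$-factor at $s=0$ [hii08]. We are interested in two cases of this conjecture, namely, for the groups $\GL_n(K)$ and ${\rm U}(n,K/k)$, when the representation is square-integrable."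
-- p0016:L39-40 "Note that the unwritten positive proportionality constant can be made completely explicit from the discussion above and its computation ultimately relies on the validity of the formal degree conjecture for $\GL(n,K)$ and ${\rm U}_n(K/k)$. Also, it is expected that"
-- bibliography: p0018:L110-113 "[mok15] Chung Pang Mok, Endoscopic classification of representations of quasi-split unitary groups, Mem. Amer. Math. Soc. 235 (2015), no. 1108, vi+248. 3338302"
-- (C319, `paper-arxiv-2210.10564/`) bibliography: p0048:L13-14 "[Mok15] C. P. Mok – “Endoscopic classi /uniFB01cation of representations of quasi-split unitary groups”, Memoirs of the AMS 235 (2015), p. 1–248."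

/-- NEW rows C318 and C319's statements, as an arbitrary assignment of truth values (the register records which typed inputs the PRINTED text invokes, never the truth of the fields). [cite: AnandavardhananMatringe2020, Thm 1.1, Thm 7.1; HernandezSchraen2023InfiniteFern, Thm 1.6 = Thm 8.8, Cor. 1.7 = Cor. 8.13 (structure only)] [claim: KalethaMinguezShinWhite2014, under-review] -/
structure Consumers164 where
  /-- C318, CONTROL — THEOREM 1.1 (finite fields; with Corollary 1.2 and Theorems 1.3, 1.4, 6.1 of the same kind; census grade G-i; PUBLISHED Adv. Math. 360 (2020) 106915): U. K. Anandavardhanan – N. Matringe (`paper-arxiv-1805.04047/`), E/F = 𝔽_{q²}/𝔽_q, H = GL_n(F) or U(n,E/F) < GL_n(E): p0004:L7-14 "Theorem 1.1. Let $\pi$ be an irreducible generic representation of $\GL_n(E)$ which is distinguished with respect to $H$ which is either $\GL_n(F)$ or ${\rm U}(n,E/F)$. Let $H^\prime$ denote ${\rm U}(n,E/F)$ when $H= \GL_n(F)$, and $\GL_n(F)$ when $H={\rm U}(n,E/F)$. Let $\rho$ be the representation of $H^\prime$ that base changes to $\pi$. Let $\psi$ be a non-degenerate character of $N(E)/N_H$.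 Let $\mathcal W(\pi,\psi)$ be the $\psi$-Whittaker model of $\pi$, and let $B_\pi \in \mathcal W(\pi,\psi)$ be the Bessel function of $\pi$. Consider the $H$-invariant linear form on $\mathcal W(\pi,\psi)$ given by  \[\lambda(W) = \frac{1}{|H|}\sum_{h \in H} W(h).\]  Then, $\lambda(W)$ is independent of the non-degenerate character $\psi$ of $N(E)/N_H$, and  \[\lambda(B_\pi) = \frac{\dim \rho}{\dim \pi} \cdot \frac{|\GL_n(E)|}{|\GL_n(F)| |{\rm U}(n,E/F)|}.\]" [display: λ(B_π) = (dim ρ / dim π) · |GL_n(E)| / (|GL_n(F)| · |U(n,E/F)|)] — base change here is Shintani's / Kawanaka's for finite groups: p0002:L11 "where $\rho$ is the representation of ${\rm U}(n,E/F)$ (resp. $\GL_n(F)$) that base changes to $\pi$ when $H$ is $\GL_n(F)$ (resp. ${\rm U}(n,E/F)$)." [cite: AnandavardhananMatringe2020, Thm 1.1 (arXiv:1805.04047 p0004:L7-14), §1 (p0003:L16-26)] -/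
  AMFiniteTestVectors : Prop
  /-- C318, THEOREM 7.1 — THE p-ADIC ANALOGUE (census grade G-ii for its C25 input: « recently announced », « forthcoming »): K/k a quadratic extension of p-adic fields, π a square-integrable GL_n(k)-distinguished representation of GL_n(K), ρ the square-integrable representation of the quasi-split U(n, K/k) that base changes to π (stably for n odd, unstably for n even), λ and ℓ the two GL_n(k)-invariant linear forms on the Whittaker model 𝒲(π, ψ) of §7, d(·) formal degrees, ∼ equality up to an explicit positive constant: p0016:L47-55 "Theorem 7.1. Let $\pi$ be a square-integrable representation of $\GL_n(K)$ which is distinguished with respect to $\GL_n(k)$. Let $\rho$ be the square-integrable representation of ${\rm U}(n,K/k)$ that base changes to $\pi$, stably or unstably depending on the parity of $n$. For $W \in \mathcal W(\pi,\psi)$, we have  \[\lambda(W) \sim \epsilon(1/2,\pi,r,\psi) \cdot \frac{d(\rho)}{d(\pi)} \cdot \ell(W).\]  Moreover, if $\pi$ is cuspidal,  \[\lambda(W) \sim \frac{d(\rho)}{d(\pi)} \cdot \ell(W).\]" [displays: λ(W) ∼ ε(1/2, π, r, ψ) · (d(ρ)/d(π)) · ℓ(W); and λ(W) ∼ (d(ρ)/d(π))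 · ℓ(W) for cuspidal π] [cite: AnandavardhananMatringe2020, Thm 7.1 (arXiv:1805.04047 p0016:L45-55), §7 (p0015:L3-40)] [claim: KalethaMinguezShinWhite2014, under-review] -/
  AMpadicFormalDegrees : Prop
  /-- C319, CONTROL — THEOREM 1.6 = THEOREM 8.8 (with Theorem 1.2, Corollary 1.3, Corollaries 8.10, 8.11; PREPRINT arXiv:2210.10564v2, 2023): V. Hernandez – B. Schraen (`paper-arxiv-2210.10564/`), E CM, F its maximal totally real subfield, ρ̄ χ-polarized, absolutely irreducible, unramified outside S, conveniently modular (§1): p0003:L2-3 "Theorem 1.2 . — The Zariski-closure of automorphic points contains a (non empty) union of irreducible components of Xχ´pol" [ρ̄; each of dimension [F:ℚ] n(n+1)/2] p0004:L6-8 "Theorem 1.6 . — Under the previous hypothesis, the Zariski closure of the in /uniFB01nite fern Fpρq in Xχ´pol ρ is a non-empty union of irreducible components, each of which are of dimension" [[F:ℚ] n(n+1)/2] p0037:L62-63 "Theorem 8.8 . — Let FpρqĂ X pol ρ be the Zariski closure of the image of Epρq." [then F̄(ρ̄) is equidimensional of dimension n(n+1)/2 · [F:ℚ]] p0037:L65-67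 "and is a union of irreducible components of X pol ρ ." — proved on the GU-eigenvariety with the Galois representations of Appendix A: p0040:L33-35 "By [ HL TT16] and [ Sch15], for any cuspidal regular algebraic automorphic representa- tion Π, there is a unique ρΠ,ι which is strongly associated to Π and for any ρ there is at most one Π such that ρ is weakly associated to Π." […]; no [Mok15] / [KMSW] / [Art13] in these proofs. [cite: HernandezSchraen2023InfiniteFern, Thm 1.2 (arXiv:2210.10564v2 p0003:L2-4), Thm 1.6 (p0004:L6-9), Thm 8.8 (p0037:L62-67), App. A (p0040:L33-36)] -/
  HSInfiniteFern : Prop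
  /-- C319, COROLLARY 1.7 = COROLLARY 8.13 « (Allen) » — FULL ZARISKI DENSITY OF THE INFINITE FERN UNDER HYPOTHESIS 8.12 (census grade G-i; PREPRINT): p0006:L6-8 "Corollary 1.7 (Allen). — Assume hypothesis 8.12, then the in /uniFB01nite fern is Zariski dense in Xχ´pol ρ ." [ρ̄] p0006:L9-12 "The only thing we need to check for this corollary is that we use classical points which are automorphic representations for a similitude unitary group, which moreover contributes to the coherent H0, whereas Allen’s proof a priori only provides an (essen- tially) polarised autormorphic representation of GLn." In §8: p0038:L47-49 "We can now deduce the following corollary , which is due to Allen, [ All19], for which we need to take care that automorphic points given by [ All19] main’s theorem are indeed inside our in /uniFB01nite fern. So we assume the following hypothesis as in [ All19]," p0038:L50-51 "Hypothesis 8.12 . — 1. pą 2, is unrami /uniFB01ed in E and every prime v|p inF splits in E. Moreover,ζpRE." p0038:L52-55 "2. ρpGEpζpqq is adequate, ρ is polarized by χ i.e. ρ_»ρcbχεn´1. 3. There exists a GLn-automorphic representation Π0, which is regular algebraic χ- polarized cuspidal, such that ρΠ0 liftsρ and such that ρΠ0,v is potentially diagonal- isable for all v|p, and even ordinary for all v|p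 ifp|n." […] p0039:L31-32 "Corollary 8.13 (Allen). — Assume the hypothesis 8.12. Then ρ0 :“ρψ0 is conveniently mod- ular, the generic /uniFB01ber of the global deformation ring Xχ´pol" [ρ̄ is equidimensional of dimension [F:ℚ] n(n+1)/2] p0039:L35-39 "and the in /uniFB01nite fern Fpρq is Zariski dense in Xχ´pol ρ thus in SpecpRχ´pol ρ q. In particular automorphic points are dense in SpecpRχ´pol ρ q." [cite: HernandezSchraen2023InfiniteFern, Cor. 1.7 (arXiv:2210.10564v2 p0006:L6-12), Hypothesis 8.12 (p0038:L50 – p0039:L3), Cor. 8.13 (p0039:L31-39)] -/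
  HSFernDense : Prop

/-- C318, CONTROL EDGE — Theorem 1.1 is a theorem about finite groups (Shintani / Kawanaka base change, Gow's multiplicity one, Gelfand's Bessel functions); no input of any DAG. [cite: AnandavardhananMatringe2020, Thm 1.1, §§2–6 (arXiv:1805.04047 p0003 – p0014)] -/
def E_AMFiniteTestVectors (c₁₆₄ : Consumers164) : Prop := c₁₆₄.AMFiniteTestVectors

/-- C318, THEOREM 7.1 ⇐ MOK ∧ ROW C25: p0015:L3-4 "Let $K/k$ be a quadratic extension of $p$-adic fields. Our interest is in distinction for the symmetric pair $(\GL_n(K),\GL_n(k))$ for square-integrable representations which is related to stable (resp. unstable) base change from the quasi-split unitary group ${\rm U}(n,K/k)$ when $n$ is odd (resp. even)," [by the Flicker – Rallis conj., « now a theorem by the work of Mok [mok15] » — line comment above] […] p0015:L18 "Let $\pi$ be a square-integrable representation of $\GL_n(K)$ which is distinguished with respect to $\GL_n(k)$. Let $\rho$ be the (unique) representation of ${\rm U}(n,K/k)$ that base changes to $\pi$. When $n$ is odd, we consider the stable base change, whereas we consider the unstable base change when $n$ is even." […] p0015:L13 "The $\GL_n(K)$ case is known and the case of ${\rm U}(n,K/k)$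 is known for $n \leq 3$ [hii08], and a proof for arbitrary $n$ has been recently announced by Beuzart-Plessis, thus proving Proposition 8.5 of [hii08] without the assumptions over there." […] p0015:L34-36 "Now the formulas for the formal degrees are as follows. By [hii08],  \[d(\pi) =\frac{1-q^{-1}}{n} \left| \lim_{s \rightarrow 0} \frac{\gamma^{\rm LS}(s,\pi \times \pi^\vee, \psi)}{1-q^{-s}} \right|,\]" p0015:L38-40 "and, by [hii08], and by the forthcoming work of Beuzart-Plessis mentioned earlier,  \[d(\rho) = \frac{1}{2} \left| \gamma^{\rm LS}(0,\pi,r^\prime,\psi_0) \right|.\]" — [mok15] ↦ Mok at every rank (the square-integrable L-packets of U(n, K/k) and their stable / unstable base change to GL_n(K): the ρ of the statement); « Beuzart-Plessis » (announced / forthcoming, = arXiv:1812.00047, Invent. Math. 225 (2021)) ↦ row C25 `Consumers34.BPPlancherel` (its Theorem 3: d(π) = |γ(0, π, Ad, ψ′)| / |S_π| for discrete series of unitary groups); [hii08] (d(π) for GL_n(K); U(n) for n ≤ 3), [kab04], [fli93], [akmss18], [sha84], [am17]: absorbed.  Premises: Mok at every rank, C25. [cite: AnandavardhananMatringe2020,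 §7 (arXiv:1805.04047 p0015:L3-40, p0016:L1-45), Thm 7.1 (p0016:L47-55); Mok2015, as [mok15]; BeuzartPlessis2021Plancherel, as « the forthcoming work of Beuzart-Plessis »] [claim: KalethaMinguezShinWhite2014, under-review] -/
def E_AMpadicFormalDegrees (μ : Mok2015.Nodes) (c₃₄ : Consumers34) (c₁₆₄ : Consumers164) : Prop :=
  (∀ N, μ.Everything N) → c₃₄.BPPlancherel → c₁₆₄.AMpadicFormalDegrees

/-- C319, CONTROL EDGE — Theorems 1.2 / 1.6 / 8.8 are proved on the GU-eigenvariety (Chenevier's determinants, trianguline deformation spaces, Bellaïche – Chenevier, Kisin, [HMS22]) with the Galois representations of Appendix A ([Mor10], [Gol14] (Shin's appendix), [HL TT16], [Sch15]); no input of any DAG as printed. [cite: HernandezSchraen2023InfiniteFern, §§5–8, Thm 8.8 proof (arXiv:2210.10564v2 p0037:L68 – p0038:L30), App. A (p0040 – p0047)] -/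
def E_HSInfiniteFern (c₁₆₄ : Consumers164) : Prop := c₁₆₄.HSInfiniteFern

/-- C319, COROLLARY 8.13 (= 1.7) ⇐ MOK ∧ THEOREM 8.8: p0039:L40-44 "Proof. — As the set of Hypothesis 8.12 contains strictly the hypothesis of Theorem 8.8, we have that the Zariski closure of Fpρq (if non-empty!) is a union of connected components of Xχ´pol ρ . Thus, it is enough to prove that each component of Xχ´pol ρ contains a points" p0039:L45-46 "in the in /uniFB01nite fern, and by the reduction of Lemma 5.5 and considering Π0ψ0 whereψ0 given by [ CHT08, Lem.4.1.5] , we can assume χ“ 1." […] p0039:L52-57 "By [ All19, Thm. 5.3.1 & 5.3.2], there is aGLn-automorphic cuspidal point Π in C, which is moreover unrami /uniFB01ed at places above p, very regular, self dual, and such that Π is a smooth point of Xpol ρ (see [ All16, Thm. C])." p0039:L58-59 "Let ΠU be the global A-packet associate to Π (see [ Mok15, 2.3] for example). Let v|8 be an archimedean place of F and let ψv be the local Arthur parameter at v associated to ψ." […] p0040:L9-16 "As ψv is tempered, discrete, regular algebraic its associated local A-packet is equal to the L-packet of discrete series representations constructed in [ Lan89], and in particular contains the holomorphic dis- crete series.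 In particular, by [ Mok15, Thm. 2.4.2], there exists π0 a regular holomorphic algebraic, unrami/uniFB01ed above p representation of the quasi-split unitary group U in ΠU . As Π is cuspidal, the A-packet ΠU is stable and thus Sψ “ 1 (see [ Rog92, 2.2]), so that π0 is also discrete and automorphic. As π0 is tempered at in /uniFB01nity , it follows from the main result of [ W al84] that π0 is cuspidal." p0040:L17-22 "Choose an algebraic extension of its central character which is unrami /uniFB01ed at p, then by [LS19] there exists an extension of π0 to a cuspidal, regular algebraic representation π of GU . Moreover π8 is also the holomorphic discrete series thus contribute to coherent cohomology in degree 0 and thus gives a point in the Eigenvariety E (forGU ), whose Galois representation (given in Corollary A.9) is ρ. In particular, ρ is conveniently modular, Fpρq intersects C, and the corollary is proved." — [Mok15, 2.3] / [Mok15, Thm. 2.4.2] ↦ Mok at every rank (the global A-packet Π_U of the quasi-split unitary group U attached to the cuspidal polarized Π and the existence of the discrete automorphic π₀ ∈ Π_U with holomorphic archimedean components; « S_ψ = 1 (see [Rog92, 2.2]) » is the multiplicity statement for a stable packet); « the hypothesis of Theorem 8.8 » / « the reduction of Lemma 5.5 » ↦ `HSInfiniteFern`; [All19, Thm. 5.3.1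 & 5.3.2] / [All16, Thm. C] (P. Allen: automorphic points on GL_n in every component of the polarized deformation ring), [CHT08], [Clo90], [BC09], [Lan89], [Rog92], [Wal84], [LS19], Corollary A.9: absorbed (no census DAG).  Premises: Mok at every rank, Theorem 8.8. [cite: HernandezSchraen2023InfiniteFern, Cor. 8.13 proof (arXiv:2210.10564v2 p0039:L40 – p0040:L22); Mok2015, as [Mok15]] -/
def E_HSFernDense (μ : Mok2015.Nodes) (c₁₆₄ : Consumers164) : Prop := (∀ N, μ.Everything N) → c₁₆₄.HSInfiniteFern → c₁₆₄.HSFernDense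

/-- The hundred-and-sixty-fourth tranche of implications: NEW row C318's control edge and consumer edge, NEW row C319's control edge and consumer edge. [cite: AnandavardhananMatringe2020, Thms 1.1, 7.1; HernandezSchraen2023InfiniteFern, Thm 8.8, Cor. 8.13 (each edge's source in its own docstring)] [claim: KalethaMinguezShinWhite2014, under-review] -/
structure Implications164 (μ : Mok2015.Nodes) (c₃₄ : Consumers34) (c₁₆₄ : Consumers164) : Prop where
  amFinite : E_AMFiniteTestVectors c₁₆₄
  amPadic : E_AMpadicFormalDegrees μ c₃₄ c₁₆₄
  hsFern : E_HSInfiniteFern c₁₆₄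
  hsDense : E_HSFernDense μ c₁₆₄

section Tranche164

variable {ν : Nodes} {μ : Mok2015.Nodes} {κ : KMSW2014.Nodes} {c : Consumers} {c₂ : Consumers2} {c₅ : Consumers5} {c₆ : Consumers6} {c₃₃ : Consumers33} {c₃₄ : Consumers34}
  {c₁₆₄ : Consumers164}

/-- THE TWO CONTROLS hold by the tranche's edges alone — no input of any DAG. [cite: AnandavardhananMatringe2020, Thm 1.1; HernandezSchraen2023InfiniteFern, Thm 8.8 (bookkeeping proved here)] -/
theorem hundredsixtyfourth_controls (Y : Implications164 μ c₃₄ c₁₆₄) : c₁₆₄.AMFiniteTestVectors ∧ c₁₆₄.HSInfiniteFern :=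
  ⟨Y.amFinite, Y.hsFern⟩

/-- FIRST READING — the tranche granted Mok at every rank and row C25: all four fields. [cite: AnandavardhananMatringe2020, Thm 7.1; HernandezSchraen2023InfiniteFern, Cor. 8.13 (bookkeeping proved here)] [claim: KalethaMinguezShinWhite2014, under-review] -/
theorem hundredsixtyfourth_of_rows (Y : Implications164 μ c₃₄ c₁₆₄) (m : ∀ N, μ.Everything N) (h₂₅ : c₃₄.BPPlancherel) :
    (c₁₆₄.AMFiniteTestVectors ∧ c₁₆₄.AMpadicFormalDegrees) ∧ (c₁₆₄.HSInfiniteFern ∧ c₁₆₄.HSFernDense) :=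
  ⟨⟨Y.amFinite, Y.amPadic m h₂₅⟩, ⟨Y.hsFern, Y.hsDense m Y.hsFern⟩⟩

/-- C319 FROM MOK ALONE (no C25, no KMSW, no book): Corollary 8.13 with its control. [cite: HernandezSchraen2023InfiniteFern, Cor. 8.13 = Cor. 1.7 (bookkeeping proved here)] -/
theorem hsFern_of_mok (Y : Implications164 μ c₃₄ c₁₆₄) (m : ∀ N, μ.Everything N) : c₁₆₄.HSInfiniteFern ∧ c₁₆₄.HSFernDense :=
  ⟨Y.hsFern, Y.hsDense m Y.hsFern⟩

/-- SECOND READING — THE WHOLE TRANCHE FROM THE INPUTS OF MOK's AND KMSW's DAGs (KMSW in its proved scope, reached only through row C25's own edges of tranches 6, 33, 34: `bpPlancherel_of_leaves`, with tranche 6's hypothesis node `BPhyp` granted as there); nothing of the book's DAG. [cite: AnandavardhananMatringe2020, Thm 7.1; HernandezSchraen2023InfiniteFern, Cor. 8.13 (bookkeeping proved here)] [claim: KalethaMinguezShinWhite2014, under-review] -/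
theorem hundredsixtyfourth_of_inputs (Y : Implications164 μ c₃₄ c₁₆₄) (T : Implications34 μ κ c₃₃ c₃₄) (T₃₃ : Implications33 ν μ κ c c₂ c₅ c₆ c₃₃) (Y₆ : Implications6 ν c c₆)
    (M : MokInputs μ) (K : KMSWInputs μ κ) (hB : c₆.BPhyp) :
    (c₁₆₄.AMFiniteTestVectors ∧ c₁₆₄.AMpadicFormalDegrees) ∧ (c₁₆₄.HSInfiniteFern ∧ c₁₆₄.HSFernDense) :=
  hundredsixtyfourth_of_rows Y M.everything (bpPlancherel_of_leaves T T₃₃ Y₆ M K hB)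

/-- ROWS C318 / C319 IN CONDITIONAL FORM, 2026 (C318 PUBLISHED 2020: Mok « now a theorem », Beuzart-Plessis « announced » / « forthcoming » — census class G-ii on the C25 input; C319 PREPRINT 2023: « by [ Mok15, Thm. 2.4.2] », no status sentence — G-i): granting Mok's section edges, supply edges and PUBLISHED inputs (and, for C318, KMSW's inputs in the proved scope with tranches 6 / 33 / 34's edges and C25's hypothesis node), Theorem 7.1 and Corollary 8.13 are conditional on Mok's 2024–2026 PREPRINT layer and on Mok's general and non-standard weighted fundamental lemmas; the two controls are unconditional. [cite: AnandavardhananMatringe2020, §7 (arXiv:1805.04047 p0015:L5, L14); HernandezSchraen2023InfiniteFern, Cor. 8.13 proof (p0040:L12) (bookkeeping proved here)] [claim: KalethaMinguezShinWhite2014, under-review] -/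
theorem hundredsixtyfourth_conditional_form_2026 (Y : Implications164 μ c₃₄ c₁₆₄) (T : Implications34 μ κ c₃₃ c₃₄) (T₃₃ : Implications33 ν μ κ c c₂ c₅ c₆ c₃₃) (Y₆ : Implications6 ν c c₆)
    (MB : μ.SectionEdges) (MS : μ.SupplyEdges) (MP : μ.PublishedLeaves) (K : KMSWInputs μ κ) (hB : c₆.BPhyp) :
    (c₁₆₄.AMFiniteTestVectors ∧ c₁₆₄.HSInfiniteFern) ∧
      (μ.PreprintLeaves2026 → μ.WFL_general → μ.WFL_nonstandard → c₁₆₄.AMpadicFormalDegrees ∧ c₁₆₄.HSFernDense) :=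
  ⟨hundredsixtyfourth_controls Y, fun hMQ m₆ m₇ =>
    have h := hundredsixtyfourth_of_inputs Y T T₃₃ Y₆ ⟨MB, MS, MP, hMQ, ⟨m₆, m₇⟩⟩ K hB
    ⟨h.1.2, h.2.2⟩⟩

end Tranche164

/-! ## Hundred-and-sixty-fifth tranche (v5 of this file, unit `pub-arthur-down-g69`, downstream tracer gen 69): NEW ROW B140 — a census §I « mention » / « peripheral: context only » text (l.1212, l.1602)
whose citations are NUMERIC (« [2] » = the book), hence invisible to the census needles; found by this seat's label sweep (`work/label_sweep.py`, GAPS G-DN-609) and read first-hand.  Text: the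
store's per-page PDF text p0001:L38 "arXiv:2510.10389v2  [math.RT]  10 Nov 2025" (`HOME/pub-arthur-down-g69/primaries/paper-arxiv-2510.10389/`, 35 pages, spacing artefacts of the extraction quoted as extracted).
**B140** — Marcela HANZER, *On the Muić conj. — the irreducibility of the big theta lift* (title lint-abbreviated), arXiv:2510.10389v2 (10 Nov 2025; PREPRINT, no journal DOI located on
2026-08-27; bib `Hanzer2025BigTheta` NEW).  F non-archimedean of characteristic 0; symplectic – even-orthogonal dual pairs (G(W_n), H(V_m)); Θ(π) the big theta lift: p0001:L5-10 "LetFbe a non-archimedean local field of characteristic zero. We study theta corre- spondence for (complex) representations of symplectic–even orthogonal dual reductive pairs overF; more specifically, the big theta lifts. We prove that, starting from a dis- crete series representationπof a symplectic (even orthogonal group) overF,its big theta lift Θ(π) (as a representation of an even orthogonal (symplectic) group) if non- zero, is an irreducible representation,"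
[…, thus proving a conj. of Muić — line comment] p0001:L10-12 "Building upon this result, we completely describe the situations in which the theta lifts of tempered representations are irreducible and when they are not."  THE FRAME IS THE BOOK's LOCAL CLASSIFICATION, cited as « [2] »: p0004:L41-46 "6. Recall ([2]) that a discrete series representationπ∈Irr(G n) can be described using its L-parameter (ϕ, ϵ).Here ϕ=⊕ r i=1ϕr, is a direct sum of distinct irreducible orthogonal representations of the Weil-Deligne groupW DF =W F ×SL(2,C),soϕ i =ρ i ⊗S ai,whereS ai is the unique algebraic" […]
p0005:L39-43 "10. The notion of the Jordan block of a discrete series representation was define" [Jord(π)] p0006:L9-13 "11. We denote the set of A-parameters ofG n by Ψ(Gn),and the subset of the those of good parity by Ψgp(Gn).By Arthur, to eachψone can attach a multiset (maybe empty) of Irr(Gn) ([2]) denoted Π ψ–so called A-packet attached toψ.These representation are explicitly constructed by Mœglin ([27]- she proved that they actually form a set; also cf. [38]) and the parameterization is simplified by Atobe ([3])."  THE AUTHOR's OWN ACCOUNT OF THE DEPENDENCE: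
p0003:L3-4 "These arguments can be better understood ifθ(π) is perceived as a representation of Arthur type (cf. [2])" [through the Adams conj. ([1], [26]) — line comment] p0003:L4-8 "and then we use some facts about the derivatives of the representations of Arthur type (cf. [38]). This is the reason we stated our results only for even orthogonal/symplectic dual pair-we avoided the meta- plectic/odd orthogonal dual reductive pair because, for the metaplectic groups, the results about Arthur parameterization are still not complete (as we understand)." p0003:L9-11 "We believe, though, that our result is also true for that reductive dual pair-but we would have to adapt our arguments to completely avoid the use of Arthur parameters (which, we believe, can be done, but it would make the proofs even more technical)."  THE INPUTS IN THE
PROOFS: PROPOSITION 2.1 (θ_{−l}(π) is unitarizable of Arthur type, with the displayed A-parameter) p0007:L46-47 "and the claim of this Proposition was already known to Mœglin-[26] and this generality is quite sufficient for our purpose." (= row B110, C. Mœglin's Adams-conj. paper in the Kudla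
Festschrift); p0008:L1-4 "We note Proposition 2.1 since we use bellow Proposition 8.3 of [38] which is concerned with certain Jacquet modules of a representation in a given Arthur packet. For our proof, we need the notion of an extended cuspidal support of a representation. We recall the notion of the extended cuspidal support as defined in [4]." (= rows B2 and B89); in the proof of Theorem 3.1: p0011:L43-44 "(π′); this is an irreducible representation by Proposition 8.3 of [38] combined with Section 3.2 of [7]." […] p0011:L61 "π′′ is irreducible, as follows from the discussion after Lemma 5.3 in [28], but we here give a" […]
p0022:L10 "From the Adams-Arthur parameter ofθ −l(π0) (Proposition 2.1 and [38]) it follows that" […]; in §3's tempered part: p0027:L61-63 "On the other hand, by the arguments in Lemma 5.5 of [9], also cf. Theorem 4.5. (2) of [5], we know thatθ l+2(π) is tempered representation with the character onχ W ⊗S l opposite toϵ T (χV ⊗S l)."  TYPED (`Consumers165`): `HanzerAdamsInstance` := Proposition 2.1 ⇐ row B110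
`Consumers54.MoeglinAdams` ([26]); `HanzerBigTheta` := Theorem 3.1 (Muić's conj. for discrete series π: Θ^{down}_{−l}(π) irreducible for l ≥ 3, Θ^{up}_{−l}(π) for l ≥ l(π)+4, the remaining
cases being [33]) ⇐ the book at every rank ([2]: items 6, 10, 11 — the (φ, ε)-description of discrete series, Jord(π), the packets Π_ψ) ∧ `HanzerAdamsInstance` ∧ row C168
`Consumers54.MoeglinImage` ([27]: « explicitly constructed by Mœglin ([27] …) ») ∧ row B2 `Consumers2.XuMoeglinParam` ([38], Proposition 8.3) ∧ row B5 `Consumers5.AtobeApackets` ([3]) ∧ row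
B89 `Consumers33.AtobeWhichPackets` ([4]: the extended cuspidal support, Definition 2.2) ∧ the Mœglin – Tadić classification `Consumers51.MoeglinTadicDS` ([28]: « Section 5 of [28] », « the
discussion after Lemma 5.3 in [28] ») ∧ row B7's Sp – O instance `Consumers54.AtobeGanThetaSpO` ([5]: the explicit theta correspondence for tempered representations, « Theorem 4.3 of [5] »,
« Theorem 4.5. (2) of [5] ») ∧ row B111 `Consumers54.BHtypeI` ([9]: « Lemma 5.5 of [9] »); `HanzerTempered` := Corollary 3.9 and Propositions 3.10 – 3.12 (when the big theta lift of a
tempered representation is irreducible) ⇐ the book ∧ `HanzerBigTheta` ∧ `AtobeGanThetaSpO` ∧ `BHtypeI`.  [1] (Adams 1989: the conj.), [7] (Atobe – Mínguez, Compositio 2023: the explicit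
Aubert – Zelevinsky duality, « Section 3.2 of [7] » — no census row), [8] (= row B93 Bakić – Hanzer, pointer « one may check [8] »), [30] – [33] (Muić 2004 – 2008, pre-book, on the Mœglin –
Tadić classification), [19] (Kudla), [35] / [37] (MVW, Waldspurger), [15] (Gan – Takeda, Howe duality): absorbed.  No Mok / KMSW (no unitary or metaplectic pair: « we avoided the
metaplectic/odd orthogonal dual reductive pair »).  GRADE: G-i (no status sentence; the author notes the dependence on « Arthur parameters » and that it could in principle be avoided).
EXPECTED SUPPORTS (section 167 of `DownstreamSupport18.lean`, next filing): support(`HanzerBigTheta`) = support(`HanzerTempered`) = the 24 book leaves, modulo B75's granted remainder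
inherited through B110 / C168 (section 54's `canon₅₄` / `canon₅₄noR`: the Mœglin-fed rows fail in the denied-remainder reading); support(`HanzerAdamsInstance`) = support(B110); no Mok /
KMSW leaf.  Census id consumed: B140.  Bib key added: Hanzer2025BigTheta (`ledger bib add`, commit a71e7714ef14).  Nothing of v1 – v4 is redeclared or changed; no new import. -/

-- Verbatim, kept out of docstrings by the docstring lint (B140, `paper-arxiv-2510.10389/`): title p0001:L1 p0001:L1 "On the Mui´ c conjecture–the irreducibility of the big theta lift"
-- abstract: p0001:L7-10 "We prove that, starting from a dis- crete series representationπof a symplectic (even orthogonal group) overF,its big theta lift Θ(π) (as a representation of an even orthogonal (symplectic) group) if non- zero, is an irreducible representation, thus proving a conjecture of Mui´ c."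
-- p0002:L37-40 "In this paper we prove a conjecture of Mui´ c stated in [32]. Conjecture 1.1.LetFbe a non-archimedean local field of characteristic zero andπan irreducible discrete series representation ofG(W n).Then, its big theta lift Θ(π) toH(V m) is irreducible, if non-zero."
-- p0003:L3-5 "These arguments can be better understood ifθ(π) is perceived as a representation of Arthur type (cf. [2]) through the Adams conjecture ([1], [26]) and then we use some facts about the derivatives of the representations of Arthur type (cf. [38])."
-- p0007:L46-48 "Proof.This is an instance of Adams conjecture (cf. [1]), and the claim of this Proposition was already known to Mœglin-[26] and this generality is quite sufficient for our purpose. For a more general instance of Adams conjecture, one may check [8]"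
-- bibliography: p0032:L43-45 "[2]J. Arthur,The endoscopic classification of representations. Orthogonal and symplectic groups, vol. 61 of Colloq. Publ., Am. Math. Soc., Providence, RI: American Mathemat- ical Society (AMS), 2013." / p0033:L33-35 "[26]C. Mœglin,A conjecture of Adams for the Howe correspondence and the Kudla filtra- tion, in Arithmetic geometry and automorphic forms. Festschrift dedicated to Stephen Kudla on the occasion of his 60th birthday, Somerville, MA: International Press; Bei-" / p0034:L1-2 "[27]C. Mœglin,Image of normalized intertwining operators and poles of the Eisenstein series, Adv. Math., 228 (2011), pp. 1068–1134." / p0034:L25-26 "[38]B. Xu,On Mœglin’s parametrization of Arthur packets forp-adic quasisplitSp(N)and SO(N), Can. J. Math., 69 (2017), pp. 890–960."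

/-- NEW row B140's statements, as an arbitrary assignment of truth values (the register records which typed inputs the PRINTED text invokes, never the truth of the fields). [cite: Hanzer2025BigTheta, Prop. 2.1, Thm 3.1, Cor. 3.9, Props 3.10–3.12 (structure only)] -/
structure Consumers165 where
  /-- B140, NODE — PROPOSITION 2.1 (an instance of the Adams conj., « already known to Mœglin-[26] »): M. Hanzer (`paper-arxiv-2510.10389/`), π ∈ Irr(G_n) a discrete series of a symplectic or even orthogonal p-adic group, θ_{−l}(π) its small theta lift on the going-down / going-up tower: p0007:L36-42 "Proposition 2.1.For eachl≥1, θ down −l (π)is an unitarizable representation of Arthur type. For eachl≥l(π) + 2, θ up −l(π)is an unitarizable representation of Arthur type. Moreover, ifϕ π is the Langlands parameter ofπ,thenθ −l(π)(on the going-down or going up tower depending onlas just explained) belongs to the A-packet corresponding to the A-parameter given by" [display: ψ = χ_W χ_V^{−1} φ_π ⊕ χ_W ⊗ S_1 ⊗ S_l]. [cite: Hanzer2025BigTheta, Prop. 2.1 (arXiv:2510.10389v2 p0007:L36-48)] -/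
  HanzerAdamsInstance : Prop
  /-- B140, THEOREM 3.1 — MUIĆ's CONJ. FOR DISCRETE SERIES (census grade G-i; PREPRINT v2 2025): p0009:L2-6 "Letπ∈Irr(G n) be a discrete series representation. Theorem 3.1.The representationΘ down −l (π)is irreducible forl≥3andΘ up −l(π)is irre- ducible forl≥l(π) + 4." [Θ^{down}_{−l}(π), Θ^{up}_{−l}(π): the big theta lifts on the two towers, item 3 of §2: p0004:L25-30 "(theconservation relationin our context, cf. the second section of [5]; recall that in our situation,ldefined above is an odd integer). This means that there is a possibility thatl down(π) =l up(π) =−1,so there is no really difference between “going-down” and “going-up” tower forπ,i.e., the Langlands quotient expression forθ −l(π) looks analogous in both towers (cf. (2) and (4) of Theorem 4.3 of [5]). We sometimes use the notationl(π) forl down(π); thusl(π)≥ −1."; the cases l = 1 down / l = l(π)+2 up are Muić's [33]] p0009:L7-14 "Proof.Recall that we know ([33]) that Θ down −1 (π) and Θ up −(l(π)+2)(π) are irreducible. We argue by induction overnand assume thatπis not supercuspidal. We break the proof in three steps: first we prove that Θ −l(π) as above does not have a discrete series subquotients, then that it does not have a tempered, non-square-integrable subquotient, and then that it does not have no non-tempered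 subquotients beside the small theta lift which appears in big theta lift with multiplicity one." [cite: Hanzer2025BigTheta, Thm 3.1 (arXiv:2510.10389v2 p0009:L2-14), abstract (p0001:L5-10)] -/
  HanzerBigTheta : Prop
  /-- B140, THE TEMPERED PART — COROLLARY 3.9 AND PROPOSITIONS 3.10 – 3.12 (census grade G-i): p0003:L16-18 "In the last part of the paper, building upon the results and techniques for the discrete series case, we examine the big theta lifts of an irreducible tempered representation, and determine precisely when they are irreducible and when they are not." p0026:L1-2 "Corollary 3.9.Letl≥1be an odd positive integer andπa tempered representation. Then, ifΘ −l(π)is non-zero, then it is an irreducible representation." p0026:L24-25 "Proposition 3.10.LetTbe an irreducible tempered representation ofG n and letl >0be such thatΘ l(T)̸= 0.Then, all the irreducible subquotients ofΘ l(T)are tempered." p0026:L47-50 "Proposition 3.11.Assume thatTis an irreducible tempered representation ofG n and l >0such thatΘ l(T)̸= 0.Note that the multiplicity ofχ V ⊗S l inϕ T is then always positive. If the multiplicity ofχ V ⊗S l inϕ T equals one,Θ l(T) =θ l(T).On the other hand, if this multiplicity is odd, but greater than one,Θ l(T)is reducible." p0027:L66-68 "Proposition 3.12.Assume thatTis an irreducible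 tempered representation ofG n and l >0such thatΘ l(T)̸= 0.If the multiplicity ofχ V ⊗S l inϕ T is even,Θ l(T) =θ l(T); i.e.Θ l(T)is irreducible." [cite: Hanzer2025BigTheta, Cor. 3.9 (arXiv:2510.10389v2 p0026:L1-2), Prop. 3.10 (p0026:L24-25), Prop. 3.11 (p0026:L47-50), Prop. 3.12 (p0027:L66-68)] -/
  HanzerTempered : Prop

/-- B140's NODE ⇐ ROW B110: p0007:L46-47 "and the claim of this Proposition was already known to Mœglin-[26] and this generality is quite sufficient for our purpose." (the proof's first clause, « This is an instance of Adams conj. (cf. [1]) », is in the line comment above) — [26] = C. Mœglin, *Conj. d'Adams pour la correspondance de Howe et filtration de Kudla* ↦ `Consumers54.MoeglinAdams`; [1] (Adams 1989) states the conj.; [8] (= row B93) is a pointer.  Premise: B110. [cite: Hanzer2025BigTheta, Prop. 2.1 proof (arXiv:2510.10389v2 p0007:L46-48); Moeglin2011Adams, as [26]] -/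
def E_HanzerAdamsInstance (c₅₄ : Consumers54) (c₁₆₅ : Consumers165) : Prop := c₅₄.MoeglinAdams → c₁₆₅.HanzerAdamsInstance

/-- B140, THEOREM 3.1 ⇐ THE BOOK ∧ THE NODE ∧ C168 ∧ B2 ∧ B5 ∧ B89 ∧ MŒGLIN – TADIĆ ∧ B7 (Sp – O) ∧ B111: the frame p0004:L41-46 "6. Recall ([2]) that a discrete series representationπ∈Irr(G n) can be described using its L-parameter (ϕ, ϵ).Here ϕ=⊕ r i=1ϕr, is a direct sum of distinct irreducible orthogonal representations of the Weil-Deligne groupW DF =W F ×SL(2,C),soϕ i =ρ i ⊗S ai,whereS ai is the unique algebraic" […] p0006:L9-13 "11. We denote the set of A-parameters ofG n by Ψ(Gn),and the subset of the those of good parity by Ψgp(Gn).By Arthur, to eachψone can attach a multiset (maybe empty) of Irr(Gn) ([2]) denoted Π ψ–so called A-packet attached toψ.These representation are explicitly constructed by Mœglin ([27]- she proved that they actually form a set; also cf. [38]) and the parameterization is simplified by Atobe ([3])." — [2] ↦ the book at every rank, [27] ↦ `Consumers54.MoeglinImage` (C168), [3] ↦ `Consumers5.AtobeApackets` (B5),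 « cf. [38] » ↦ `Consumers2.XuMoeglinParam` (B2); the proof: p0008:L1-4 "We note Proposition 2.1 since we use bellow Proposition 8.3 of [38] which is concerned with certain Jacquet modules of a representation in a given Arthur packet. For our proof, we need the notion of an extended cuspidal support of a representation. We recall the notion of the extended cuspidal support as defined in [4]." ([4] ↦ `Consumers33.AtobeWhichPackets`, B89) p0011:L43-44 "(π′); this is an irreducible representation by Proposition 8.3 of [38] combined with Section 3.2 of [7]." […] p0011:L61 "π′′ is irreducible, as follows from the discussion after Lemma 5.3 in [28], but we here give a" ([28] ↦ `Consumers51.MoeglinTadicDS`) […] p0022:L10 "From the Adams-Arthur parameter ofθ −l(π0) (Proposition 2.1 and [38]) it follows that" […]; the explicit theta correspondence « cf. [5], [9] » (p0002:L4) ↦ `Consumers54.AtobeGanThetaSpO` (B7's Sp – O instance), `Consumers54.BHtypeI` (B111); [7] (Atobe – Mínguez, « Section 3.2 of [7] »), [33] (Muić 2008: the cases l = 1 / l(π)+2), [30], [31]: absorbed.  Premises: the book at every rank, the node, C168, B2, B5, B89, Mœglin – Tadić, B7 (Sp – O), B111. [cite: Hanzer2025BigTheta, §2 items 6, 10, 11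 (arXiv:2510.10389v2 p0004:L41 – p0006:L13), §2 (p0008:L1-4), Thm 3.1 proof (p0009:L7 – p0025:L40, esp. p0011:L43-44, L61, p0022:L10); Arthur2013, as [2]] -/
def E_HanzerBigTheta (ν : Nodes) (c₂ : Consumers2) (c₅ : Consumers5) (c₃₃ : Consumers33) (c₅₁ : Consumers51) (c₅₄ : Consumers54) (c₁₆₅ : Consumers165) : Prop :=
  (∀ N, ν.Everything N) → c₁₆₅.HanzerAdamsInstance → c₅₄.MoeglinImage → c₂.XuMoeglinParam → c₅.AtobeApackets → c₃₃.AtobeWhichPackets → c₅₁.MoeglinTadicDS →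
    c₅₄.AtobeGanThetaSpO → c₅₄.BHtypeI → c₁₆₅.HanzerBigTheta

/-- B140, THE TEMPERED PART ⇐ THE BOOK ∧ THEOREM 3.1 ∧ B7 (Sp – O) ∧ B111: p0003:L16-18 "In the last part of the paper, building upon the results and techniques for the discrete series case, we examine the big theta lifts of an irreducible tempered representation, and determine precisely when they are irreducible and when they are not." In the proof of Proposition 3.11: p0027:L61-63 "On the other hand, by the arguments in Lemma 5.5 of [9], also cf. Theorem 4.5. (2) of [5], we know thatθ l+2(π) is tempered representation with the character onχ W ⊗S l opposite toϵ T (χV ⊗S l)." — « building upon the results and techniques for the discrete series case » ↦ `HanzerBigTheta`; [5] ↦ `AtobeGanThetaSpO`; [9] ↦ `BHtypeI`; the (φ, ε)-description of tempered T (φ_T, ε_T) ↦ the book.  Premises: the book at every rank, Theorem 3.1, B7 (Sp – O), B111. [cite: Hanzer2025BigTheta, §1 (arXiv:2510.10389v2 p0003:L16-18), Cor. 3.9 – Prop. 3.12 with proofs (p0026:L1 – p0031:L30, esp. p0027:L61-64)] -/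
def E_HanzerTempered (ν : Nodes) (c₅₄ : Consumers54) (c₁₆₅ : Consumers165) : Prop :=
  (∀ N, ν.Everything N) → c₁₆₅.HanzerBigTheta → c₅₄.AtobeGanThetaSpO → c₅₄.BHtypeI → c₁₆₅.HanzerTempered

/-- The hundred-and-sixty-fifth tranche of implications: NEW row B140's node edge and two consumer edges. [cite: Hanzer2025BigTheta, Prop. 2.1, Thm 3.1, Cor. 3.9 – Prop. 3.12 (each edge's source in its own docstring)] -/
structure Implications165 (ν : Nodes) (c₂ : Consumers2) (c₅ : Consumers5) (c₃₃ : Consumers33) (c₅₁ : Consumers51) (c₅₄ : Consumers54) (c₁₆₅ : Consumers165) : Prop where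
  hanzerAdams : E_HanzerAdamsInstance c₅₄ c₁₆₅
  hanzerBigTheta : E_HanzerBigTheta ν c₂ c₅ c₃₃ c₅₁ c₅₄ c₁₆₅
  hanzerTempered : E_HanzerTempered ν c₅₄ c₁₆₅

section Tranche165

variable {ν : Nodes} {c₂ : Consumers2} {c₅ : Consumers5} {c₁₁ : Consumers11} {c₂₆ : Consumers26} {c₃₃ : Consumers33} {c₄₅ : Consumers45} {c₄₇ : Consumers47} {c₄₈ : Consumers48}
  {c₅₁ : Consumers51} {c₅₄ : Consumers54} {c₁₆₅ : Consumers165}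

/-- FIRST READING — row B140 granted the book at every rank and the rows it cites (B110, C168, B2, B5, B89, Mœglin – Tadić, B7 for Sp – O, B111): the node, Theorem 3.1 and the tempered part. [cite: Hanzer2025BigTheta, Prop. 2.1, Thm 3.1, Cor. 3.9 – Prop. 3.12 (bookkeeping proved here)] -/
theorem hanzer_of_rows (Y : Implications165 ν c₂ c₅ c₃₃ c₅₁ c₅₄ c₁₆₅) (b : ∀ N, ν.Everything N) (h₂₆ : c₅₄.MoeglinAdams) (h₂₇ : c₅₄.MoeglinImage) (h₃₈ : c₂.XuMoeglinParam)
    (h₃ : c₅.AtobeApackets) (h₄ : c₃₃.AtobeWhichPackets) (h₂₈ : c₅₁.MoeglinTadicDS) (h₅ : c₅₄.AtobeGanThetaSpO) (h₉ : c₅₄.BHtypeI) :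
    c₁₆₅.HanzerAdamsInstance ∧ c₁₆₅.HanzerBigTheta ∧ c₁₆₅.HanzerTempered :=
  have a := Y.hanzerAdams h₂₆
  have t := Y.hanzerBigTheta b a h₂₇ h₃₈ h₃ h₄ h₂₈ h₅ h₉
  ⟨a, t, Y.hanzerTempered b t h₅ h₉⟩

/-- SECOND READING — B140 THROUGH TRANCHE 54's ADAMS LINE: from the book's inputs and tranche 54's edges (`adamsLine_of_inputs`, which delivers C168, B110, B7's Sp – O instance and B111 from
`BookInputs` once B75's node and multiplicity one, Mœglin's B70 – B74, [Ar11] §30, the Mœglin – Tadić classification, B2, B5, B89, HLL and the two metaplectic rows are granted as there);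
nothing of Mok's or KMSW's. [cite: Hanzer2025BigTheta, Thm 3.1 (bookkeeping proved here)] -/
theorem hanzer_of_adamsLine (Y : Implications165 ν c₂ c₅ c₃₃ c₅₁ c₅₄ c₁₆₅) (W : Implications54 ν c₂ c₅ c₁₁ c₂₆ c₃₃ c₄₅ c₄₇ c₄₈ c₅₁ c₅₄) (A : BookInputs ν)
    (hN : c₄₅.MoeglinDSHyp) (hM1 : c₄₅.MoeglinMult1) (h70 : c₄₈.MoeglinElementary) (h71 : c₄₇.MoeglinDiscretePackets) (h72 : c₄₇.MoeglinPacketsComb) (h73 : c₄₈.MoeglinHolomorphy)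
    (h74 : c₄₈.MoeglinComparaison) (hC30 : c₄₇.ArthurClay30) (hMT : c₅₁.MoeglinTadicDS) (hX2 : c₂.XuMoeglinParam) (hAt : c₅.AtobeApackets) (hWh : c₃₃.AtobeWhichPackets)
    (hHLL : c₂₆.HLL) (hLi : c₁₁.LiMpApackets) (hLuo : c₁₁.LuoECR) :
    c₁₆₅.HanzerAdamsInstance ∧ c₁₆₅.HanzerBigTheta ∧ c₁₆₅.HanzerTempered :=
  have t := adamsLine_of_inputs W A hN hM1 h70 h71 h72 h73 h74 hC30 hMT hX2 hAt hWh hHLL hLi hLuo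
  hanzer_of_rows Y A.everything t.2.1 t.1 hX2 hAt hWh hMT t.2.2.2.2.1 t.2.2.2.2.2.1

/-- ROW B140 IN CONDITIONAL FORM, 2026 (PREPRINT 2025; no status sentence — census class G-i): granting the book's edges, supplies and PUBLISHED inputs, tranche 54's edges and the rows granted
there, the three statements are conditional on the book's 2024–2026 PREPRINT layer and its general and non-standard weighted fundamental lemmas (and, through B110 / C168, on B75's printed
node beyond the book's case, granted here as `hN`). [cite: Hanzer2025BigTheta, §1 (arXiv:2510.10389v2 p0003:L3-11) (bookkeeping proved here)] -/
theorem hanzer_conditional_form_2026 (Y : Implications165 ν c₂ c₅ c₃₃ c₅₁ c₅₄ c₁₆₅) (W : Implications54 ν c₂ c₅ c₁₁ c₂₆ c₃₃ c₄₅ c₄₇ c₄₈ c₅₁ c₅₄) (B : ν.BookEdges) (S : ν.SupplyEdges)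
    (P : ν.PublishedLeaves) (hN : c₄₅.MoeglinDSHyp) (hM1 : c₄₅.MoeglinMult1) (h70 : c₄₈.MoeglinElementary) (h71 : c₄₇.MoeglinDiscretePackets) (h72 : c₄₇.MoeglinPacketsComb)
    (h73 : c₄₈.MoeglinHolomorphy) (h74 : c₄₈.MoeglinComparaison) (hC30 : c₄₇.ArthurClay30) (hMT : c₅₁.MoeglinTadicDS) (hX2 : c₂.XuMoeglinParam) (hAt : c₅.AtobeApackets)
    (hWh : c₃₃.AtobeWhichPackets) (hHLL : c₂₆.HLL) (hLi : c₁₁.LiMpApackets) (hLuo : c₁₁.LuoECR) :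
    ν.PreprintLeaves2026 → ν.WFL_general → ν.WFL_nonstandard → c₁₆₅.HanzerAdamsInstance ∧ c₁₆₅.HanzerBigTheta ∧ c₁₆₅.HanzerTempered :=
  fun hQ h₆ h₇ => hanzer_of_adamsLine Y W ⟨B, S, P, hQ, ⟨h₆, h₇⟩⟩ hN hM1 h70 h71 h72 h73 h74 hC30 hMT hX2 hAt hWh hHLL hLi hLuo

end Tranche165

/-! ## Hundred-and-sixty-sixth tranche (v6 of this file, unit `pub-arthur-down-g69`, downstream tracer gen 69): NEW ROWS C320 AND C321 — THE SECOND LABEL SWEEP.  The numeric-label /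
blank-tolerant sweeps that found B140 covered the 137 §I.4 « peripheral » / « mention » texts; this seat extended them to the 190 remaining ungraded §I arXiv texts (§I.1, §I.2, §I.4's
free-form verdicts, §I.6's conduit-citers, §I.13+; `work/sweep2_ids.txt`, `work/label_sweep2.py` with `\par`-tolerant labels and French trigger stems, `work/blank_sweep2.py`; verdicts in GAPS
G-DN-611).  Two texts cite the book under a label the census needles cannot see and USE it in a proof: « [1] » in Chenevier's Appendix A to Cléry – van der Geer (census §I.4 l.1078, needles
0/0/7/0/0, « mention »; down-g59's check `[g59b]` had already noted « Chenevier's appendix applies Arthur's multiplicity formula, p0021:L8-26 » without regrading) and « [art:end] » in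
S. Tang's Lemma 6.3 (census §I.1 l.930-area, needles 1/0/0/0, « peripheral (bibliographic/context mention only by these needles) »).  ERRATUM to the tranche-165 header above: the B140 text
`paper-arxiv-2510.10389/` has 34 pages (p0001 – p0034), not « 35 »; no locator is affected.
**C320** (NEW ROW) — Fabien CLÉRY – Gerard VAN DER GEER, *On vector-valued Siegel modular forms of degree 2 and weight (j,2)*, with two appendices by Gaëtan CHENEVIER, Doc. Math. 23 (2018)
1129–1156, doi:10.4171/dm/643 = p0001:L1 "arXiv:1709.01748v1  [math.AG]  6 Sep 2017" (bib `CleryVanDerGeer2018Chenevier` NEW; the store's per-page text of the arXiv v1 PDF `HOME/pub-arthur-down-g69/primaries/paper-arxiv-1709.01748/`,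
26 pages, spacing artefacts quoted as extracted; the Doc. Math. VoR was not compared).  p0001:L2-6 "ON VECTOR-V ALUED SIEGEL MODULAR FORMS OF DEGREE 2 AND WEIGHT (j, 2) F ABIEN CL´ERY AND GERARD V AN DER GEER with two appendices by Ga¨ etan Chenevier" […] p0001:L11-12 "Two appendices contain related results of Chenevier; in particular a proof of the fact that every modular form of degree 2 and level 2 and weig ht (j, 1) vanishes."  THE BODY (Cléry – van der Geer) is
Arthur-free — covariants of binary sextics, Fourier expansions, restriction to Humbert surfaces: p0003:L10 "Theorem 1.3. We have dimSj,2(Γ 2) = 0 for j ≤ 52." (p0015:L8 "We carried this out for all the cases j ≤ 52 and thus proved Theorem 1.3.") and p0015:L26 "We begin with an elementary argument that shows that Sj,k(Γ 2[2]) = (0) for j ≤ 8"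
p0015:L28 "Proposition 7.1. Forj ≤ 8 and k ≤ 2 we have dimSj,k(Γ 2[2]) = 0 ." — two CONTROLS, the second an input of Theorem A.5.  APPENDIX A (Chenevier) USES THE BOOK, cited as « [1] », for PGSp₄ ≅ SO₅ over ℤ: p0017:L9-12 "We ﬁrst consider the full Siegel modular group Γ 2 = Sp 4(Z) and provide alternative proofs of the following results : Proposition A.1. We have Sj,1(Γ 2) = 0 for any j, and Sj,2(Γ 2) = 0 for j ≤ 38."
p0017:L13-16 "The vanishing of Sj,2(Γ 2) for all j ≤ 52 is also proved in this paper by Cl´ ery and van der Geer (Theorem 1.3). The vanishing of Sj,1(Γ 2) was at least known to Ibukiyama, who asserts in [16, p. 54] that it is a consequence of the vanishing of all J acobi forms of weight 1 for SL 2(Z) proven by Skoruppa [23, Satz 6.1]. Here we shall rather use autom orphic" [representation theoretic methods]; p0017:L40-44 "The relevance of Uj,k here is that ifπ is a cuspidal automorphic representation of PGSp 4 over Q generated by an element of Sj,k(Γ 2), then the Archimedean component π∞ ofπ is isomorphic to U j,k. The other important property of π is that πp is unramiﬁed for each prime p (i.e. admits non-zero invariants under PGSp 4(Zp)). As PGSp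 4 is isomorphic to the split classical group SO 5 over Z, we may apply Arthur’s theory [1] to such a π." p0018:L2-7 "(b) One of the main results of Arthur [1, Thm. 1.5.2] associates to an y discrete auto- morphic representation π of PGSp 4 over Q a unique isobaric automorphic representation πGL of GL 4 over Q, characterized by the following property : for any prime p such that πp is unramiﬁed, then (πGL)p is unramiﬁed as well and its Satake parameter is the image of the one of πp under the map r." […] p0018:L18 "All of this is included in [1, Thm. 1.5.2]."  PROPOSITION A.1, first
assertion (S_{j,1}(Γ₂) = 0 for every j): p0018:L38-40 "Proof. (of the vanishing of Sj,1(Γ 2) for any j). It is enough to show that there is no dis- crete automorphic representation π of PGSp 4 over Q which is unramiﬁed at every prime and with π∞ ≃ Uj,1." […] p0018:L47-49 "If we have di = 1 for each i, then (πGL)∞ is tempered by (c), hence so is π∞ by Arthur’s local-global compatibility [1, Thm. 1.5.1 (b) & Thm. 1.5.2], a contradiction as Uj,1 is non-tempered by (a)." [the level-one facts (d) on GL₁ / GL₂ — Selberg's λ₁ > 1/4 — absorbed].  LEMMA A.2: p0019:L7-9 "Lemma A.2. Letj ≥ 0 be an even integer. The integer dimSj,2(Γ 2) is the number of cus- pidal,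 selfdual symplectic, automorphic representations Π of GL4 over Q whose local com- ponents Π p are unramiﬁed for each prime p, and with inf Π ∞ ="
[{±(j+1)/2, ±(j+1)/2}] — proved with p0019:L26-27 "Let us denote by ψ Arthur’s substitute for the global parameter of the representation π of PGSp 4 deﬁned in [1, Chap. 1 §1.4]." p0019:L31-32 "We now apply Arthur’s multiplicity formu la to the element π of the global packet Π ψ deﬁned by Arthur." […] p0019:L37-38 "But then his multiplicity formula shows that π∞ has to be generic since πp is unramiﬁed for each prime p," […] p0019:L46-50 "A trivial application of Arthur’s multiplicity formula shows the existence of a discrete automorphic π for PGSp 4 with π∞ ≃ Uj,2, which is unramiﬁed at every prime, and satisfying πGL ≃ Π. As U j,2 is tempered, a classical result of Wallach ensures that π is actually cuspidal, hence generated by an element of Sj,2(Γ 2) : this concludes the proof." [Wallach absorbed].  LEMMA A.3: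
p0020:L2 "Lemma A.3. For any even integer 0 ≤j ≤ 38 there is no Π as in Lemma A.2." — for j ≤ 34 by the explicit formula alone (p0020:L3-11 "In order to contradict the existence of a Π as in Lemma A.2 for small j, and following work of Odlyzko, Mestre, Fermigier, Miller and Chenevier-Lannes, w e shall apply the so-called explicit formula “` a la Riemann-Weil” to a suitable test function F and to the complete Rankin-Selberg L-function L(s, Π × Π ′), ﬁrst to Π ′ = Π ∨ (the contragredient of Π) and then to some other well-chosen cuspidal automorphic rep resentations Π ′. Let us stress that the analytic properties of those Rankin-Selberg L-functions (meromorphic continuation to C, functional equation, determination of the poles, and boundedne ss in vertical strips away from the poles) which have been established by Gelbart, Jacquet, Shalika and Shahidi, will play a crucial role in the argument." […] p0020:L25-26 "As J Fλ (Iw) is a non-increasing function of w, the truth of the proposition for j ≤ 34 is a consequence of the following numerical computation for λ = 3.3" — Arthur-free given the statement: a CONTROL), for j = 36, 38 with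
one more input from row C5: p0020:L31-35 "We now explain how to deal with the cases j = 36 and 38. By Tsushima’s formula (proved for k = 3 independently by Petersen and Ta ¨ ıbi), we know that the ﬁrst value of j such that Sj,3(Γ 2) is non-zero is j = 36, in which case it has dimension 1. Let π be the cuspidal automorphic representation of PGSp 4 over Q generated by S36,3(Γ 2) and set Π ′ =πGL. This Π ′ is a selfdual cuspidal representation by [6, Chap. IX Prop. 1.4], and" [… the explicit formula for Π × Π∨, Π′ × Π′∨, Π × Π′∨: p0020:L40-41 "We now apply the explicit formula to Π × Π ∨, Π ′ × Π ′∨ and Π × Π ′∨. It leads to a simple criterion, given in [6, Chap. IX Scholie 3.26], for Π not to exist" …] — « [6, Chap. IX Prop. 1.4] » is, in the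
arXiv text of row C5 (`paper:arxiv-1409.7616` p0164:L30-31), the STARRED « Proposition${}^\star$ 142 » (j > 0 even, k ≥ 3: ψ(π_F, St) ∈ Π_cusp^⊥(PGL₄)), i.e. one of the statements
C5 marks as depending on the book = `Consumers.ChenevierLannesStar`; Tsushima's formula for k = 3 has the two printed sources « Petersen and Taïbi » (Petersen's cohomological proof is
Arthur-free; Taïbi's = row C3) — an alternative source named in the same sentence, not typed as a premise (G-viii pattern).  REMARK A.4 (ii) (p0021:L6-8 "(ii) Lemma A.2 and the explicit formula can also be used to obtain upper b ounds on dimSj,2(Γ 2). Indeed, keeping the notations in the above proof, and applying [6 , Chap. IX Cor. 3.14] (due to Ta ¨ ıbi), we get that the inequality" […] p0021:L12-14 "For instance, we get dim Sj,2(Γ 2) ≤ 1 for all j < 54 and dim Sj,2(Γ 2) ≤ 2 for all j < 66 (choose respectively λ = 5 and λ = 6).")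
rests on Lemma A.2 — recorded, not typed.  THEOREM A.5 (« our last and main result »): p0021:L16 "Theorem A.5. We have Sj,1(Γ 2[2]) = 0 for any j." p0021:L17-19 "Our proof will be an elaboration of the one of Proposition A.1. We shall also use the vanishing Sj,1(Γ 2[2]) = 0 for j ≤ 8, proved by Cl´ ery and van der Geer in this paper (Proposition 7.1)." — the proof: p0021:L32-33 "The classiﬁcation of orthogonal cuspidal automorphic represent ations of GL 2 over Q, a very special case of Arthur’s results, is well-known."
[…] p0021:L39-40 "Last but not least, to any χ as above Arthur associates a global packet" [Π(χ) …] p0022:L1-3 "which satisfy ωGL = ind(χ) ⊗ |.|1/2 ⊞ ind(χ) ⊗ |.|−1/2 (Soudry type); in this “stable case” any element of Π( χ) is automorphic by Arthur’s multiplicity formula." […] p0022:L33-39 "This last property holds because the Langlands packet associated to the A rthur packet Π ∞(χ′ ∞), which is included in Π ∞(χ′ ∞) by [1, Prop. 7.4.1], is the one of U j′,1 by Remark (a) above. As already explained, the representation π′ is discrete automorphic by Arthur, and even cuspidal as its Archimedean component is tempered." […] p0022:L42-44 "But now we have the inequality j′ ≤ 2wK ≤ 8, a contradiction by the vanishing Sj′,1(Γ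 2[2]) = 0 for j′ ≤ 8. □" (p0022:L45 "Lemma A.6. Let K = Q(" …: class field theory, proved
there).  APPENDIX B (Chenevier) is Arthur-free: p0023:L2-6 "Appendix B. Proof of Theorem 1.1 by Ga ¨ etan Chenevier In this second appendix, we explain how to deduce Theorem 1.1 state d in the paper of Cl´ ery and van der Geer from the works of R¨ osner [20] and Weis sauer [26], for the convenience of the reader." […] p0023:L31 "The multiplicity formula proved by Weissauer [26, Thm. 5.2, p . 186] states" […] — a CONTROL (Weissauer's endoscopy for GSp(4) and Rösner's thesis).  TYPED
(`Consumers166`): `CvdGWeight2Vanishing` := Theorem 1.3 (control); `CvdGSmallWeights` := Proposition 7.1 (control); `ChenWeight1LevelOne` := Prop. A.1, first assertion ⇐ the book at every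
rank ([1, Thm. 1.5.2], [1, Thm. 1.5.1 (b)]); `ChenLemmaA2` := Lemma A.2 ⇐ the book ([1, Thm. 1.5.2], [1, Chap. 1 §1.4], the multiplicity formula); `ChenLemmaA3Low` := Lemma A.3 for j ≤ 34
(control); `ChenLemmaA3Top` := Lemma A.3 for j = 36, 38 ⇐ row C5 `Consumers.ChenevierLannesStar`; `ChenWeight2LevelOne` := Prop. A.1, second assertion (S_{j,2}(Γ₂) = 0, j ≤ 38) ⇐
`ChenLemmaA2` ∧ `ChenLemmaA3Low` ∧ `ChenLemmaA3Top`; `ChenThmA5` := Theorem A.5 ⇐ the book ([1, Thm. 1.5.2], the multiplicity formula in the stable case, [1, Prop. 7.4.1]) ∧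
`CvdGSmallWeights`; `ChenAppBYoshida` := Theorem 1.1 via Appendix B (control).  STATUS SENTENCES: none on [1] (« we may apply Arthur's theory [1] »; [1] = Colloquium Publ. 61 (2013)) —
census class G-i.
**C321** (NEW ROW) — Shiang TANG, *Motivic Galois representations valued in Spin groups*, J. Théor. Nombres Bordeaux 33 (2021) 197–221, doi:10.5802/jtnb.1157 = arXiv:2006.03585 (bib
`Tang2021SpinMotivic` NEW; corpus TeX rendering `HOME/pub-arthur-down-g69/primaries/paper-arxiv-2006.03585/`, 18 chunks; the JTNB VoR was not compared).  p0002:L3 "Let $m$ be an integer such that $m \geq 7$ and $m \equiv 0,1,7 \mod 8$. We construct strictly compatible systems of representations of $\Gamma_{\mathbb Q} \to \mathrm{Spin}_m(\overline{\mathbb Q}_l) \xrightarrow{\mathrm{spin}} \mathrm{GL}_N(\overline{\mathbb Q}_l)$ that is potentially automorphic and motivic." p0002:L3 "As an application, we prove instances of the inverse Galois problem for the $\mathbb F_p$–points of the spin groups. For odd $m$, we compare our examples with the work of A. Kret and S. W. Shin ( [kret-shin]), which studies automorphic Galois representations valued in $\GSpin{m}$."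
THE MAIN THEOREMS — p0003:L8 "Theorem 1.1. (Proposition (char zero spin rep) and Theorem (spin compatible system))" [m ≥ 7, m ≡ 0, 1, 7 mod 8: strictly compatible systems Γ_ℚ → Spin_m → GL_N with Zariski-dense image, potentially automorphic and motivic]
and p0003:L22 "Theorem 1.2. (Corollary (igp for spin))" [Spin_m(𝔽_p) as a Galois group over ℚ for a positive-density set of p] — are Galois-deformation-theoretic (§§2–5: residual representations, lifting,
potential automorphy): no [art:end] — a CONTROL.  §6 COMPARES WITH ROW C10 (Kret – Shin): p0016:L3 "In this section, we explain how the main theorem of [kret-shin] implies a stronger version of Theorem (main theorem) in the case when $m=2n+1$ is odd." p0016:L33 "A trace formula argument shows that there are infinitely many cuspidal automorphic representations $\pi$ of $\mr{PSp}_{2n}(\mb A_{\rats})$ such that its archimedean component $\pi_{\infty}$ satisfies Lemma (L-parameters), (2) and $\pi$ is Steinberg at a finite place of $\rats$ (cf. [clo:lmf])." p0017:L5 "Therefore, by [kret-shin], the cuspidal automorphic representation $\tilde\pi$ of $\gsp{2n}{\mb A_{\rats}}$ (for $n \equiv 0,3 \mod 4$) has an associated weakly compatible system of Galois representations" […]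
p0017:L10 "In particular, since the central character of $\tilde\pi$ is trivial, [kret-shin] implies that $\rho_{\tilde\pi,l}$ is in fact valued in $\spin{2n+1}{\bQl}$. Moreover, for sufficiently general $\{m_i\}_{1 \leq i \leq n}$, $\tilde\pi_{\infty}$ is spin-regular in the sense of [kret-shin], i.e. the L–parameter of $\tilde\pi_{\infty}$ maps to a regular parameter for $\GL{2^n}$ by the spin representation." p0017:L10 "In this case, the Zariski-closure of $\rho_{\tilde\pi,l}$ equals $\Spin{2n+1}$, and thus we obtain a $\Spin{2n+1}$–compatible system of motivic Galois representations with full monodromy."  THE ONE USE OF THE BOOK is LEMMA 6.3: p0017:L14-15 "Lemma 6.3. Suppose $n \equiv 1,2 \mod 4$ (equivalently, $\frac{n(n+1)}{2}$ is odd) and $\pi$ is a cuspidal automorphic representation of $\sp{2n}{\mb A_{\rats}}$ with trivial central character. Denote by $\pi^{\flat}$ the associated representation of $\mr{PSp}_{2n}(\mb A_{\rats})$. If $\pi$ is regular algebraic, [Since the dual group $\SO{2n+1}$ is adjoint, L–algebraicity is equivalent to C–algebraicity.] then $\pi^{\flat}$ is C–algebraic but not L–algebraic." — proof: p0017:L23-24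 "Arthur’s classification of automorphic representations of classical groups ( [art:end]) implies that $\pi$ has a functorial transfer to a cuspidal automorphic representation of $\gl{2n+1}{\mb A_{\rats}}$, so Clozel's archimedean purity theorem ( [clo:mot]) implies that $m_i+l_i=0$ for all $i$."  TYPED: `TangSpinSystems` :=
Theorems 1.1 / 1.2 (control); `TangKretShinSpin` := §6's statement (for n ≡ 0, 3 mod 4: Spin_{2n+1}-valued motivic compatible systems with full monodromy from L-cohomological cuspidal
π̃ of GSp_{2n}) ⇐ row C10 `Consumers.KretShinGSp` ([kret-shin]; the existence of the π by « a trace formula argument … (cf. [clo:lmf]) » — Clozel 1986, absorbed); `TangLemma63` := Lemma 6.3 ⇐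
the book at every rank ([art:end]: the transfer of a cuspidal π of Sp_{2n}(𝔸_ℚ) to GL_{2n+1}; Clozel's purity [clo:mot] absorbed).  STATUS SENTENCES: none (« Arthur's classification …
implies »; [art:end] = « Vol. 61. American Mathematical Soc., 2013 ») — census class G-i.
EXPECTED SUPPORTS (section 168 of `DownstreamSupport18.lean`, next filing): support(`ChenWeight1LevelOne`) = support(`ChenLemmaA2`) = support(`ChenThmA5`) = support(`TangLemma63`) = the 24
book leaves; support(`ChenLemmaA3Top`) = support(C5★) = the 24 book leaves, hence support(`ChenWeight2LevelOne`) = the 24 book leaves; support(`TangKretShinSpin`) = support(C10) = the 24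
book leaves (C10 ⇐ book ∧ A14, tranche 1); the five controls: ∅.  No Mok / KMSW leaf.  Census ids consumed: C320, C321 (next free C322).  Bib keys added: CleryVanDerGeer2018Chenevier
(commit 4faa9222740e), Tang2021SpinMotivic (commit b12e33bd084d).  Nothing of v1 – v5 is redeclared or changed; no new import (`Consumers`, `Implications`, `chenevierLannes_of_leaves`,
`kretShin_of_leaves` of tranche 1 reach this file through the import chain). -/

-- Verbatim, kept out of docstrings by the docstring lint (C320, `paper-arxiv-1709.01748/`): p0003:L6 "Conjecture 1.2. The space Sj,2(Γ 2[2]) is generated by Yoshida type lifts."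
-- bibliography (C320): p0024:L45-46 "[1] J. Arthur: The endoscopic classiﬁcation of representations: orthogonal an d symplectic groups , Colloquium Publ. 61, Amer. Math. Soc. (2013)." / p0025:L6-7 "[6] G. Chenevier, J. Lannes: Automorphic forms and even unimodular lattices . To appear in: Ergeb- nisse der Mathematik und ihrer Grenzgebiete." / p0025:L32-33 "[20] M. R¨ osner:Parahoric restriction for GSP(4) and the inner cohomology of Siegel modular threefolds. Inaugural dissertation, Ruprecht-Karls-Universit¨ at Heidelberg, 2016." / p0025:L44-45 "[26] R. Weissauer: Endoscopy for GSp(4) and the Cohomology of Siegel Modular Threefolds. Lecture Notes in Mathematics 1968. Springer, 1st edition (2009)."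
-- bibliography (C321, `paper-arxiv-2006.03585/`): p0018:L7 "[art:end] Arthur, James. The Endoscopic Classification of Representations Orthogonal and Symplectic Groups. Vol. 61. American Mathematical Soc., 2013." / p0018:L41 "[kret-shin] Kret, Arno and Shin, Sug Woo. Galois representations for general symplectic groups. arXiv preprint (2016)."

/-- NEW rows C320 and C321's statements, as an arbitrary assignment of truth values (the register records which typed inputs the PRINTED text invokes, never the truth of the fields). [cite: CleryVanDerGeer2018Chenevier, Thm 1.3, Prop. 7.1, App. A (Prop. A.1, Lemmas A.2, A.3, Thm A.5), App. B; Tang2021SpinMotivic, Thms 1.1, 1.2, §6, Lemma 6.3 (structure only)] -/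
structure Consumers166 where
  /-- C320, CONTROL — THEOREM 1.3 (Cléry – van der Geer; covariants of binary sextics and divisibility by χ₅, §6): p0003:L10 "Theorem 1.3. We have dimSj,2(Γ 2) = 0 for j ≤ 52." p0015:L8 "We carried this out for all the cases j ≤ 52 and thus proved Theorem 1.3." [cite: CleryVanDerGeer2018Chenevier, Thm 1.3 (arXiv:1709.01748v1 p0003:L10, p0015:L8)] -/
  CvdGWeight2Vanishing : Prop
  /-- C320, CONTROL — PROPOSITION 7.1 (Cléry – van der Geer; restriction to the ten components of the Humbert surface H₁): p0015:L26 "We begin with an elementary argument that shows that Sj,k(Γ 2[2]) = (0) for j ≤ 8" p0015:L28 "Proposition 7.1. Forj ≤ 8 and k ≤ 2 we have dimSj,k(Γ 2[2]) = 0 ." [cite: CleryVanDerGeer2018Chenevier, Prop. 7.1 (arXiv:1709.01748v1 p0015:L26-28)] -/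
  CvdGSmallWeights : Prop
  /-- C320, APPENDIX A (G. Chenevier), PROPOSITION A.1 — FIRST ASSERTION: S_{j,1}(Γ₂) = 0 for every j (Γ₂ = Sp₄(ℤ), S_{j,k} = cusp forms of weight Sym^j ⊗ det^k; census grade G-i; PUBLISHED Doc. Math. 23 (2018)): p0017:L9-12 "We ﬁrst consider the full Siegel modular group Γ 2 = Sp 4(Z) and provide alternative proofs of the following results : Proposition A.1. We have Sj,1(Γ 2) = 0 for any j, and Sj,2(Γ 2) = 0 for j ≤ 38." [cite: CleryVanDerGeer2018Chenevier, Prop. A.1 (arXiv:1709.01748v1 p0017:L9-12)] -/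
  ChenWeight1LevelOne : Prop
  /-- C320, APPENDIX A, LEMMA A.2 (census grade G-i): p0019:L7-9 "Lemma A.2. Letj ≥ 0 be an even integer. The integer dimSj,2(Γ 2) is the number of cus- pidal, selfdual symplectic, automorphic representations Π of GL4 over Q whose local com- ponents Π p are unramiﬁed for each prime p, and with inf Π ∞ =" [display: inf Π_∞ = {(j+1)/2, (j+1)/2, −(j+1)/2, −(j+1)/2}]. [cite: CleryVanDerGeer2018Chenevier, Lemma A.2 (arXiv:1709.01748v1 p0019:L7-12)] -/
  ChenLemmaA2 : Prop
  /-- C320, APPENDIX A, LEMMA A.3 FOR j ≤ 34 — CONTROL (the explicit formula « à la Riemann – Weil » applied to L(s, Π × Π∨), the analytic theory of Rankin – Selberg L-functions of Gelbart, Jacquet, Shalika, Shahidi; Odlyzko's test function): p0020:L2 "Lemma A.3. For any even integer 0 ≤j ≤ 38 there is no Π as in Lemma A.2." — restricted here to 0 ≤ j ≤ 34: p0020:L25-26 "As J Fλ (Iw) is a non-increasing function of w, the truth of the proposition for j ≤ 34 is a consequence of the following numerical computation for λ = 3.3" [J_{F_λ}(I₇₀) + J_{F_λ}(I₀) ≃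 0.679 > 2/(π² λ) ≃ 0.669]. [cite: CleryVanDerGeer2018Chenevier, Lemma A.3, case j ≤ 34 (arXiv:1709.01748v1 p0020:L2-30)] -/
  ChenLemmaA3Low : Prop
  /-- C320, APPENDIX A, LEMMA A.3 FOR j = 36, 38 (census grade G-i through row C5): p0020:L31-35 "We now explain how to deal with the cases j = 36 and 38. By Tsushima’s formula (proved for k = 3 independently by Petersen and Ta ¨ ıbi), we know that the ﬁrst value of j such that Sj,3(Γ 2) is non-zero is j = 36, in which case it has dimension 1. Let π be the cuspidal automorphic representation of PGSp 4 over Q generated by S36,3(Γ 2) and set Π ′ =πGL. This Π ′ is a selfdual cuspidal representation by [6, Chap. IX Prop. 1.4], and" [… the explicit formula applied to Π × Π∨, Π′ × Π′∨ and Π × Π′∨ with the criterion of [6, Chap. IX Scholie 3.26]]. [cite: CleryVanDerGeer2018Chenevier, Lemma A.3, cases j = 36, 38 (arXiv:1709.01748v1 p0020:L31-45, p0021:L1)] -/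
  ChenLemmaA3Top : Prop
  /-- C320, APPENDIX A, PROPOSITION A.1 — SECOND ASSERTION: S_{j,2}(Γ₂) = 0 for j ≤ 38 (census grade G-i): p0017:L9-12 "We ﬁrst consider the full Siegel modular group Γ 2 = Sp 4(Z) and provide alternative proofs of the following results : Proposition A.1. We have Sj,1(Γ 2) = 0 for any j, and Sj,2(Γ 2) = 0 for j ≤ 38." — « The second assertion of the proposition will be a consequence of the following two lemmas » (p0019:L4-5). [cite: CleryVanDerGeer2018Chenevier, Prop. A.1 (arXiv:1709.01748v1 p0017:L12, p0019:L4-5)] -/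
  ChenWeight2LevelOne : Prop
  /-- C320, APPENDIX A, THEOREM A.5 — « Our last and main result » (Γ₂[2] = the principal congruence subgroup of level 2; census grade G-i): p0021:L16 "Theorem A.5. We have Sj,1(Γ 2[2]) = 0 for any j." p0021:L17-19 "Our proof will be an elaboration of the one of Proposition A.1. We shall also use the vanishing Sj,1(Γ 2[2]) = 0 for j ≤ 8, proved by Cl´ ery and van der Geer in this paper (Proposition 7.1)." [cite: CleryVanDerGeer2018Chenevier, Thm A.5 (arXiv:1709.01748v1 p0021:L16-19)] -/
  ChenThmA5 : Prop
  /-- C320, CONTROL — THEOREM 1.1 (the Yoshida-lift spaces YS^{s[w]}_{j,2}, three cases) AS PROVED IN APPENDIX B (G. Chenevier) from Weissauer's endoscopy for GSp(4) [26] and Rösner's thesis [20]: p0023:L2-6 "Appendix B. Proof of Theorem 1.1 by Ga ¨ etan Chenevier In this second appendix, we explain how to deduce Theorem 1.1 state d in the paper of Cl´ ery and van der Geer from the works of R¨ osner [20] and Weis sauer [26], for the convenience of the reader." [cite: CleryVanDerGeer2018Chenevier, Thm 1.1, App. B (arXiv:1709.01748v1 p0002:L41, p0023:L2-6)] -/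
  ChenAppBYoshida : Prop
  /-- C321, CONTROL — THEOREMS 1.1 AND 1.2 (census grade G-i; PUBLISHED J. Théor. Nombres Bordeaux 33 (2021) 197–221): S. Tang (`paper-arxiv-2006.03585/`): p0002:L3 "Let $m$ be an integer such that $m \geq 7$ and $m \equiv 0,1,7 \mod 8$. We construct strictly compatible systems of representations of $\Gamma_{\mathbb Q} \to \mathrm{Spin}_m(\overline{\mathbb Q}_l) \xrightarrow{\mathrm{spin}} \mathrm{GL}_N(\overline{\mathbb Q}_l)$ that is potentially automorphic and motivic." p0002:L3 "As an application, we prove instances of the inverse Galois problem for the $\mathbb F_p$–points of the spin groups. For odd $m$, we compare our examples with the work of A. Kret and S. W. Shin ( [kret-shin]), which studies automorphic Galois representations valued in $\GSpin{m}$." — p0003:L8 "Theorem 1.1. (Proposition (char zero spin rep) and Theorem (spin compatible system))" / p0003:L22 "Theorem 1.2. (Corollary (igp for spin))" [cite: Tang2021SpinMotivic, Thms 1.1, 1.2 (arXiv:2006.03585 p0002:L3, p0003:L8-22)] -/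
  TangSpinSystems : Prop
  /-- C321, §6 (COMPARISON WITH KRET – SHIN = row C10): for n ≡ 0, 3 mod 4 and π a cuspidal automorphic representation of PSp_{2n}(𝔸_ℚ) with L-algebraic regular discrete-series archimedean component (Lemmas 6.1, 6.2), lifted to π̃ on GSp_{2n}: p0017:L5 "Therefore, by [kret-shin], the cuspidal automorphic representation $\tilde\pi$ of $\gsp{2n}{\mb A_{\rats}}$ (for $n \equiv 0,3 \mod 4$) has an associated weakly compatible system of Galois representations" [ρ_{π̃,l} : Γ_ℚ → GSpin_{2n+1}(ℚ̄_l)] p0017:L10 "In particular, since the central character of $\tilde\pi$ is trivial, [kret-shin] implies that $\rho_{\tilde\pi,l}$ is in fact valued in $\spin{2n+1}{\bQl}$. Moreover, for sufficiently general $\{m_i\}_{1 \leq i \leq n}$, $\tilde\pi_{\infty}$ is spin-regular in the sense of [kret-shin], i.e. the L–parameter of $\tilde\pi_{\infty}$ maps to a regular parameter for $\GL{2^n}$ by the spin representation." p0017:L10 "In this case, the Zariski-closure of $\rho_{\tilde\pi,l}$ equals $\Spin{2n+1}$, and thus we obtain a $\Spin{2n+1}$–compatible system of motivic Galois representations with full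 monodromy." [cite: Tang2021SpinMotivic, §6 (arXiv:2006.03585 p0016:L3-33, p0017:L5-10)] -/
  TangKretShinSpin : Prop
  /-- C321, LEMMA 6.3 (census grade G-i): p0017:L14-15 "Lemma 6.3. Suppose $n \equiv 1,2 \mod 4$ (equivalently, $\frac{n(n+1)}{2}$ is odd) and $\pi$ is a cuspidal automorphic representation of $\sp{2n}{\mb A_{\rats}}$ with trivial central character. Denote by $\pi^{\flat}$ the associated representation of $\mr{PSp}_{2n}(\mb A_{\rats})$. If $\pi$ is regular algebraic, [Since the dual group $\SO{2n+1}$ is adjoint, L–algebraicity is equivalent to C–algebraicity.] then $\pi^{\flat}$ is C–algebraic but not L–algebraic." [cite: Tang2021SpinMotivic, Lemma 6.3 (arXiv:2006.03585 p0017:L14-15)] -/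
  TangLemma63 : Prop

/-- C320, CONTROL EDGE — Theorem 1.3 (Cléry – van der Geer's covariant computations). [cite: CleryVanDerGeer2018Chenevier, Thm 1.3, §6 (arXiv:1709.01748v1 p0015:L8) (edge)] -/
def E_CvdGWeight2Vanishing (c₁₆₆ : Consumers166) : Prop := c₁₆₆.CvdGWeight2Vanishing

/-- C320, CONTROL EDGE — Proposition 7.1 (« an elementary argument »). [cite: CleryVanDerGeer2018Chenevier, Prop. 7.1 (arXiv:1709.01748v1 p0015:L26-28) (edge)] -/
def E_CvdGSmallWeights (c₁₆₆ : Consumers166) : Prop := c₁₆₆.CvdGSmallWeights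

/-- C320, PROPOSITION A.1 (first assertion) ⇐ THE BOOK: p0017:L40-44 "The relevance of Uj,k here is that ifπ is a cuspidal automorphic representation of PGSp 4 over Q generated by an element of Sj,k(Γ 2), then the Archimedean component π∞ ofπ is isomorphic to U j,k. The other important property of π is that πp is unramiﬁed for each prime p (i.e. admits non-zero invariants under PGSp 4(Zp)). As PGSp 4 is isomorphic to the split classical group SO 5 over Z, we may apply Arthur’s theory [1] to such a π." […] p0018:L47-49 "If we have di = 1 for each i, then (πGL)∞ is tempered by (c), hence so is π∞ by Arthur’s local-global compatibility [1, Thm. 1.5.1 (b) & Thm. 1.5.2], a contradiction as Uj,1 is non-tempered by (a)." [cite: CleryVanDerGeer2018Chenevier, App. A (a)–(d) and the proof of Prop. A.1 (arXiv:1709.01748v1 p0017:L40-44, p0018:L2-18, L38-49, p0019:L1-3) (edge)] -/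
def E_ChenWeight1LevelOne (ν : Nodes) (c₁₆₆ : Consumers166) : Prop := (∀ N, ν.Everything N) → c₁₆₆.ChenWeight1LevelOne

/-- C320, LEMMA A.2 ⇐ THE BOOK (Thm 1.5.2, Arthur's ψ of [1, Chap. 1 §1.4], the multiplicity formula, twice): p0019:L26-27 "Let us denote by ψ Arthur’s substitute for the global parameter of the representation π of PGSp 4 deﬁned in [1, Chap. 1 §1.4]." p0019:L31-32 "We now apply Arthur’s multiplicity formu la to the element π of the global packet Π ψ deﬁned by Arthur." […] p0019:L46-50 "A trivial application of Arthur’s multiplicity formula shows the existence of a discrete automorphic π for PGSp 4 with π∞ ≃ Uj,2, which is unramiﬁed at every prime, and satisfying πGL ≃ Π. As U j,2 is tempered, a classical result of Wallach ensures that π is actually cuspidal, hence generated by an element of Sj,2(Γ 2) : this concludes the proof." [cite: CleryVanDerGeer2018Chenevier, proof of Lemma A.2 (arXiv:1709.01748v1 p0019:L13-50) (edge)] -/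
def E_ChenLemmaA2 (ν : Nodes) (c₁₆₆ : Consumers166) : Prop := (∀ N, ν.Everything N) → c₁₆₆.ChenLemmaA2

/-- C320, CONTROL EDGE — Lemma A.3 for j ≤ 34 (the explicit formula; no input from the classification given the statement): p0020:L3-11 "In order to contradict the existence of a Π as in Lemma A.2 for small j, and following work of Odlyzko, Mestre, Fermigier, Miller and Chenevier-Lannes, w e shall apply the so-called explicit formula “` a la Riemann-Weil” to a suitable test function F and to the complete Rankin-Selberg L-function L(s, Π × Π ′), ﬁrst to Π ′ = Π ∨ (the contragredient of Π) and then to some other well-chosen cuspidal automorphic rep resentations Π ′. Let us stress that the analytic properties of those Rankin-Selberg L-functions (meromorphic continuation to C, functional equation, determination of the poles, and boundedne ss in vertical strips away from the poles) which have been established by Gelbart, Jacquet, Shalika and Shahidi, will play a crucial role in the argument." [cite: CleryVanDerGeer2018Chenevier, proof of Lemma A.3 (arXiv:1709.01748v1 p0020:L3-30) (edge)] -/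
def E_ChenLemmaA3Low (c₁₆₆ : Consumers166) : Prop := c₁₆₆.ChenLemmaA3Low

/-- C320, LEMMA A.3 FOR j = 36, 38 ⇐ ROW C5's STARRED STATEMENTS (« [6, Chap. IX Prop. 1.4] » = « Proposition${}^\star$ 142 » of `paper:arxiv-1409.7616` p0164:L30: Π′ = π^GL of the generator of S_{36,3}(Γ₂) is cuspidal selfdual): p0020:L31-35 "We now explain how to deal with the cases j = 36 and 38. By Tsushima’s formula (proved for k = 3 independently by Petersen and Ta ¨ ıbi), we know that the ﬁrst value of j such that Sj,3(Γ 2) is non-zero is j = 36, in which case it has dimension 1. Let π be the cuspidal automorphic representation of PGSp 4 over Q generated by S36,3(Γ 2) and set Π ′ =πGL. This Π ′ is a selfdual cuspidal representation by [6, Chap. IX Prop. 1.4], and" [cite: CleryVanDerGeer2018Chenevier, proof of Lemma A.3 (arXiv:1709.01748v1 p0020:L31-45) (edge); ChenevierLannes2019, Prop. IX.1.4 (premise)] -/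
def E_ChenLemmaA3Top (c : Consumers) (c₁₆₆ : Consumers166) : Prop := c.ChenevierLannesStar → c₁₆₆.ChenLemmaA3Top

/-- C320, PROPOSITION A.1 (second assertion) ⇐ LEMMA A.2 ∧ LEMMA A.3 (both halves): « The second assertion of the proposition will be a consequence of the following two lemmas. » (p0019:L4-5). [cite: CleryVanDerGeer2018Chenevier, App. A (arXiv:1709.01748v1 p0019:L4-5) (edge)] -/
def E_ChenWeight2LevelOne (c₁₆₆ : Consumers166) : Prop := c₁₆₆.ChenLemmaA2 → c₁₆₆.ChenLemmaA3Low → c₁₆₆.ChenLemmaA3Top → c₁₆₆.ChenWeight2LevelOne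

/-- C320, THEOREM A.5 ⇐ THE BOOK ∧ PROPOSITION 7.1: p0021:L17-19 "Our proof will be an elaboration of the one of Proposition A.1. We shall also use the vanishing Sj,1(Γ 2[2]) = 0 for j ≤ 8, proved by Cl´ ery and van der Geer in this paper (Proposition 7.1)." […] p0022:L1-3 "which satisfy ωGL = ind(χ) ⊗ |.|1/2 ⊞ ind(χ) ⊗ |.|−1/2 (Soudry type); in this “stable case” any element of Π( χ) is automorphic by Arthur’s multiplicity formula." […] p0022:L33-39 "This last property holds because the Langlands packet associated to the A rthur packet Π ∞(χ′ ∞), which is included in Π ∞(χ′ ∞) by [1, Prop. 7.4.1], is the one of U j′,1 by Remark (a) above. As already explained, the representation π′ is discrete automorphic by Arthur, and even cuspidal as its Archimedean component is tempered." […] p0022:L42-44 "But now we have the inequality j′ ≤ 2wK ≤ 8, a contradiction by the vanishing Sj′,1(Γ 2[2]) = 0 for j′ ≤ 8. □" [the orthogonal cuspidal representations of GL₂ (« a very special case of Arthur's results, is well-known ») and Lemma A.6 (class field theory, proved in the appendix): absorbed]. [cite: CleryVanDerGeer2018Chenevier, proof of Thm A.5 (arXiv:1709.01748v1 p0021:L17-45,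 p0022:L1-44) (edge)] -/
def E_ChenThmA5 (ν : Nodes) (c₁₆₆ : Consumers166) : Prop := (∀ N, ν.Everything N) → c₁₆₆.CvdGSmallWeights → c₁₆₆.ChenThmA5

/-- C320, CONTROL EDGE — Theorem 1.1 through Appendix B (Weissauer [26, Thm. 5.2], Rösner [20, Cor. 4.14, Lemma 5.22, Tables 4.2 / 5.2]): p0023:L31 "The multiplicity formula proved by Weissauer [26, Thm. 5.2, p . 186] states" […] [cite: CleryVanDerGeer2018Chenevier, App. B (arXiv:1709.01748v1 p0023:L2-31, p0024:L1-25) (edge)] -/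
def E_ChenAppBYoshida (c₁₆₆ : Consumers166) : Prop := c₁₆₆.ChenAppBYoshida

/-- C321, CONTROL EDGE — Theorems 1.1 / 1.2 (Galois deformation theory and potential automorphy, §§2–5). [cite: Tang2021SpinMotivic, Thms 1.1, 1.2 (arXiv:2006.03585 p0003:L8-22) (edge)] -/
def E_TangSpinSystems (c₁₆₆ : Consumers166) : Prop := c₁₆₆.TangSpinSystems

/-- C321, §6 ⇐ ROW C10 (Kret – Shin, `Consumers.KretShinGSp`): p0017:L5 "Therefore, by [kret-shin], the cuspidal automorphic representation $\tilde\pi$ of $\gsp{2n}{\mb A_{\rats}}$ (for $n \equiv 0,3 \mod 4$) has an associated weakly compatible system of Galois representations" [cite: Tang2021SpinMotivic, §6 (arXiv:2006.03585 p0017:L5-10) (edge); KretShin2022 (premise)] -/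
def E_TangKretShinSpin (c : Consumers) (c₁₆₆ : Consumers166) : Prop := c.KretShinGSp → c₁₆₆.TangKretShinSpin

/-- C321, LEMMA 6.3 ⇐ THE BOOK: p0017:L23-24 "Arthur’s classification of automorphic representations of classical groups ( [art:end]) implies that $\pi$ has a functorial transfer to a cuspidal automorphic representation of $\gl{2n+1}{\mb A_{\rats}}$, so Clozel's archimedean purity theorem ( [clo:mot]) implies that $m_i+l_i=0$ for all $i$." [cite: Tang2021SpinMotivic, proof of Lemma 6.3 (arXiv:2006.03585 p0017:L17-25) (edge)] -/
def E_TangLemma63 (ν : Nodes) (c₁₆₆ : Consumers166) : Prop := (∀ N, ν.Everything N) → c₁₆₆.TangLemma63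

/-- The hundred-and-sixty-sixth tranche's implication table. [cite: CleryVanDerGeer2018Chenevier, Thm 1.3, Prop. 7.1, App. A, App. B; Tang2021SpinMotivic, Thms 1.1, 1.2, §6, Lemma 6.3 (structure only)] -/
structure Implications166 (ν : Nodes) (c : Consumers) (c₁₆₆ : Consumers166) : Prop where
  cvdgWeight2 : E_CvdGWeight2Vanishing c₁₆₆
  cvdgSmall : E_CvdGSmallWeights c₁₆₆
  chenWeight1 : E_ChenWeight1LevelOne ν c₁₆₆
  chenLemmaA2 : E_ChenLemmaA2 ν c₁₆₆
  chenLemmaA3Low : E_ChenLemmaA3Low c₁₆₆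
  chenLemmaA3Top : E_ChenLemmaA3Top c c₁₆₆
  chenWeight2 : E_ChenWeight2LevelOne c₁₆₆
  chenThmA5 : E_ChenThmA5 ν c₁₆₆
  chenAppB : E_ChenAppBYoshida c₁₆₆
  tangSpin : E_TangSpinSystems c₁₆₆
  tangKretShin : E_TangKretShinSpin c c₁₆₆
  tangLemma63 : E_TangLemma63 ν c₁₆₆

section Tranche166

variable {ν : Nodes} {μ : Mok2015.Nodes} {κ : KMSW2014.Nodes} {c : Consumers} {c₁₆₆ : Consumers166}

/-- The five controls of the tranche hold outright. [cite: CleryVanDerGeer2018Chenevier, Thm 1.3, Prop. 7.1, Lemma A.3 (j ≤ 34), App. B; Tang2021SpinMotivic, Thms 1.1, 1.2 (bookkeeping proved here)] -/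
theorem hundredsixtysixth_controls (Y : Implications166 ν c c₁₆₆) :
    c₁₆₆.CvdGWeight2Vanishing ∧ c₁₆₆.CvdGSmallWeights ∧ c₁₆₆.ChenLemmaA3Low ∧ c₁₆₆.ChenAppBYoshida ∧ c₁₆₆.TangSpinSystems :=
  ⟨Y.cvdgWeight2, Y.cvdgSmall, Y.chenLemmaA3Low, Y.chenAppB, Y.tangSpin⟩

/-- FIRST READING — rows C320 / C321 granted the book at every rank, row C5's starred statements and row C10: Chenevier's Appendix A (Prop. A.1 both assertions, Lemmas A.2 / A.3, Thm A.5) and Tang's §6 / Lemma 6.3. [cite: CleryVanDerGeer2018Chenevier, App. A; Tang2021SpinMotivic, §6, Lemma 6.3 (bookkeeping proved here)] -/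
theorem chenevierTang_of_rows (Y : Implications166 ν c c₁₆₆) (b : ∀ N, ν.Everything N) (h₅ : c.ChenevierLannesStar) (h₁₀ : c.KretShinGSp) :
    (c₁₆₆.ChenWeight1LevelOne ∧ c₁₆₆.ChenLemmaA2 ∧ c₁₆₆.ChenLemmaA3Top ∧ c₁₆₆.ChenWeight2LevelOne ∧ c₁₆₆.ChenThmA5) ∧ (c₁₆₆.TangKretShinSpin ∧ c₁₆₆.TangLemma63) :=
  have a2 := Y.chenLemmaA2 b
  have a3 := Y.chenLemmaA3Top h₅
  ⟨⟨Y.chenWeight1 b, a2, a3, Y.chenWeight2 a2 Y.chenLemmaA3Low a3, Y.chenThmA5 b Y.cvdgSmall⟩, ⟨Y.tangKretShin h₁₀, Y.tangLemma63 b⟩⟩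

/-- SECOND READING — C320 / C321 FROM THE BOOK's INPUTS (`BookInputs.everything`), rows C5 (★) and C10 being delivered from the same inputs by tranche 1's `chenevierLannes_of_leaves` / `kretShin_of_leaves`; nothing of Mok's or KMSW's. [cite: CleryVanDerGeer2018Chenevier, App. A; Tang2021SpinMotivic, §6, Lemma 6.3 (bookkeeping proved here)] -/
theorem chenevierTang_of_inputs (Y : Implications166 ν c c₁₆₆) (I : Implications ν μ κ c) (A : BookInputs ν) :
    (c₁₆₆.ChenWeight1LevelOne ∧ c₁₆₆.ChenLemmaA2 ∧ c₁₆₆.ChenLemmaA3Top ∧ c₁₆₆.ChenWeight2LevelOne ∧ c₁₆₆.ChenThmA5) ∧ (c₁₆₆.TangKretShinSpin ∧ c₁₆₆.TangLemma63) :=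
  chenevierTang_of_rows Y A.everything (chenevierLannes_of_leaves I A) (kretShin_of_leaves I A)

/-- ROWS C320 AND C321 IN CONDITIONAL FORM, 2026 (both PUBLISHED, 2018 / 2021; no status sentence on the book — census class G-i): granting the book's edges, supplies and PUBLISHED inputs and tranche 1's edges, Chenevier's Appendix-A statements and Tang's §6 / Lemma 6.3 are conditional on the book's 2024–2026 PREPRINT layer and its general and non-standard weighted fundamental lemmas; the five controls are unconditional. [cite: CleryVanDerGeer2018Chenevier, App. A (arXiv:1709.01748v1 p0017:L44); Tang2021SpinMotivic, Lemma 6.3 (arXiv:2006.03585 p0017:L23-24) (bookkeeping proved here)] -/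
theorem chenevierTang_conditional_form_2026 (Y : Implications166 ν c c₁₆₆) (I : Implications ν μ κ c) (B : ν.BookEdges) (S : ν.SupplyEdges) (P : ν.PublishedLeaves) :
    (c₁₆₆.CvdGWeight2Vanishing ∧ c₁₆₆.CvdGSmallWeights ∧ c₁₆₆.ChenLemmaA3Low ∧ c₁₆₆.ChenAppBYoshida ∧ c₁₆₆.TangSpinSystems) ∧
    (ν.PreprintLeaves2026 → ν.WFL_general → ν.WFL_nonstandard →
      (c₁₆₆.ChenWeight1LevelOne ∧ c₁₆₆.ChenLemmaA2 ∧ c₁₆₆.ChenLemmaA3Top ∧ c₁₆₆.ChenWeight2LevelOne ∧ c₁₆₆.ChenThmA5) ∧ (c₁₆₆.TangKretShinSpin ∧ c₁₆₆.TangLemma63)) :=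
  ⟨hundredsixtysixth_controls Y, fun hQ h₆ h₇ => chenevierTang_of_inputs Y I ⟨B, S, P, hQ, ⟨h₆, h₇⟩⟩⟩

end Tranche166

end Downstream

end Literature.NumberTheory.Automorphic.Arthur2013
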